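import Mathlib

/-!
# SignPencilChowClass — §9–§13 of `SignPencilSketch` (crux idea #9 `sign-pencil`, stmt-ValiantsHypothesis-24813)

val-idea-19 g9 (planner, crux-ideate style).  HONEST LABEL: nothing here proves `LaplaceOptimalFive`,
`LaplaceBridging` or VP ≠ VNP.  Companion to `Cruxes/LaplaceOptimalFive/SignPencilSketch.lean` (rev 11),
kept separate only because of the workfile size cap; self-contained (`import Mathlib`; the tables `th`,
`om`, `e0` below are verbatim copies of the sketch's §0/§2d tables).

## THEOREM A — K1 on the whole `GL₅`-CLASS of the hub configuration (kernel, 0 sorry)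

Up to `SignPencilSketch` rev 10 every K1 instance (§2b–§2d, §7 there) was ONE configuration with
arbitrary long factors.  This file proves K1 for a 25-parameter FAMILY at once: the orbit of the hub
short-factor system under the diagonal action of `GL₅(ℂ)` on the letters (and with it the orbits of the
`2222` star design and of every configuration whose short factors lie in `span{θ⊗V, ω}` on the rays `{0,k}`
and in `ℂθ` on the slice `{0}`).

**Theorem A** (`chow_not_InLhub`, `K1_hubClass`, `K1_star2222Class`).  For every invertible
`G ∈ ℂ^{5×5}` and all long factors `Y : V⁴ → ℂ`, `W₀…W₃ : V³ → ℂ`: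
`G·P₅ ≠ θ⊗Y + Σ_k ω_{0k}⊗W_k`, where `(G·P₅)(v) = per G[v,:] = Σ_σ Π_i G_{v_i σ(i)}` is the permutation
pattern transported by `G` acting diagonally (defined here by RYSER's formula, `chow`; spot checks in kernel:
`per J = 120`, `chow 1 = P₅` on an injective and a non-injective word).  Equivalently: no configuration
`g·U_hub`, `g ∈ GL₅`, carries `P₅` — although each carries `D₅` (`δ = 1` is `GL₅`-invariant, `g·D₅ =
det g·D₅`).  So the card's K1 («`δ = 1 ⟹ ¬P`») holds on a positive-dimensional family inside S3′'s
asymmetric D-feasible sub-sector, not only at isolated designs; the two-word certificate alone could not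
give this (it is not `GL₅`-invariant) — the new input is the SUPPORT ARGUMENT (1)+(3) below.

Proof (all in kernel).  (1) SUPPORT: every `X ∈ L(U_hub)` vanishes at the words `v` with `v₀ ≠ 4` and
`v_k ≠ p(v₀)` (`p = (0 1)(2 3)`), since there `θ(v₀) = ω(v₀,v_k) = 0` (`InLhub.support`).
(2) EXPANSION: for `y ∈ ℂ⁵`, `Σ_{w∈[5]⁴} y_{w₁}⋯y_{w₄}·chow G (a,w) = R(G_a, ℓ(y))`, `ℓ(y) = yᵀG`, where
`R(r,u) = Σ_ε (−1)^{5−|ε|}(ε·r)(ε·u)⁴ = 24·D(r,u)`, `D(r,u) = Σ_j r_j Π_{j'≠j} u_{j'}` (`expansion`,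
`R_eq_D` — a 32-term polynomial identity closed by `ring`).  If `chow G ∈ L(U_hub)`, take `a = p(b)`,
`b ≤ 3`, and `y` with `y_b = 0`: by (1) the left side vanishes termwise, so `D(G_a, u) = 0` for every `u`
orthogonal to column `b` of `G⁻¹` (`hyperplane`).  (3) CORE LEMMA (`core`): if `μ_{i₀} ≠ 0`, `μ·r = 0` and
`D(r,·) ≡ 0` on `μ^⊥`, then `r_{i₀} = 0`, and `r = 0` as soon as `μ` has a second nonzero entry —
seventeen explicit points of `μ^⊥` (no division) give `r_j μ_l = 0` (`j ≠ l`) and `2μ_{i₀}r_{i₀} = 0`.  A row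
of an invertible `G` is nonzero, so column `b` of `G⁻¹` is a coordinate vector, i.e. some column `c_b` of `G`
is supported on row `b` (`column_supported`), for each `b ≤ 3`, with `c_0,…,c_3` distinct; let `c_4` be the
fifth index; row 4 of `G` forces `G_{4c_4} ≠ 0`.  (4) EVALUATION: `chow` is invariant under column
permutations (`chow_reindex`, reindexing `ε ↦ ε∘π`) and symmetric in the word, and on the resulting normal
form Ryser's sum collapses to the product of the five pivots (`chow_normalForm`, by `ring`):
`chow G (2,3,0,1,4) = chow G (3,2,0,1,4) = Π_b G_{b c_b} ≠ 0`.  (5) But the TWO-WORD CERTIFICATE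
`X(2,3,0,1,4) + X(3,2,0,1,4) = 0` holds on `L(U_hub)` (`InLhub.twoWord`) — contradiction.

## THEOREM B (rev 2, §10) — the same for the two-hub `84` configuration (`SixTail`)

`L(U_84) = Σ_{k=1..4} ω(v₀,v_k)⊗V³ + Σ_{k=2..4} ω(v₁,v_k)⊗V³` (the weight-84 exact design of `D₅` of the
sketch's §2d, long factors arbitrary).  **Theorem B** (`chow_not_InL84`, `K1_twohub84Class`): for every
invertible `G`, `G·P₅ ∉ L(U_84)`.  Its support set is thinner than the hub's (no slice), but it contains ALL
words `(4,4,*,*,*)`: so `per[G_4;G_4;u;u;u] = 6·D₂(G_4,G_4,u) ≡ 0` (`expansion3`, `R2_eq_D2`), which forces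
row 4 of `G` onto a single column (`row_four_products`); after a column permutation (`chow_reindex`,
`Matrix.det_permute'`) that column is 4, `(G G⁻¹)_{4b} = 0` kills `(G⁻¹)_{4b}` for `b ≤ 3`, and the words
`(a,4,w)`, `w_k ≠ p(a)`, give `D₂(G_a, G_4, u) = 0` on the hyperplane `u ⊥ (G⁻¹)_{·,p(a)}`; the identity
`u₄·D₂(G_a, g·e₄, u) = g·D(r°,u)`, `r° = (G_{a0},…,G_{a3},0)`, feeds the CORE LEMMA of §9 (`r° = 0` would make
rows `a`, `4` proportional — `Matrix.det_updateRow_add_smul_self`), and the column normal form + two-word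
certificate finish exactly as in Theorem A (`column_supported84`, `chow_not_InL84_normalised`).

## THEOREM C (rev 3, §11) — K1 on the ENTIRE hub PROFILE (kernel, 0 sorry)

The hub profile is the split system `{0}, {0,1}, {0,2}, {0,3}, {0,4}` (one term each, weight
`1!4! + 4·2!3! = 72`, the contested value).  A configuration of this profile is `U = (θ; C₀,…,C₃)`: an
ARBITRARY covector `θ ∈ V*` on the slice (ghost `θ = 0` allowed) and ARBITRARY bilinear short factors
`C_k(v₀, v_k)` on the rays (any rank, symmetric parts allowed); `L(U) = θ⊗V⁴* + Σ_k C_k⊗V³*` (long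
factors free).  `HubD θ C` := `D₅ ∈ L(U)`, `HubP θ C` := `P₅ ∈ L(U)` (`D₅ = levW`, the determinant of the
`0/1` word matrix, `levW_eq_det`; `P₅ = chow 1`).
**Theorem C** (`K1_hubProfile`): `HubD θ C → HubP θ C → False` — NO configuration of the hub profile that
carries `D₅` carries `P₅`.  This is K1 («`δ = 1 ⟹ ¬P`») on a whole PROFILE (all short factors at once), the
reach the critic priced after Theorem A (REACH (3), bus 03:33:10Z: the D-feasible family on the hub profile is
strictly larger than `GL₅·U_hub`); Theorems A and A′ are the special cases `U ∈ GL₅·U_hub`, `GL₅·U_2222`.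
Proof (kernel): read tables as multilinear forms (`evalD`: `det[λ;x₀;…;x₃] = Σ_w λ x₀ x₁ x₂ x₃ · D₅(w)`;
`evalP`: `Σ_w λ x x x x · P₅(w) = per[λ;x;x;x;x] = 24·D(λ,x)`); for `λ ∈ ker θ ∖ 0` put `n_k := C_k(λ,·)`
(`nvec`).  (1) `HubD.eval` / `HubP.eval`: `det[λ;x₀;…;x₃] = 0` whenever `x_k ⊥ n_k`, and `D(λ,x) = 0`
whenever `x ⊥ n_k ∀k` (the slice and ray terms factor through `θ(λ)`, `C_k(λ,x_k)`: `factorS`, `factor0–3`).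
(2) ALIGNMENT (`aligned_of_hubD`, pure linear algebra, `align_core`): choosing `a, b, c` successively in
the hyperplanes `n_A^⊥, n_B^⊥, n_C^⊥` independent of `λ` and of each other (dimension count, `exists_not_mem`),
`det[d;c;b;a;λ] = 0 ∀ d ⊥ n_D` forces `n_D^⊥ ⊆ span{c,b,a,λ}` (`Matrix.linearIndependent_rows_iff_isUnit`),
hence `n_D ≠ 0`, `n_D^⊥ = span{c,b,a,λ} ∋ λ, a`; running this over the four role assignments (row
permutations `σ0–σ3`, `Matrix.det_permute`): all `n_k ≠ 0`, `n_k·λ = 0`, and `n_0^⊥ ⊆ n_k^⊥` (`Aligned`).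
(3) With `H = n_0(λ)^⊥ ∋ λ`: `D(λ,·) ≡ 0` on `H`, so the CORE LEMMA of §9 (`core`) puts `n_0(λ)` on a
coordinate axis `e_{i(λ)}` with `λ_{i(λ)} = 0`.  (4) `λ ↦ n_0(λ)` is linear and nonzero on `ker θ ∖ 0`
(`dim ker θ ≥ 4 ≥ 2`, `exists_pair`): two independent `κ₁, κ₂ ∈ ker θ` have `n_0(κ₁) = αe_i`, `n_0(κ₂) = βe_j`,
and `n_0(κ₁+κ₂)` on an axis forces `i = j`, whence `n_0(βκ₁ − ακ₂) = 0` with `βκ₁ − ακ₂ ≠ 0` — contradiction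
(`K1_hub_of_aligned`).  Sanity (kernel): `levW(01234) = 1`, `levW(10234) = −1`, `levW(00234) = 0`.
NON-VACUITY (rev 4, §12, kernel): `levW = sgn5` (the sketch's `D₅` table) on EVERY word (`levW_eq_sgn5`, via
`Matrix.det_permutation` + a 120-case `decide`), so the sketch's hub configuration `(θ; ω,ω,ω,ω)` is a `HubD` instance
(`hubD_hub`, long factors `Ω`, `±θ∧ω` = the weight-72 hub design `hub_design`), and `K1_hubProfile` re-derives
`¬ HubP` for it (`hub_not_HubP`, Theorem A at `G = 1`).
WORD CURRENCY (rev 5, §13, kernel; the critic's bookkeeping price b1): `chow_one_word : chow 1 a b c d e =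
if Function.Injective ![a,b,c,d,e] then 1 else 0` on ALL words (structural: at `G = 1` the Ryser row sums are the
bits; a missing letter gives a sign-reversing bit-flip involution, an injective word is a permutation and reindexes
to the identity word), so `HubP ↔ HubPword` (`hubP_iff_word`) and THEOREM C reads in the crux's own currency
(`K1_hubProfile_word`: `HubD θ C → HubPword θ C → False`).

TOGETHER: K1 holds on the ENTIRE hub profile (Theorem C) and on the `GL₅`-orbits of ALL THREE exact designs of `D₅` on record — hub 72 (slice),
star 96 (`⊂ StarTail`), two-hub 84 (`⊂ SixTail`) — with arbitrary long factors: positive-dimensional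
families of asymmetric D-feasible configurations on BOTH LM tail profiles carry no `P₅`.

HONEST SCOPE.  K1 on the hub PROFILE (all its D-feasible configurations) and on the `GL₅`-orbits named,
nothing more: no statement about ALL D-feasible configurations of the StarTail / SixTail profiles (K1 there
stays open), nor about profiles of weight `< 120` in general, nor `LaplaceOptimalFive`.  24813 stays
OPEN · CONTESTED 72/120; VP ≠ VNP is NOT proved.
-/

set_option linter.dupNamespace false

namespace Summit.ValiantsHypothesis.ValiantsHypothesis.Cruxes.LaplaceOptimalFive.SignPencil.ChowClass
open Finset

theorem sum_vecCons {α M : Type*} [Fintype α] [AddCommMonoid M] (n : ℕ) (f : (Fin (n+1) → α) → M) :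
    ∑ e, f e = ∑ a, ∑ e' : Fin n → α, f (Matrix.vecCons a e') := by
  rw [← Fintype.sum_prod_type']
  refine Fintype.sum_equiv (Fin.consEquiv fun _ => α).symm _ _ (fun x => ?_)
  simp only [Fin.consEquiv, Equiv.coe_fn_symm_mk, Matrix.vecCons, Fin.cons_self_tail]

theorem sum_fin0 {α M : Type*} [Fintype α] [AddCommMonoid M] (f : (Fin 0 → α) → M) :
    ∑ e, f e = f ![] := by
  rw [Fintype.sum_unique]; exact congrArg f (Subsingleton.elim _ _)

/-- sign `(−1)^{5−|e|}` -/
def rsgn (e : Fin 5 → Fin 2) : ℂ :=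
  (-1) ^ (5 - ((e 0).val + (e 1).val + (e 2).val + (e 3).val + (e 4).val))

/-- `e·x` -/
def edot (e : Fin 5 → Fin 2) (x : Fin 5 → ℂ) : ℂ :=
  ((e 0).val : ℂ) * x 0 + ((e 1).val : ℂ) * x 1 + ((e 2).val : ℂ) * x 2 + ((e 3).val : ℂ) * x 3
    + ((e 4).val : ℂ) * x 4

/-- Ryser functional `R(r,u) = per[r;u;u;u;u]`. -/
def R (r u : Fin 5 → ℂ) : ℂ := ∑ e : Fin 5 → Fin 2, rsgn e * (edot e r * edot e u ^ 4)

/-- `D(r,u) = Σ_j r_j Π_{j'≠j} u_{j'}`. -/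
def D (r u : Fin 5 → ℂ) : ℂ :=
  r 0 * (u 1 * u 2 * u 3 * u 4) + r 1 * (u 0 * u 2 * u 3 * u 4) + r 2 * (u 0 * u 1 * u 3 * u 4)
    + r 3 * (u 0 * u 1 * u 2 * u 4) + r 4 * (u 0 * u 1 * u 2 * u 3)

theorem sum32 (f : (Fin 5 → Fin 2) → ℂ) : ∑ e, f e =
    ∑ a, ∑ b, ∑ c, ∑ d, ∑ e', f ![a, b, c, d, e'] := by
  rw [sum_vecCons]; refine sum_congr rfl fun a _ => ?_
  rw [sum_vecCons]; refine sum_congr rfl fun b _ => ?_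
  rw [sum_vecCons]; refine sum_congr rfl fun c _ => ?_
  rw [sum_vecCons]; refine sum_congr rfl fun d _ => ?_
  rw [sum_vecCons]; refine sum_congr rfl fun e' _ => ?_
  rw [sum_fin0]

theorem R_eq_D (r u : Fin 5 → ℂ) : R r u = 24 * D r u := by
  unfold R; rw [sum32]
  simp only [Fin.sum_univ_two, rsgn, edot, D, Matrix.cons_val_zero, Matrix.cons_val_one,
    Matrix.cons_val_two, Matrix.cons_val_three, Matrix.cons_val_four, Matrix.head_cons,
    Matrix.tail_cons, Fin.val_zero, Fin.val_one, Fin.isValue, Nat.cast_zero, Nat.cast_one]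
  norm_num
  ring

/-! ### the hub configuration's linear span (tables = `SignPencilSketch` §0) `L(U_hub) = θ⊗V⁴ + Σ_k ω_{0k}⊗V³` over `ℂ` -/

def th (x : Fin 5) : ℤ := if x = 4 then 1 else 0
def om (x y : Fin 5) : ℤ :=
  if x = 0 ∧ y = 1 then 1 else if x = 1 ∧ y = 0 then -1
  else if x = 2 ∧ y = 3 then 1 else if x = 3 ∧ y = 2 then -1 else 0

/-- partner letter: `ω(a,x) ≠ 0 ⟹ x = pr a` (`pr 4` is immaterial). -/
def pr : Fin 5 → Fin 5 := ![1, 0, 3, 2, 0]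

theorem om_eq_zero_of_ne : ∀ a x : Fin 5, x ≠ pr a → om a x = 0 := by decide
theorem th_eq_zero_of_ne : ∀ a : Fin 5, a ≠ 4 → th a = 0 := by decide
theorem pr_pr : ∀ b : Fin 5, b ≠ 4 → pr (pr b) = b := by decide
theorem pr_ne_four : ∀ b : Fin 5, pr b ≠ 4 := by decide
theorem pr_ne_self : ∀ b : Fin 5, b ≠ 4 → pr b ≠ b := by decide

/-- `X ∈ L(U_hub)`: `X = θ(v₀)·Y(v₁..v₄) + Σ_k ω(v₀,v_k)·W_k(rest)`, long factors arbitrary. -/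
def InLhub (X : Fin 5 → Fin 5 → Fin 5 → Fin 5 → Fin 5 → ℂ) : Prop :=
  ∃ (Y : Fin 5 → Fin 5 → Fin 5 → Fin 5 → ℂ) (W : Fin 4 → Fin 5 → Fin 5 → Fin 5 → ℂ),
    ∀ a b c d e, X a b c d e = (th a : ℂ) * Y b c d e + (om a b : ℂ) * W 0 c d e
      + (om a c : ℂ) * W 1 b d e + (om a d : ℂ) * W 2 b c e + (om a e : ℂ) * W 3 b c d

/-- SUPPORT: every member of `L(U_hub)` vanishes on `Z = {v : v₀ ≠ 4, v_k ≠ pr v₀}`. -/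
theorem InLhub.support {X} (hX : InLhub X) (a b c d e : Fin 5) (ha : a ≠ 4) (hb : b ≠ pr a)
    (hc : c ≠ pr a) (hd : d ≠ pr a) (he : e ≠ pr a) : X a b c d e = 0 := by
  obtain ⟨Y, W, h⟩ := hX
  rw [h, th_eq_zero_of_ne a ha, om_eq_zero_of_ne a b hb, om_eq_zero_of_ne a c hc,
    om_eq_zero_of_ne a d hd, om_eq_zero_of_ne a e he]
  simp

theorem om23 : om 2 3 = 1 := by decide
theorem om32 : om 3 2 = -1 := by decide

/-- TWO-WORD CERTIFICATE: `X(2,3,0,1,4) + X(3,2,0,1,4) = 0` on `L(U_hub)`. -/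
theorem InLhub.twoWord {X} (hX : InLhub X) : X 2 3 0 1 4 + X 3 2 0 1 4 = 0 := by
  obtain ⟨Y, W, h⟩ := hX
  rw [h, h, th_eq_zero_of_ne 2 (by decide), th_eq_zero_of_ne 3 (by decide), om23, om32,
    om_eq_zero_of_ne 2 0 (by decide), om_eq_zero_of_ne 2 1 (by decide),
    om_eq_zero_of_ne 2 4 (by decide), om_eq_zero_of_ne 3 0 (by decide),
    om_eq_zero_of_ne 3 1 (by decide), om_eq_zero_of_ne 3 4 (by decide)]
  push_cast; ring

/-! ### the Chow tensor of five linear forms (Ryser form of `g·P₅`) -/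

/-- `rd ε G x = Σ_j ε_j G_{xj}` (row sum over the column subset `ε`). -/
def rd (ε : Fin 5 → Fin 2) (G : Matrix (Fin 5) (Fin 5) ℂ) (x : Fin 5) : ℂ := edot ε (G x)

/-- `chow G v := Σ_{ε∈{0,1}⁵} (−1)^{5−|ε|} Π_i (Σ_j ε_j G_{v_i j})` — by RYSER'S FORMULA this is the
permanent of the row selection `G[v,:]`, i.e. `(G·P₅)(v) = Σ_σ Π_i G_{v_i σ(i)}`, the pattern `P₅`
transformed by the diagonal action of `G`, equivalently the polarisation of the product of the five linear
forms given by the columns of `G`. -/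
def chow (G : Matrix (Fin 5) (Fin 5) ℂ) (a b c d e : Fin 5) : ℂ :=
  ∑ ε : Fin 5 → Fin 2, rsgn ε * (rd ε G a * (rd ε G b * rd ε G c * rd ε G d * rd ε G e))

/-- the forms: `ℓ y j = Σ_x y_x G_{xj}`. -/
def ell (G : Matrix (Fin 5) (Fin 5) ℂ) (y : Fin 5 → ℂ) (j : Fin 5) : ℂ := ∑ x, y x * G x j

theorem sum_mul_rd (G : Matrix (Fin 5) (Fin 5) ℂ) (ε : Fin 5 → Fin 2) (y : Fin 5 → ℂ) :
    ∑ x, y x * rd ε G x = edot ε (ell G y) := by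
  simp only [rd, edot, ell, mul_add, Finset.sum_add_distrib, Finset.mul_sum]
  have h : ∀ (c : ℂ) (j : Fin 5), ∑ x, y x * (c * G x j) = ∑ x, c * (y x * G x j) :=
    fun c j => Finset.sum_congr rfl (fun x _ => by ring)
  simp only [h]

/-- EXPANSION: `Σ_{w'} (Π_k y_{w'_k}) · chow G (a,w') = R(G_a, ℓ(y))` (`= per[G_a; ℓ(y)×4]`). -/
theorem expansion (G : Matrix (Fin 5) (Fin 5) ℂ) (a : Fin 5) (y : Fin 5 → ℂ) :
    ∑ w : Fin 4 → Fin 5, (∏ k, y (w k)) * chow G a (w 0) (w 1) (w 2) (w 3)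
      = R (G a) (ell G y) := by
  have step1 : ∀ w : Fin 4 → Fin 5, (∏ k, y (w k)) * chow G a (w 0) (w 1) (w 2) (w 3)
      = ∑ ε : Fin 5 → Fin 2, rsgn ε * rd ε G a * ∏ k, (y (w k) * rd ε G (w k)) := by
    intro w
    simp only [chow, Finset.mul_sum, Fin.prod_univ_four]
    exact Finset.sum_congr rfl (fun ε _ => by ring)
  simp_rw [step1]
  rw [Finset.sum_comm]
  unfold R
  refine Finset.sum_congr rfl (fun ε _ => ?_)
  rw [← Finset.mul_sum, ← Fintype.prod_sum (fun (_ : Fin 4) (x : Fin 5) => y x * rd ε G x)]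
  simp only [sum_mul_rd, Finset.prod_const, Finset.card_univ, Fintype.card_fin]
  simp [rd]; ring

/-! ### CORE LEMMA: `D(r,·) ≡ 0` on the hyperplane `μ^⊥ ∋ r` forces `μ` to be a coordinate vector -/

theorem core0 (μ r : Fin 5 → ℂ) (hi : μ 0 ≠ 0)
    (hr : r 0 * μ 0 + r 1 * μ 1 + r 2 * μ 2 + r 3 * μ 3 + r 4 * μ 4 = 0)
    (hP : ∀ u : Fin 5 → ℂ, μ 0 * u 0 + μ 1 * u 1 + μ 2 * u 2 + μ 3 * u 3 + μ 4 * u 4 = 0 → D r u = 0) :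
    r 0 = 0 ∧ ∀ l : Fin 5, l ≠ 0 → μ l ≠ 0 → r = 0 := by
  have EA : μ 0 * r 0 - (μ 1 + μ 2 + μ 3 + μ 4) * (r 1 + r 2 + r 3 + r 4) = 0 := by
    have h := hP ![-(μ 1 + μ 2 + μ 3 + μ 4), μ 0, μ 0, μ 0, μ 0] (by simp only [Matrix.cons_val_zero, Matrix.cons_val_one, Matrix.cons_val_two, Matrix.cons_val_three, Matrix.cons_val_four, Matrix.head_cons, Matrix.tail_cons]; ring)
    simp only [D, Matrix.cons_val_zero, Matrix.cons_val_one, Matrix.cons_val_two, Matrix.cons_val_three, Matrix.cons_val_four, Matrix.head_cons, Matrix.tail_cons] at h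
    have h' : μ 0 ^ 3 * (μ 0 * r 0 - (μ 1 + μ 2 + μ 3 + μ 4) * (r 1 + r 2 + r 3 + r 4)) = 0 := by
      linear_combination h
    exact (mul_eq_zero.mp h').resolve_left (pow_ne_zero 3 hi)
  have E1 : r 1 * (μ 2 + μ 3 + μ 4) = 0 := by
    have h := hP ![-(μ 2 + μ 3 + μ 4), 0, μ 0, μ 0, μ 0] (by simp only [Matrix.cons_val_zero, Matrix.cons_val_one, Matrix.cons_val_two, Matrix.cons_val_three, Matrix.cons_val_four, Matrix.head_cons, Matrix.tail_cons]; ring)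
    simp only [D, Matrix.cons_val_zero, Matrix.cons_val_one, Matrix.cons_val_two, Matrix.cons_val_three, Matrix.cons_val_four, Matrix.head_cons, Matrix.tail_cons] at h
    have h' : μ 0 ^ 3 * (r 1 * (μ 2 + μ 3 + μ 4)) = 0 := by linear_combination (-1 : ℂ) * h
    exact (mul_eq_zero.mp h').resolve_left (pow_ne_zero 3 hi)
  have P12 : r 1 * μ 2 = 0 := by
    have h := hP ![-(2 * μ 2 + μ 3 + μ 4), 0, 2 * μ 0, μ 0, μ 0] (by simp only [Matrix.cons_val_zero, Matrix.cons_val_one, Matrix.cons_val_two, Matrix.cons_val_three, Matrix.cons_val_four, Matrix.head_cons, Matrix.tail_cons]; ring)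
    simp only [D, Matrix.cons_val_zero, Matrix.cons_val_one, Matrix.cons_val_two, Matrix.cons_val_three, Matrix.cons_val_four, Matrix.head_cons, Matrix.tail_cons] at h
    have h' : μ 0 ^ 3 * (r 1 * (2 * μ 2 + μ 3 + μ 4)) = 0 := by
      linear_combination (-1/2 : ℂ) * h
    have h'' := (mul_eq_zero.mp h').resolve_left (pow_ne_zero 3 hi)
    linear_combination h'' - E1
  have P13 : r 1 * μ 3 = 0 := by
    have h := hP ![-(2 * μ 3 + μ 2 + μ 4), 0, μ 0, 2 * μ 0, μ 0] (by simp only [Matrix.cons_val_zero, Matrix.cons_val_one, Matrix.cons_val_two, Matrix.cons_val_three, Matrix.cons_val_four, Matrix.head_cons, Matrix.tail_cons]; ring)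
    simp only [D, Matrix.cons_val_zero, Matrix.cons_val_one, Matrix.cons_val_two, Matrix.cons_val_three, Matrix.cons_val_four, Matrix.head_cons, Matrix.tail_cons] at h
    have h' : μ 0 ^ 3 * (r 1 * (2 * μ 3 + μ 2 + μ 4)) = 0 := by
      linear_combination (-1/2 : ℂ) * h
    have h'' := (mul_eq_zero.mp h').resolve_left (pow_ne_zero 3 hi)
    linear_combination h'' - E1
  have P14 : r 1 * μ 4 = 0 := by
    have h := hP ![-(2 * μ 4 + μ 2 + μ 3), 0, μ 0, μ 0, 2 * μ 0] (by simp only [Matrix.cons_val_zero, Matrix.cons_val_one, Matrix.cons_val_two, Matrix.cons_val_three, Matrix.cons_val_four, Matrix.head_cons, Matrix.tail_cons]; ring)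
    simp only [D, Matrix.cons_val_zero, Matrix.cons_val_one, Matrix.cons_val_two, Matrix.cons_val_three, Matrix.cons_val_four, Matrix.head_cons, Matrix.tail_cons] at h
    have h' : μ 0 ^ 3 * (r 1 * (2 * μ 4 + μ 2 + μ 3)) = 0 := by
      linear_combination (-1/2 : ℂ) * h
    have h'' := (mul_eq_zero.mp h').resolve_left (pow_ne_zero 3 hi)
    linear_combination h'' - E1
  have E2 : r 2 * (μ 1 + μ 3 + μ 4) = 0 := by
    have h := hP ![-(μ 1 + μ 3 + μ 4), μ 0, 0, μ 0, μ 0] (by simp only [Matrix.cons_val_zero, Matrix.cons_val_one, Matrix.cons_val_two, Matrix.cons_val_three, Matrix.cons_val_four, Matrix.head_cons, Matrix.tail_cons]; ring)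
    simp only [D, Matrix.cons_val_zero, Matrix.cons_val_one, Matrix.cons_val_two, Matrix.cons_val_three, Matrix.cons_val_four, Matrix.head_cons, Matrix.tail_cons] at h
    have h' : μ 0 ^ 3 * (r 2 * (μ 1 + μ 3 + μ 4)) = 0 := by linear_combination (-1 : ℂ) * h
    exact (mul_eq_zero.mp h').resolve_left (pow_ne_zero 3 hi)
  have P21 : r 2 * μ 1 = 0 := by
    have h := hP ![-(2 * μ 1 + μ 3 + μ 4), 2 * μ 0, 0, μ 0, μ 0] (by simp only [Matrix.cons_val_zero, Matrix.cons_val_one, Matrix.cons_val_two, Matrix.cons_val_three, Matrix.cons_val_four, Matrix.head_cons, Matrix.tail_cons]; ring)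
    simp only [D, Matrix.cons_val_zero, Matrix.cons_val_one, Matrix.cons_val_two, Matrix.cons_val_three, Matrix.cons_val_four, Matrix.head_cons, Matrix.tail_cons] at h
    have h' : μ 0 ^ 3 * (r 2 * (2 * μ 1 + μ 3 + μ 4)) = 0 := by
      linear_combination (-1/2 : ℂ) * h
    have h'' := (mul_eq_zero.mp h').resolve_left (pow_ne_zero 3 hi)
    linear_combination h'' - E2
  have P23 : r 2 * μ 3 = 0 := by
    have h := hP ![-(2 * μ 3 + μ 1 + μ 4), μ 0, 0, 2 * μ 0, μ 0] (by simp only [Matrix.cons_val_zero, Matrix.cons_val_one, Matrix.cons_val_two, Matrix.cons_val_three, Matrix.cons_val_four, Matrix.head_cons, Matrix.tail_cons]; ring)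
    simp only [D, Matrix.cons_val_zero, Matrix.cons_val_one, Matrix.cons_val_two, Matrix.cons_val_three, Matrix.cons_val_four, Matrix.head_cons, Matrix.tail_cons] at h
    have h' : μ 0 ^ 3 * (r 2 * (2 * μ 3 + μ 1 + μ 4)) = 0 := by
      linear_combination (-1/2 : ℂ) * h
    have h'' := (mul_eq_zero.mp h').resolve_left (pow_ne_zero 3 hi)
    linear_combination h'' - E2
  have P24 : r 2 * μ 4 = 0 := by
    have h := hP ![-(2 * μ 4 + μ 1 + μ 3), μ 0, 0, μ 0, 2 * μ 0] (by simp only [Matrix.cons_val_zero, Matrix.cons_val_one, Matrix.cons_val_two, Matrix.cons_val_three, Matrix.cons_val_four, Matrix.head_cons, Matrix.tail_cons]; ring)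
    simp only [D, Matrix.cons_val_zero, Matrix.cons_val_one, Matrix.cons_val_two, Matrix.cons_val_three, Matrix.cons_val_four, Matrix.head_cons, Matrix.tail_cons] at h
    have h' : μ 0 ^ 3 * (r 2 * (2 * μ 4 + μ 1 + μ 3)) = 0 := by
      linear_combination (-1/2 : ℂ) * h
    have h'' := (mul_eq_zero.mp h').resolve_left (pow_ne_zero 3 hi)
    linear_combination h'' - E2
  have E3 : r 3 * (μ 1 + μ 2 + μ 4) = 0 := by
    have h := hP ![-(μ 1 + μ 2 + μ 4), μ 0, μ 0, 0, μ 0] (by simp only [Matrix.cons_val_zero, Matrix.cons_val_one, Matrix.cons_val_two, Matrix.cons_val_three, Matrix.cons_val_four, Matrix.head_cons, Matrix.tail_cons]; ring)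
    simp only [D, Matrix.cons_val_zero, Matrix.cons_val_one, Matrix.cons_val_two, Matrix.cons_val_three, Matrix.cons_val_four, Matrix.head_cons, Matrix.tail_cons] at h
    have h' : μ 0 ^ 3 * (r 3 * (μ 1 + μ 2 + μ 4)) = 0 := by linear_combination (-1 : ℂ) * h
    exact (mul_eq_zero.mp h').resolve_left (pow_ne_zero 3 hi)
  have P31 : r 3 * μ 1 = 0 := by
    have h := hP ![-(2 * μ 1 + μ 2 + μ 4), 2 * μ 0, μ 0, 0, μ 0] (by simp only [Matrix.cons_val_zero, Matrix.cons_val_one, Matrix.cons_val_two, Matrix.cons_val_three, Matrix.cons_val_four, Matrix.head_cons, Matrix.tail_cons]; ring)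
    simp only [D, Matrix.cons_val_zero, Matrix.cons_val_one, Matrix.cons_val_two, Matrix.cons_val_three, Matrix.cons_val_four, Matrix.head_cons, Matrix.tail_cons] at h
    have h' : μ 0 ^ 3 * (r 3 * (2 * μ 1 + μ 2 + μ 4)) = 0 := by
      linear_combination (-1/2 : ℂ) * h
    have h'' := (mul_eq_zero.mp h').resolve_left (pow_ne_zero 3 hi)
    linear_combination h'' - E3
  have P32 : r 3 * μ 2 = 0 := by
    have h := hP ![-(2 * μ 2 + μ 1 + μ 4), μ 0, 2 * μ 0, 0, μ 0] (by simp only [Matrix.cons_val_zero, Matrix.cons_val_one, Matrix.cons_val_two, Matrix.cons_val_three, Matrix.cons_val_four, Matrix.head_cons, Matrix.tail_cons]; ring)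
    simp only [D, Matrix.cons_val_zero, Matrix.cons_val_one, Matrix.cons_val_two, Matrix.cons_val_three, Matrix.cons_val_four, Matrix.head_cons, Matrix.tail_cons] at h
    have h' : μ 0 ^ 3 * (r 3 * (2 * μ 2 + μ 1 + μ 4)) = 0 := by
      linear_combination (-1/2 : ℂ) * h
    have h'' := (mul_eq_zero.mp h').resolve_left (pow_ne_zero 3 hi)
    linear_combination h'' - E3
  have P34 : r 3 * μ 4 = 0 := by
    have h := hP ![-(2 * μ 4 + μ 1 + μ 2), μ 0, μ 0, 0, 2 * μ 0] (by simp only [Matrix.cons_val_zero, Matrix.cons_val_one, Matrix.cons_val_two, Matrix.cons_val_three, Matrix.cons_val_four, Matrix.head_cons, Matrix.tail_cons]; ring)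
    simp only [D, Matrix.cons_val_zero, Matrix.cons_val_one, Matrix.cons_val_two, Matrix.cons_val_three, Matrix.cons_val_four, Matrix.head_cons, Matrix.tail_cons] at h
    have h' : μ 0 ^ 3 * (r 3 * (2 * μ 4 + μ 1 + μ 2)) = 0 := by
      linear_combination (-1/2 : ℂ) * h
    have h'' := (mul_eq_zero.mp h').resolve_left (pow_ne_zero 3 hi)
    linear_combination h'' - E3
  have E4 : r 4 * (μ 1 + μ 2 + μ 3) = 0 := by
    have h := hP ![-(μ 1 + μ 2 + μ 3), μ 0, μ 0, μ 0, 0] (by simp only [Matrix.cons_val_zero, Matrix.cons_val_one, Matrix.cons_val_two, Matrix.cons_val_three, Matrix.cons_val_four, Matrix.head_cons, Matrix.tail_cons]; ring)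
    simp only [D, Matrix.cons_val_zero, Matrix.cons_val_one, Matrix.cons_val_two, Matrix.cons_val_three, Matrix.cons_val_four, Matrix.head_cons, Matrix.tail_cons] at h
    have h' : μ 0 ^ 3 * (r 4 * (μ 1 + μ 2 + μ 3)) = 0 := by linear_combination (-1 : ℂ) * h
    exact (mul_eq_zero.mp h').resolve_left (pow_ne_zero 3 hi)
  have P41 : r 4 * μ 1 = 0 := by
    have h := hP ![-(2 * μ 1 + μ 2 + μ 3), 2 * μ 0, μ 0, μ 0, 0] (by simp only [Matrix.cons_val_zero, Matrix.cons_val_one, Matrix.cons_val_two, Matrix.cons_val_three, Matrix.cons_val_four, Matrix.head_cons, Matrix.tail_cons]; ring)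
    simp only [D, Matrix.cons_val_zero, Matrix.cons_val_one, Matrix.cons_val_two, Matrix.cons_val_three, Matrix.cons_val_four, Matrix.head_cons, Matrix.tail_cons] at h
    have h' : μ 0 ^ 3 * (r 4 * (2 * μ 1 + μ 2 + μ 3)) = 0 := by
      linear_combination (-1/2 : ℂ) * h
    have h'' := (mul_eq_zero.mp h').resolve_left (pow_ne_zero 3 hi)
    linear_combination h'' - E4
  have P42 : r 4 * μ 2 = 0 := by
    have h := hP ![-(2 * μ 2 + μ 1 + μ 3), μ 0, 2 * μ 0, μ 0, 0] (by simp only [Matrix.cons_val_zero, Matrix.cons_val_one, Matrix.cons_val_two, Matrix.cons_val_three, Matrix.cons_val_four, Matrix.head_cons, Matrix.tail_cons]; ring)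
    simp only [D, Matrix.cons_val_zero, Matrix.cons_val_one, Matrix.cons_val_two, Matrix.cons_val_three, Matrix.cons_val_four, Matrix.head_cons, Matrix.tail_cons] at h
    have h' : μ 0 ^ 3 * (r 4 * (2 * μ 2 + μ 1 + μ 3)) = 0 := by
      linear_combination (-1/2 : ℂ) * h
    have h'' := (mul_eq_zero.mp h').resolve_left (pow_ne_zero 3 hi)
    linear_combination h'' - E4
  have P43 : r 4 * μ 3 = 0 := by
    have h := hP ![-(2 * μ 3 + μ 1 + μ 2), μ 0, μ 0, 2 * μ 0, 0] (by simp only [Matrix.cons_val_zero, Matrix.cons_val_one, Matrix.cons_val_two, Matrix.cons_val_three, Matrix.cons_val_four, Matrix.head_cons, Matrix.tail_cons]; ring)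
    simp only [D, Matrix.cons_val_zero, Matrix.cons_val_one, Matrix.cons_val_two, Matrix.cons_val_three, Matrix.cons_val_four, Matrix.head_cons, Matrix.tail_cons] at h
    have h' : μ 0 ^ 3 * (r 4 * (2 * μ 3 + μ 1 + μ 2)) = 0 := by
      linear_combination (-1/2 : ℂ) * h
    have h'' := (mul_eq_zero.mp h').resolve_left (pow_ne_zero 3 hi)
    linear_combination h'' - E4
  have hri : r 0 = 0 := by
    have h2 : μ 0 * (2 * r 0) = 0 := by
      linear_combination EA + hr + P12 + P13 + P14 + P21 + P23 + P24 + P31 + P32 + P34 + P41 + P42 + P43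
    have := (mul_eq_zero.mp h2).resolve_left hi
    have h3 : r 0 = (2 * r 0) / 2 := by ring
    rw [h3, this]; simp
  refine ⟨hri, fun l hl hμ => ?_⟩
  fin_cases l
  · exact absurd rfl hl
  · -- l = 1
    have hr2 : r 2 = 0 := (mul_eq_zero.mp P21).resolve_right hμ
    have hr3 : r 3 = 0 := (mul_eq_zero.mp P31).resolve_right hμ
    have hr4 : r 4 = 0 := (mul_eq_zero.mp P41).resolve_right hμ
    have hrl : r 1 * μ 1 = 0 := by
      have h := hr; rw [hri, hr2, hr3, hr4] at h; linear_combination h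
    have hr1 : r 1 = 0 := (mul_eq_zero.mp hrl).resolve_right hμ
    funext x; fin_cases x
    · exact hri
    · exact hr1
    · exact hr2
    · exact hr3
    · exact hr4
  · -- l = 2
    have hr1 : r 1 = 0 := (mul_eq_zero.mp P12).resolve_right hμ
    have hr3 : r 3 = 0 := (mul_eq_zero.mp P32).resolve_right hμ
    have hr4 : r 4 = 0 := (mul_eq_zero.mp P42).resolve_right hμ
    have hrl : r 2 * μ 2 = 0 := by
      have h := hr; rw [hri, hr1, hr3, hr4] at h; linear_combination h
    have hr2 : r 2 = 0 := (mul_eq_zero.mp hrl).resolve_right hμ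
    funext x; fin_cases x
    · exact hri
    · exact hr1
    · exact hr2
    · exact hr3
    · exact hr4
  · -- l = 3
    have hr1 : r 1 = 0 := (mul_eq_zero.mp P13).resolve_right hμ
    have hr2 : r 2 = 0 := (mul_eq_zero.mp P23).resolve_right hμ
    have hr4 : r 4 = 0 := (mul_eq_zero.mp P43).resolve_right hμ
    have hrl : r 3 * μ 3 = 0 := by
      have h := hr; rw [hri, hr1, hr2, hr4] at h; linear_combination h
    have hr3 : r 3 = 0 := (mul_eq_zero.mp hrl).resolve_right hμ
    funext x; fin_cases x
    · exact hri
    · exact hr1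
    · exact hr2
    · exact hr3
    · exact hr4
  · -- l = 4
    have hr1 : r 1 = 0 := (mul_eq_zero.mp P14).resolve_right hμ
    have hr2 : r 2 = 0 := (mul_eq_zero.mp P24).resolve_right hμ
    have hr3 : r 3 = 0 := (mul_eq_zero.mp P34).resolve_right hμ
    have hrl : r 4 * μ 4 = 0 := by
      have h := hr; rw [hri, hr1, hr2, hr3] at h; linear_combination h
    have hr4 : r 4 = 0 := (mul_eq_zero.mp hrl).resolve_right hμ
    funext x; fin_cases x
    · exact hri
    · exact hr1
    · exact hr2
    · exact hr3
    · exact hr4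

theorem core1 (μ r : Fin 5 → ℂ) (hi : μ 1 ≠ 0)
    (hr : r 0 * μ 0 + r 1 * μ 1 + r 2 * μ 2 + r 3 * μ 3 + r 4 * μ 4 = 0)
    (hP : ∀ u : Fin 5 → ℂ, μ 0 * u 0 + μ 1 * u 1 + μ 2 * u 2 + μ 3 * u 3 + μ 4 * u 4 = 0 → D r u = 0) :
    r 1 = 0 ∧ ∀ l : Fin 5, l ≠ 1 → μ l ≠ 0 → r = 0 := by
  have EA : μ 1 * r 1 - (μ 0 + μ 2 + μ 3 + μ 4) * (r 0 + r 2 + r 3 + r 4) = 0 := by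
    have h := hP ![μ 1, -(μ 0 + μ 2 + μ 3 + μ 4), μ 1, μ 1, μ 1] (by simp only [Matrix.cons_val_zero, Matrix.cons_val_one, Matrix.cons_val_two, Matrix.cons_val_three, Matrix.cons_val_four, Matrix.head_cons, Matrix.tail_cons]; ring)
    simp only [D, Matrix.cons_val_zero, Matrix.cons_val_one, Matrix.cons_val_two, Matrix.cons_val_three, Matrix.cons_val_four, Matrix.head_cons, Matrix.tail_cons] at h
    have h' : μ 1 ^ 3 * (μ 1 * r 1 - (μ 0 + μ 2 + μ 3 + μ 4) * (r 0 + r 2 + r 3 + r 4)) = 0 := by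
      linear_combination h
    exact (mul_eq_zero.mp h').resolve_left (pow_ne_zero 3 hi)
  have E0 : r 0 * (μ 2 + μ 3 + μ 4) = 0 := by
    have h := hP ![0, -(μ 2 + μ 3 + μ 4), μ 1, μ 1, μ 1] (by simp only [Matrix.cons_val_zero, Matrix.cons_val_one, Matrix.cons_val_two, Matrix.cons_val_three, Matrix.cons_val_four, Matrix.head_cons, Matrix.tail_cons]; ring)
    simp only [D, Matrix.cons_val_zero, Matrix.cons_val_one, Matrix.cons_val_two, Matrix.cons_val_three, Matrix.cons_val_four, Matrix.head_cons, Matrix.tail_cons] at h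
    have h' : μ 1 ^ 3 * (r 0 * (μ 2 + μ 3 + μ 4)) = 0 := by linear_combination (-1 : ℂ) * h
    exact (mul_eq_zero.mp h').resolve_left (pow_ne_zero 3 hi)
  have P02 : r 0 * μ 2 = 0 := by
    have h := hP ![0, -(2 * μ 2 + μ 3 + μ 4), 2 * μ 1, μ 1, μ 1] (by simp only [Matrix.cons_val_zero, Matrix.cons_val_one, Matrix.cons_val_two, Matrix.cons_val_three, Matrix.cons_val_four, Matrix.head_cons, Matrix.tail_cons]; ring)
    simp only [D, Matrix.cons_val_zero, Matrix.cons_val_one, Matrix.cons_val_two, Matrix.cons_val_three, Matrix.cons_val_four, Matrix.head_cons, Matrix.tail_cons] at h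
    have h' : μ 1 ^ 3 * (r 0 * (2 * μ 2 + μ 3 + μ 4)) = 0 := by
      linear_combination (-1/2 : ℂ) * h
    have h'' := (mul_eq_zero.mp h').resolve_left (pow_ne_zero 3 hi)
    linear_combination h'' - E0
  have P03 : r 0 * μ 3 = 0 := by
    have h := hP ![0, -(2 * μ 3 + μ 2 + μ 4), μ 1, 2 * μ 1, μ 1] (by simp only [Matrix.cons_val_zero, Matrix.cons_val_one, Matrix.cons_val_two, Matrix.cons_val_three, Matrix.cons_val_four, Matrix.head_cons, Matrix.tail_cons]; ring)
    simp only [D, Matrix.cons_val_zero, Matrix.cons_val_one, Matrix.cons_val_two, Matrix.cons_val_three, Matrix.cons_val_four, Matrix.head_cons, Matrix.tail_cons] at h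
    have h' : μ 1 ^ 3 * (r 0 * (2 * μ 3 + μ 2 + μ 4)) = 0 := by
      linear_combination (-1/2 : ℂ) * h
    have h'' := (mul_eq_zero.mp h').resolve_left (pow_ne_zero 3 hi)
    linear_combination h'' - E0
  have P04 : r 0 * μ 4 = 0 := by
    have h := hP ![0, -(2 * μ 4 + μ 2 + μ 3), μ 1, μ 1, 2 * μ 1] (by simp only [Matrix.cons_val_zero, Matrix.cons_val_one, Matrix.cons_val_two, Matrix.cons_val_three, Matrix.cons_val_four, Matrix.head_cons, Matrix.tail_cons]; ring)
    simp only [D, Matrix.cons_val_zero, Matrix.cons_val_one, Matrix.cons_val_two, Matrix.cons_val_three, Matrix.cons_val_four, Matrix.head_cons, Matrix.tail_cons] at h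
    have h' : μ 1 ^ 3 * (r 0 * (2 * μ 4 + μ 2 + μ 3)) = 0 := by
      linear_combination (-1/2 : ℂ) * h
    have h'' := (mul_eq_zero.mp h').resolve_left (pow_ne_zero 3 hi)
    linear_combination h'' - E0
  have E2 : r 2 * (μ 0 + μ 3 + μ 4) = 0 := by
    have h := hP ![μ 1, -(μ 0 + μ 3 + μ 4), 0, μ 1, μ 1] (by simp only [Matrix.cons_val_zero, Matrix.cons_val_one, Matrix.cons_val_two, Matrix.cons_val_three, Matrix.cons_val_four, Matrix.head_cons, Matrix.tail_cons]; ring)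
    simp only [D, Matrix.cons_val_zero, Matrix.cons_val_one, Matrix.cons_val_two, Matrix.cons_val_three, Matrix.cons_val_four, Matrix.head_cons, Matrix.tail_cons] at h
    have h' : μ 1 ^ 3 * (r 2 * (μ 0 + μ 3 + μ 4)) = 0 := by linear_combination (-1 : ℂ) * h
    exact (mul_eq_zero.mp h').resolve_left (pow_ne_zero 3 hi)
  have P20 : r 2 * μ 0 = 0 := by
    have h := hP ![2 * μ 1, -(2 * μ 0 + μ 3 + μ 4), 0, μ 1, μ 1] (by simp only [Matrix.cons_val_zero, Matrix.cons_val_one, Matrix.cons_val_two, Matrix.cons_val_three, Matrix.cons_val_four, Matrix.head_cons, Matrix.tail_cons]; ring)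
    simp only [D, Matrix.cons_val_zero, Matrix.cons_val_one, Matrix.cons_val_two, Matrix.cons_val_three, Matrix.cons_val_four, Matrix.head_cons, Matrix.tail_cons] at h
    have h' : μ 1 ^ 3 * (r 2 * (2 * μ 0 + μ 3 + μ 4)) = 0 := by
      linear_combination (-1/2 : ℂ) * h
    have h'' := (mul_eq_zero.mp h').resolve_left (pow_ne_zero 3 hi)
    linear_combination h'' - E2
  have P23 : r 2 * μ 3 = 0 := by
    have h := hP ![μ 1, -(2 * μ 3 + μ 0 + μ 4), 0, 2 * μ 1, μ 1] (by simp only [Matrix.cons_val_zero, Matrix.cons_val_one, Matrix.cons_val_two, Matrix.cons_val_three, Matrix.cons_val_four, Matrix.head_cons, Matrix.tail_cons]; ring)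
    simp only [D, Matrix.cons_val_zero, Matrix.cons_val_one, Matrix.cons_val_two, Matrix.cons_val_three, Matrix.cons_val_four, Matrix.head_cons, Matrix.tail_cons] at h
    have h' : μ 1 ^ 3 * (r 2 * (2 * μ 3 + μ 0 + μ 4)) = 0 := by
      linear_combination (-1/2 : ℂ) * h
    have h'' := (mul_eq_zero.mp h').resolve_left (pow_ne_zero 3 hi)
    linear_combination h'' - E2
  have P24 : r 2 * μ 4 = 0 := by
    have h := hP ![μ 1, -(2 * μ 4 + μ 0 + μ 3), 0, μ 1, 2 * μ 1] (by simp only [Matrix.cons_val_zero, Matrix.cons_val_one, Matrix.cons_val_two, Matrix.cons_val_three, Matrix.cons_val_four, Matrix.head_cons, Matrix.tail_cons]; ring)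
    simp only [D, Matrix.cons_val_zero, Matrix.cons_val_one, Matrix.cons_val_two, Matrix.cons_val_three, Matrix.cons_val_four, Matrix.head_cons, Matrix.tail_cons] at h
    have h' : μ 1 ^ 3 * (r 2 * (2 * μ 4 + μ 0 + μ 3)) = 0 := by
      linear_combination (-1/2 : ℂ) * h
    have h'' := (mul_eq_zero.mp h').resolve_left (pow_ne_zero 3 hi)
    linear_combination h'' - E2
  have E3 : r 3 * (μ 0 + μ 2 + μ 4) = 0 := by
    have h := hP ![μ 1, -(μ 0 + μ 2 + μ 4), μ 1, 0, μ 1] (by simp only [Matrix.cons_val_zero, Matrix.cons_val_one, Matrix.cons_val_two, Matrix.cons_val_three, Matrix.cons_val_four, Matrix.head_cons, Matrix.tail_cons]; ring)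
    simp only [D, Matrix.cons_val_zero, Matrix.cons_val_one, Matrix.cons_val_two, Matrix.cons_val_three, Matrix.cons_val_four, Matrix.head_cons, Matrix.tail_cons] at h
    have h' : μ 1 ^ 3 * (r 3 * (μ 0 + μ 2 + μ 4)) = 0 := by linear_combination (-1 : ℂ) * h
    exact (mul_eq_zero.mp h').resolve_left (pow_ne_zero 3 hi)
  have P30 : r 3 * μ 0 = 0 := by
    have h := hP ![2 * μ 1, -(2 * μ 0 + μ 2 + μ 4), μ 1, 0, μ 1] (by simp only [Matrix.cons_val_zero, Matrix.cons_val_one, Matrix.cons_val_two, Matrix.cons_val_three, Matrix.cons_val_four, Matrix.head_cons, Matrix.tail_cons]; ring)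
    simp only [D, Matrix.cons_val_zero, Matrix.cons_val_one, Matrix.cons_val_two, Matrix.cons_val_three, Matrix.cons_val_four, Matrix.head_cons, Matrix.tail_cons] at h
    have h' : μ 1 ^ 3 * (r 3 * (2 * μ 0 + μ 2 + μ 4)) = 0 := by
      linear_combination (-1/2 : ℂ) * h
    have h'' := (mul_eq_zero.mp h').resolve_left (pow_ne_zero 3 hi)
    linear_combination h'' - E3
  have P32 : r 3 * μ 2 = 0 := by
    have h := hP ![μ 1, -(2 * μ 2 + μ 0 + μ 4), 2 * μ 1, 0, μ 1] (by simp only [Matrix.cons_val_zero, Matrix.cons_val_one, Matrix.cons_val_two, Matrix.cons_val_three, Matrix.cons_val_four, Matrix.head_cons, Matrix.tail_cons]; ring)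
    simp only [D, Matrix.cons_val_zero, Matrix.cons_val_one, Matrix.cons_val_two, Matrix.cons_val_three, Matrix.cons_val_four, Matrix.head_cons, Matrix.tail_cons] at h
    have h' : μ 1 ^ 3 * (r 3 * (2 * μ 2 + μ 0 + μ 4)) = 0 := by
      linear_combination (-1/2 : ℂ) * h
    have h'' := (mul_eq_zero.mp h').resolve_left (pow_ne_zero 3 hi)
    linear_combination h'' - E3
  have P34 : r 3 * μ 4 = 0 := by
    have h := hP ![μ 1, -(2 * μ 4 + μ 0 + μ 2), μ 1, 0, 2 * μ 1] (by simp only [Matrix.cons_val_zero, Matrix.cons_val_one, Matrix.cons_val_two, Matrix.cons_val_three, Matrix.cons_val_four, Matrix.head_cons, Matrix.tail_cons]; ring)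
    simp only [D, Matrix.cons_val_zero, Matrix.cons_val_one, Matrix.cons_val_two, Matrix.cons_val_three, Matrix.cons_val_four, Matrix.head_cons, Matrix.tail_cons] at h
    have h' : μ 1 ^ 3 * (r 3 * (2 * μ 4 + μ 0 + μ 2)) = 0 := by
      linear_combination (-1/2 : ℂ) * h
    have h'' := (mul_eq_zero.mp h').resolve_left (pow_ne_zero 3 hi)
    linear_combination h'' - E3
  have E4 : r 4 * (μ 0 + μ 2 + μ 3) = 0 := by
    have h := hP ![μ 1, -(μ 0 + μ 2 + μ 3), μ 1, μ 1, 0] (by simp only [Matrix.cons_val_zero, Matrix.cons_val_one, Matrix.cons_val_two, Matrix.cons_val_three, Matrix.cons_val_four, Matrix.head_cons, Matrix.tail_cons]; ring)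
    simp only [D, Matrix.cons_val_zero, Matrix.cons_val_one, Matrix.cons_val_two, Matrix.cons_val_three, Matrix.cons_val_four, Matrix.head_cons, Matrix.tail_cons] at h
    have h' : μ 1 ^ 3 * (r 4 * (μ 0 + μ 2 + μ 3)) = 0 := by linear_combination (-1 : ℂ) * h
    exact (mul_eq_zero.mp h').resolve_left (pow_ne_zero 3 hi)
  have P40 : r 4 * μ 0 = 0 := by
    have h := hP ![2 * μ 1, -(2 * μ 0 + μ 2 + μ 3), μ 1, μ 1, 0] (by simp only [Matrix.cons_val_zero, Matrix.cons_val_one, Matrix.cons_val_two, Matrix.cons_val_three, Matrix.cons_val_four, Matrix.head_cons, Matrix.tail_cons]; ring)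
    simp only [D, Matrix.cons_val_zero, Matrix.cons_val_one, Matrix.cons_val_two, Matrix.cons_val_three, Matrix.cons_val_four, Matrix.head_cons, Matrix.tail_cons] at h
    have h' : μ 1 ^ 3 * (r 4 * (2 * μ 0 + μ 2 + μ 3)) = 0 := by
      linear_combination (-1/2 : ℂ) * h
    have h'' := (mul_eq_zero.mp h').resolve_left (pow_ne_zero 3 hi)
    linear_combination h'' - E4
  have P42 : r 4 * μ 2 = 0 := by
    have h := hP ![μ 1, -(2 * μ 2 + μ 0 + μ 3), 2 * μ 1, μ 1, 0] (by simp only [Matrix.cons_val_zero, Matrix.cons_val_one, Matrix.cons_val_two, Matrix.cons_val_three, Matrix.cons_val_four, Matrix.head_cons, Matrix.tail_cons]; ring)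
    simp only [D, Matrix.cons_val_zero, Matrix.cons_val_one, Matrix.cons_val_two, Matrix.cons_val_three, Matrix.cons_val_four, Matrix.head_cons, Matrix.tail_cons] at h
    have h' : μ 1 ^ 3 * (r 4 * (2 * μ 2 + μ 0 + μ 3)) = 0 := by
      linear_combination (-1/2 : ℂ) * h
    have h'' := (mul_eq_zero.mp h').resolve_left (pow_ne_zero 3 hi)
    linear_combination h'' - E4
  have P43 : r 4 * μ 3 = 0 := by
    have h := hP ![μ 1, -(2 * μ 3 + μ 0 + μ 2), μ 1, 2 * μ 1, 0] (by simp only [Matrix.cons_val_zero, Matrix.cons_val_one, Matrix.cons_val_two, Matrix.cons_val_three, Matrix.cons_val_four, Matrix.head_cons, Matrix.tail_cons]; ring)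
    simp only [D, Matrix.cons_val_zero, Matrix.cons_val_one, Matrix.cons_val_two, Matrix.cons_val_three, Matrix.cons_val_four, Matrix.head_cons, Matrix.tail_cons] at h
    have h' : μ 1 ^ 3 * (r 4 * (2 * μ 3 + μ 0 + μ 2)) = 0 := by
      linear_combination (-1/2 : ℂ) * h
    have h'' := (mul_eq_zero.mp h').resolve_left (pow_ne_zero 3 hi)
    linear_combination h'' - E4
  have hri : r 1 = 0 := by
    have h2 : μ 1 * (2 * r 1) = 0 := by
      linear_combination EA + hr + P02 + P03 + P04 + P20 + P23 + P24 + P30 + P32 + P34 + P40 + P42 + P43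
    have := (mul_eq_zero.mp h2).resolve_left hi
    have h3 : r 1 = (2 * r 1) / 2 := by ring
    rw [h3, this]; simp
  refine ⟨hri, fun l hl hμ => ?_⟩
  fin_cases l
  · -- l = 0
    have hr2 : r 2 = 0 := (mul_eq_zero.mp P20).resolve_right hμ
    have hr3 : r 3 = 0 := (mul_eq_zero.mp P30).resolve_right hμ
    have hr4 : r 4 = 0 := (mul_eq_zero.mp P40).resolve_right hμ
    have hrl : r 0 * μ 0 = 0 := by
      have h := hr; rw [hri, hr2, hr3, hr4] at h; linear_combination h
    have hr0 : r 0 = 0 := (mul_eq_zero.mp hrl).resolve_right hμ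
    funext x; fin_cases x
    · exact hr0
    · exact hri
    · exact hr2
    · exact hr3
    · exact hr4
  · exact absurd rfl hl
  · -- l = 2
    have hr0 : r 0 = 0 := (mul_eq_zero.mp P02).resolve_right hμ
    have hr3 : r 3 = 0 := (mul_eq_zero.mp P32).resolve_right hμ
    have hr4 : r 4 = 0 := (mul_eq_zero.mp P42).resolve_right hμ
    have hrl : r 2 * μ 2 = 0 := by
      have h := hr; rw [hri, hr0, hr3, hr4] at h; linear_combination h
    have hr2 : r 2 = 0 := (mul_eq_zero.mp hrl).resolve_right hμ
    funext x; fin_cases x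
    · exact hr0
    · exact hri
    · exact hr2
    · exact hr3
    · exact hr4
  · -- l = 3
    have hr0 : r 0 = 0 := (mul_eq_zero.mp P03).resolve_right hμ
    have hr2 : r 2 = 0 := (mul_eq_zero.mp P23).resolve_right hμ
    have hr4 : r 4 = 0 := (mul_eq_zero.mp P43).resolve_right hμ
    have hrl : r 3 * μ 3 = 0 := by
      have h := hr; rw [hri, hr0, hr2, hr4] at h; linear_combination h
    have hr3 : r 3 = 0 := (mul_eq_zero.mp hrl).resolve_right hμ
    funext x; fin_cases x
    · exact hr0
    · exact hri
    · exact hr2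
    · exact hr3
    · exact hr4
  · -- l = 4
    have hr0 : r 0 = 0 := (mul_eq_zero.mp P04).resolve_right hμ
    have hr2 : r 2 = 0 := (mul_eq_zero.mp P24).resolve_right hμ
    have hr3 : r 3 = 0 := (mul_eq_zero.mp P34).resolve_right hμ
    have hrl : r 4 * μ 4 = 0 := by
      have h := hr; rw [hri, hr0, hr2, hr3] at h; linear_combination h
    have hr4 : r 4 = 0 := (mul_eq_zero.mp hrl).resolve_right hμ
    funext x; fin_cases x
    · exact hr0
    · exact hri
    · exact hr2
    · exact hr3
    · exact hr4

theorem core2 (μ r : Fin 5 → ℂ) (hi : μ 2 ≠ 0)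
    (hr : r 0 * μ 0 + r 1 * μ 1 + r 2 * μ 2 + r 3 * μ 3 + r 4 * μ 4 = 0)
    (hP : ∀ u : Fin 5 → ℂ, μ 0 * u 0 + μ 1 * u 1 + μ 2 * u 2 + μ 3 * u 3 + μ 4 * u 4 = 0 → D r u = 0) :
    r 2 = 0 ∧ ∀ l : Fin 5, l ≠ 2 → μ l ≠ 0 → r = 0 := by
  have EA : μ 2 * r 2 - (μ 0 + μ 1 + μ 3 + μ 4) * (r 0 + r 1 + r 3 + r 4) = 0 := by
    have h := hP ![μ 2, μ 2, -(μ 0 + μ 1 + μ 3 + μ 4), μ 2, μ 2] (by simp only [Matrix.cons_val_zero, Matrix.cons_val_one, Matrix.cons_val_two, Matrix.cons_val_three, Matrix.cons_val_four, Matrix.head_cons, Matrix.tail_cons]; ring)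
    simp only [D, Matrix.cons_val_zero, Matrix.cons_val_one, Matrix.cons_val_two, Matrix.cons_val_three, Matrix.cons_val_four, Matrix.head_cons, Matrix.tail_cons] at h
    have h' : μ 2 ^ 3 * (μ 2 * r 2 - (μ 0 + μ 1 + μ 3 + μ 4) * (r 0 + r 1 + r 3 + r 4)) = 0 := by
      linear_combination h
    exact (mul_eq_zero.mp h').resolve_left (pow_ne_zero 3 hi)
  have E0 : r 0 * (μ 1 + μ 3 + μ 4) = 0 := by
    have h := hP ![0, μ 2, -(μ 1 + μ 3 + μ 4), μ 2, μ 2] (by simp only [Matrix.cons_val_zero, Matrix.cons_val_one, Matrix.cons_val_two, Matrix.cons_val_three, Matrix.cons_val_four, Matrix.head_cons, Matrix.tail_cons]; ring)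
    simp only [D, Matrix.cons_val_zero, Matrix.cons_val_one, Matrix.cons_val_two, Matrix.cons_val_three, Matrix.cons_val_four, Matrix.head_cons, Matrix.tail_cons] at h
    have h' : μ 2 ^ 3 * (r 0 * (μ 1 + μ 3 + μ 4)) = 0 := by linear_combination (-1 : ℂ) * h
    exact (mul_eq_zero.mp h').resolve_left (pow_ne_zero 3 hi)
  have P01 : r 0 * μ 1 = 0 := by
    have h := hP ![0, 2 * μ 2, -(2 * μ 1 + μ 3 + μ 4), μ 2, μ 2] (by simp only [Matrix.cons_val_zero, Matrix.cons_val_one, Matrix.cons_val_two, Matrix.cons_val_three, Matrix.cons_val_four, Matrix.head_cons, Matrix.tail_cons]; ring)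
    simp only [D, Matrix.cons_val_zero, Matrix.cons_val_one, Matrix.cons_val_two, Matrix.cons_val_three, Matrix.cons_val_four, Matrix.head_cons, Matrix.tail_cons] at h
    have h' : μ 2 ^ 3 * (r 0 * (2 * μ 1 + μ 3 + μ 4)) = 0 := by
      linear_combination (-1/2 : ℂ) * h
    have h'' := (mul_eq_zero.mp h').resolve_left (pow_ne_zero 3 hi)
    linear_combination h'' - E0
  have P03 : r 0 * μ 3 = 0 := by
    have h := hP ![0, μ 2, -(2 * μ 3 + μ 1 + μ 4), 2 * μ 2, μ 2] (by simp only [Matrix.cons_val_zero, Matrix.cons_val_one, Matrix.cons_val_two, Matrix.cons_val_three, Matrix.cons_val_four, Matrix.head_cons, Matrix.tail_cons]; ring)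
    simp only [D, Matrix.cons_val_zero, Matrix.cons_val_one, Matrix.cons_val_two, Matrix.cons_val_three, Matrix.cons_val_four, Matrix.head_cons, Matrix.tail_cons] at h
    have h' : μ 2 ^ 3 * (r 0 * (2 * μ 3 + μ 1 + μ 4)) = 0 := by
      linear_combination (-1/2 : ℂ) * h
    have h'' := (mul_eq_zero.mp h').resolve_left (pow_ne_zero 3 hi)
    linear_combination h'' - E0
  have P04 : r 0 * μ 4 = 0 := by
    have h := hP ![0, μ 2, -(2 * μ 4 + μ 1 + μ 3), μ 2, 2 * μ 2] (by simp only [Matrix.cons_val_zero, Matrix.cons_val_one, Matrix.cons_val_two, Matrix.cons_val_three, Matrix.cons_val_four, Matrix.head_cons, Matrix.tail_cons]; ring)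
    simp only [D, Matrix.cons_val_zero, Matrix.cons_val_one, Matrix.cons_val_two, Matrix.cons_val_three, Matrix.cons_val_four, Matrix.head_cons, Matrix.tail_cons] at h
    have h' : μ 2 ^ 3 * (r 0 * (2 * μ 4 + μ 1 + μ 3)) = 0 := by
      linear_combination (-1/2 : ℂ) * h
    have h'' := (mul_eq_zero.mp h').resolve_left (pow_ne_zero 3 hi)
    linear_combination h'' - E0
  have E1 : r 1 * (μ 0 + μ 3 + μ 4) = 0 := by
    have h := hP ![μ 2, 0, -(μ 0 + μ 3 + μ 4), μ 2, μ 2] (by simp only [Matrix.cons_val_zero, Matrix.cons_val_one, Matrix.cons_val_two, Matrix.cons_val_three, Matrix.cons_val_four, Matrix.head_cons, Matrix.tail_cons]; ring)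
    simp only [D, Matrix.cons_val_zero, Matrix.cons_val_one, Matrix.cons_val_two, Matrix.cons_val_three, Matrix.cons_val_four, Matrix.head_cons, Matrix.tail_cons] at h
    have h' : μ 2 ^ 3 * (r 1 * (μ 0 + μ 3 + μ 4)) = 0 := by linear_combination (-1 : ℂ) * h
    exact (mul_eq_zero.mp h').resolve_left (pow_ne_zero 3 hi)
  have P10 : r 1 * μ 0 = 0 := by
    have h := hP ![2 * μ 2, 0, -(2 * μ 0 + μ 3 + μ 4), μ 2, μ 2] (by simp only [Matrix.cons_val_zero, Matrix.cons_val_one, Matrix.cons_val_two, Matrix.cons_val_three, Matrix.cons_val_four, Matrix.head_cons, Matrix.tail_cons]; ring)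
    simp only [D, Matrix.cons_val_zero, Matrix.cons_val_one, Matrix.cons_val_two, Matrix.cons_val_three, Matrix.cons_val_four, Matrix.head_cons, Matrix.tail_cons] at h
    have h' : μ 2 ^ 3 * (r 1 * (2 * μ 0 + μ 3 + μ 4)) = 0 := by
      linear_combination (-1/2 : ℂ) * h
    have h'' := (mul_eq_zero.mp h').resolve_left (pow_ne_zero 3 hi)
    linear_combination h'' - E1
  have P13 : r 1 * μ 3 = 0 := by
    have h := hP ![μ 2, 0, -(2 * μ 3 + μ 0 + μ 4), 2 * μ 2, μ 2] (by simp only [Matrix.cons_val_zero, Matrix.cons_val_one, Matrix.cons_val_two, Matrix.cons_val_three, Matrix.cons_val_four, Matrix.head_cons, Matrix.tail_cons]; ring)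
    simp only [D, Matrix.cons_val_zero, Matrix.cons_val_one, Matrix.cons_val_two, Matrix.cons_val_three, Matrix.cons_val_four, Matrix.head_cons, Matrix.tail_cons] at h
    have h' : μ 2 ^ 3 * (r 1 * (2 * μ 3 + μ 0 + μ 4)) = 0 := by
      linear_combination (-1/2 : ℂ) * h
    have h'' := (mul_eq_zero.mp h').resolve_left (pow_ne_zero 3 hi)
    linear_combination h'' - E1
  have P14 : r 1 * μ 4 = 0 := by
    have h := hP ![μ 2, 0, -(2 * μ 4 + μ 0 + μ 3), μ 2, 2 * μ 2] (by simp only [Matrix.cons_val_zero, Matrix.cons_val_one, Matrix.cons_val_two, Matrix.cons_val_three, Matrix.cons_val_four, Matrix.head_cons, Matrix.tail_cons]; ring)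
    simp only [D, Matrix.cons_val_zero, Matrix.cons_val_one, Matrix.cons_val_two, Matrix.cons_val_three, Matrix.cons_val_four, Matrix.head_cons, Matrix.tail_cons] at h
    have h' : μ 2 ^ 3 * (r 1 * (2 * μ 4 + μ 0 + μ 3)) = 0 := by
      linear_combination (-1/2 : ℂ) * h
    have h'' := (mul_eq_zero.mp h').resolve_left (pow_ne_zero 3 hi)
    linear_combination h'' - E1
  have E3 : r 3 * (μ 0 + μ 1 + μ 4) = 0 := by
    have h := hP ![μ 2, μ 2, -(μ 0 + μ 1 + μ 4), 0, μ 2] (by simp only [Matrix.cons_val_zero, Matrix.cons_val_one, Matrix.cons_val_two, Matrix.cons_val_three, Matrix.cons_val_four, Matrix.head_cons, Matrix.tail_cons]; ring)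
    simp only [D, Matrix.cons_val_zero, Matrix.cons_val_one, Matrix.cons_val_two, Matrix.cons_val_three, Matrix.cons_val_four, Matrix.head_cons, Matrix.tail_cons] at h
    have h' : μ 2 ^ 3 * (r 3 * (μ 0 + μ 1 + μ 4)) = 0 := by linear_combination (-1 : ℂ) * h
    exact (mul_eq_zero.mp h').resolve_left (pow_ne_zero 3 hi)
  have P30 : r 3 * μ 0 = 0 := by
    have h := hP ![2 * μ 2, μ 2, -(2 * μ 0 + μ 1 + μ 4), 0, μ 2] (by simp only [Matrix.cons_val_zero, Matrix.cons_val_one, Matrix.cons_val_two, Matrix.cons_val_three, Matrix.cons_val_four, Matrix.head_cons, Matrix.tail_cons]; ring)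
    simp only [D, Matrix.cons_val_zero, Matrix.cons_val_one, Matrix.cons_val_two, Matrix.cons_val_three, Matrix.cons_val_four, Matrix.head_cons, Matrix.tail_cons] at h
    have h' : μ 2 ^ 3 * (r 3 * (2 * μ 0 + μ 1 + μ 4)) = 0 := by
      linear_combination (-1/2 : ℂ) * h
    have h'' := (mul_eq_zero.mp h').resolve_left (pow_ne_zero 3 hi)
    linear_combination h'' - E3
  have P31 : r 3 * μ 1 = 0 := by
    have h := hP ![μ 2, 2 * μ 2, -(2 * μ 1 + μ 0 + μ 4), 0, μ 2] (by simp only [Matrix.cons_val_zero, Matrix.cons_val_one, Matrix.cons_val_two, Matrix.cons_val_three, Matrix.cons_val_four, Matrix.head_cons, Matrix.tail_cons]; ring)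
    simp only [D, Matrix.cons_val_zero, Matrix.cons_val_one, Matrix.cons_val_two, Matrix.cons_val_three, Matrix.cons_val_four, Matrix.head_cons, Matrix.tail_cons] at h
    have h' : μ 2 ^ 3 * (r 3 * (2 * μ 1 + μ 0 + μ 4)) = 0 := by
      linear_combination (-1/2 : ℂ) * h
    have h'' := (mul_eq_zero.mp h').resolve_left (pow_ne_zero 3 hi)
    linear_combination h'' - E3
  have P34 : r 3 * μ 4 = 0 := by
    have h := hP ![μ 2, μ 2, -(2 * μ 4 + μ 0 + μ 1), 0, 2 * μ 2] (by simp only [Matrix.cons_val_zero, Matrix.cons_val_one, Matrix.cons_val_two, Matrix.cons_val_three, Matrix.cons_val_four, Matrix.head_cons, Matrix.tail_cons]; ring)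
    simp only [D, Matrix.cons_val_zero, Matrix.cons_val_one, Matrix.cons_val_two, Matrix.cons_val_three, Matrix.cons_val_four, Matrix.head_cons, Matrix.tail_cons] at h
    have h' : μ 2 ^ 3 * (r 3 * (2 * μ 4 + μ 0 + μ 1)) = 0 := by
      linear_combination (-1/2 : ℂ) * h
    have h'' := (mul_eq_zero.mp h').resolve_left (pow_ne_zero 3 hi)
    linear_combination h'' - E3
  have E4 : r 4 * (μ 0 + μ 1 + μ 3) = 0 := by
    have h := hP ![μ 2, μ 2, -(μ 0 + μ 1 + μ 3), μ 2, 0] (by simp only [Matrix.cons_val_zero, Matrix.cons_val_one, Matrix.cons_val_two, Matrix.cons_val_three, Matrix.cons_val_four, Matrix.head_cons, Matrix.tail_cons]; ring)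
    simp only [D, Matrix.cons_val_zero, Matrix.cons_val_one, Matrix.cons_val_two, Matrix.cons_val_three, Matrix.cons_val_four, Matrix.head_cons, Matrix.tail_cons] at h
    have h' : μ 2 ^ 3 * (r 4 * (μ 0 + μ 1 + μ 3)) = 0 := by linear_combination (-1 : ℂ) * h
    exact (mul_eq_zero.mp h').resolve_left (pow_ne_zero 3 hi)
  have P40 : r 4 * μ 0 = 0 := by
    have h := hP ![2 * μ 2, μ 2, -(2 * μ 0 + μ 1 + μ 3), μ 2, 0] (by simp only [Matrix.cons_val_zero, Matrix.cons_val_one, Matrix.cons_val_two, Matrix.cons_val_three, Matrix.cons_val_four, Matrix.head_cons, Matrix.tail_cons]; ring)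
    simp only [D, Matrix.cons_val_zero, Matrix.cons_val_one, Matrix.cons_val_two, Matrix.cons_val_three, Matrix.cons_val_four, Matrix.head_cons, Matrix.tail_cons] at h
    have h' : μ 2 ^ 3 * (r 4 * (2 * μ 0 + μ 1 + μ 3)) = 0 := by
      linear_combination (-1/2 : ℂ) * h
    have h'' := (mul_eq_zero.mp h').resolve_left (pow_ne_zero 3 hi)
    linear_combination h'' - E4
  have P41 : r 4 * μ 1 = 0 := by
    have h := hP ![μ 2, 2 * μ 2, -(2 * μ 1 + μ 0 + μ 3), μ 2, 0] (by simp only [Matrix.cons_val_zero, Matrix.cons_val_one, Matrix.cons_val_two, Matrix.cons_val_three, Matrix.cons_val_four, Matrix.head_cons, Matrix.tail_cons]; ring)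
    simp only [D, Matrix.cons_val_zero, Matrix.cons_val_one, Matrix.cons_val_two, Matrix.cons_val_three, Matrix.cons_val_four, Matrix.head_cons, Matrix.tail_cons] at h
    have h' : μ 2 ^ 3 * (r 4 * (2 * μ 1 + μ 0 + μ 3)) = 0 := by
      linear_combination (-1/2 : ℂ) * h
    have h'' := (mul_eq_zero.mp h').resolve_left (pow_ne_zero 3 hi)
    linear_combination h'' - E4
  have P43 : r 4 * μ 3 = 0 := by
    have h := hP ![μ 2, μ 2, -(2 * μ 3 + μ 0 + μ 1), 2 * μ 2, 0] (by simp only [Matrix.cons_val_zero, Matrix.cons_val_one, Matrix.cons_val_two, Matrix.cons_val_three, Matrix.cons_val_four, Matrix.head_cons, Matrix.tail_cons]; ring)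
    simp only [D, Matrix.cons_val_zero, Matrix.cons_val_one, Matrix.cons_val_two, Matrix.cons_val_three, Matrix.cons_val_four, Matrix.head_cons, Matrix.tail_cons] at h
    have h' : μ 2 ^ 3 * (r 4 * (2 * μ 3 + μ 0 + μ 1)) = 0 := by
      linear_combination (-1/2 : ℂ) * h
    have h'' := (mul_eq_zero.mp h').resolve_left (pow_ne_zero 3 hi)
    linear_combination h'' - E4
  have hri : r 2 = 0 := by
    have h2 : μ 2 * (2 * r 2) = 0 := by
      linear_combination EA + hr + P01 + P03 + P04 + P10 + P13 + P14 + P30 + P31 + P34 + P40 + P41 + P43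
    have := (mul_eq_zero.mp h2).resolve_left hi
    have h3 : r 2 = (2 * r 2) / 2 := by ring
    rw [h3, this]; simp
  refine ⟨hri, fun l hl hμ => ?_⟩
  fin_cases l
  · -- l = 0
    have hr1 : r 1 = 0 := (mul_eq_zero.mp P10).resolve_right hμ
    have hr3 : r 3 = 0 := (mul_eq_zero.mp P30).resolve_right hμ
    have hr4 : r 4 = 0 := (mul_eq_zero.mp P40).resolve_right hμ
    have hrl : r 0 * μ 0 = 0 := by
      have h := hr; rw [hri, hr1, hr3, hr4] at h; linear_combination h
    have hr0 : r 0 = 0 := (mul_eq_zero.mp hrl).resolve_right hμ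
    funext x; fin_cases x
    · exact hr0
    · exact hr1
    · exact hri
    · exact hr3
    · exact hr4
  · -- l = 1
    have hr0 : r 0 = 0 := (mul_eq_zero.mp P01).resolve_right hμ
    have hr3 : r 3 = 0 := (mul_eq_zero.mp P31).resolve_right hμ
    have hr4 : r 4 = 0 := (mul_eq_zero.mp P41).resolve_right hμ
    have hrl : r 1 * μ 1 = 0 := by
      have h := hr; rw [hri, hr0, hr3, hr4] at h; linear_combination h
    have hr1 : r 1 = 0 := (mul_eq_zero.mp hrl).resolve_right hμ
    funext x; fin_cases x
    · exact hr0
    · exact hr1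
    · exact hri
    · exact hr3
    · exact hr4
  · exact absurd rfl hl
  · -- l = 3
    have hr0 : r 0 = 0 := (mul_eq_zero.mp P03).resolve_right hμ
    have hr1 : r 1 = 0 := (mul_eq_zero.mp P13).resolve_right hμ
    have hr4 : r 4 = 0 := (mul_eq_zero.mp P43).resolve_right hμ
    have hrl : r 3 * μ 3 = 0 := by
      have h := hr; rw [hri, hr0, hr1, hr4] at h; linear_combination h
    have hr3 : r 3 = 0 := (mul_eq_zero.mp hrl).resolve_right hμ
    funext x; fin_cases x
    · exact hr0
    · exact hr1
    · exact hri
    · exact hr3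
    · exact hr4
  · -- l = 4
    have hr0 : r 0 = 0 := (mul_eq_zero.mp P04).resolve_right hμ
    have hr1 : r 1 = 0 := (mul_eq_zero.mp P14).resolve_right hμ
    have hr3 : r 3 = 0 := (mul_eq_zero.mp P34).resolve_right hμ
    have hrl : r 4 * μ 4 = 0 := by
      have h := hr; rw [hri, hr0, hr1, hr3] at h; linear_combination h
    have hr4 : r 4 = 0 := (mul_eq_zero.mp hrl).resolve_right hμ
    funext x; fin_cases x
    · exact hr0
    · exact hr1
    · exact hri
    · exact hr3
    · exact hr4

theorem core3 (μ r : Fin 5 → ℂ) (hi : μ 3 ≠ 0)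
    (hr : r 0 * μ 0 + r 1 * μ 1 + r 2 * μ 2 + r 3 * μ 3 + r 4 * μ 4 = 0)
    (hP : ∀ u : Fin 5 → ℂ, μ 0 * u 0 + μ 1 * u 1 + μ 2 * u 2 + μ 3 * u 3 + μ 4 * u 4 = 0 → D r u = 0) :
    r 3 = 0 ∧ ∀ l : Fin 5, l ≠ 3 → μ l ≠ 0 → r = 0 := by
  have EA : μ 3 * r 3 - (μ 0 + μ 1 + μ 2 + μ 4) * (r 0 + r 1 + r 2 + r 4) = 0 := by
    have h := hP ![μ 3, μ 3, μ 3, -(μ 0 + μ 1 + μ 2 + μ 4), μ 3] (by simp only [Matrix.cons_val_zero, Matrix.cons_val_one, Matrix.cons_val_two, Matrix.cons_val_three, Matrix.cons_val_four, Matrix.head_cons, Matrix.tail_cons]; ring)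
    simp only [D, Matrix.cons_val_zero, Matrix.cons_val_one, Matrix.cons_val_two, Matrix.cons_val_three, Matrix.cons_val_four, Matrix.head_cons, Matrix.tail_cons] at h
    have h' : μ 3 ^ 3 * (μ 3 * r 3 - (μ 0 + μ 1 + μ 2 + μ 4) * (r 0 + r 1 + r 2 + r 4)) = 0 := by
      linear_combination h
    exact (mul_eq_zero.mp h').resolve_left (pow_ne_zero 3 hi)
  have E0 : r 0 * (μ 1 + μ 2 + μ 4) = 0 := by
    have h := hP ![0, μ 3, μ 3, -(μ 1 + μ 2 + μ 4), μ 3] (by simp only [Matrix.cons_val_zero, Matrix.cons_val_one, Matrix.cons_val_two, Matrix.cons_val_three, Matrix.cons_val_four, Matrix.head_cons, Matrix.tail_cons]; ring)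
    simp only [D, Matrix.cons_val_zero, Matrix.cons_val_one, Matrix.cons_val_two, Matrix.cons_val_three, Matrix.cons_val_four, Matrix.head_cons, Matrix.tail_cons] at h
    have h' : μ 3 ^ 3 * (r 0 * (μ 1 + μ 2 + μ 4)) = 0 := by linear_combination (-1 : ℂ) * h
    exact (mul_eq_zero.mp h').resolve_left (pow_ne_zero 3 hi)
  have P01 : r 0 * μ 1 = 0 := by
    have h := hP ![0, 2 * μ 3, μ 3, -(2 * μ 1 + μ 2 + μ 4), μ 3] (by simp only [Matrix.cons_val_zero, Matrix.cons_val_one, Matrix.cons_val_two, Matrix.cons_val_three, Matrix.cons_val_four, Matrix.head_cons, Matrix.tail_cons]; ring)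
    simp only [D, Matrix.cons_val_zero, Matrix.cons_val_one, Matrix.cons_val_two, Matrix.cons_val_three, Matrix.cons_val_four, Matrix.head_cons, Matrix.tail_cons] at h
    have h' : μ 3 ^ 3 * (r 0 * (2 * μ 1 + μ 2 + μ 4)) = 0 := by
      linear_combination (-1/2 : ℂ) * h
    have h'' := (mul_eq_zero.mp h').resolve_left (pow_ne_zero 3 hi)
    linear_combination h'' - E0
  have P02 : r 0 * μ 2 = 0 := by
    have h := hP ![0, μ 3, 2 * μ 3, -(2 * μ 2 + μ 1 + μ 4), μ 3] (by simp only [Matrix.cons_val_zero, Matrix.cons_val_one, Matrix.cons_val_two, Matrix.cons_val_three, Matrix.cons_val_four, Matrix.head_cons, Matrix.tail_cons]; ring)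
    simp only [D, Matrix.cons_val_zero, Matrix.cons_val_one, Matrix.cons_val_two, Matrix.cons_val_three, Matrix.cons_val_four, Matrix.head_cons, Matrix.tail_cons] at h
    have h' : μ 3 ^ 3 * (r 0 * (2 * μ 2 + μ 1 + μ 4)) = 0 := by
      linear_combination (-1/2 : ℂ) * h
    have h'' := (mul_eq_zero.mp h').resolve_left (pow_ne_zero 3 hi)
    linear_combination h'' - E0
  have P04 : r 0 * μ 4 = 0 := by
    have h := hP ![0, μ 3, μ 3, -(2 * μ 4 + μ 1 + μ 2), 2 * μ 3] (by simp only [Matrix.cons_val_zero, Matrix.cons_val_one, Matrix.cons_val_two, Matrix.cons_val_three, Matrix.cons_val_four, Matrix.head_cons, Matrix.tail_cons]; ring)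
    simp only [D, Matrix.cons_val_zero, Matrix.cons_val_one, Matrix.cons_val_two, Matrix.cons_val_three, Matrix.cons_val_four, Matrix.head_cons, Matrix.tail_cons] at h
    have h' : μ 3 ^ 3 * (r 0 * (2 * μ 4 + μ 1 + μ 2)) = 0 := by
      linear_combination (-1/2 : ℂ) * h
    have h'' := (mul_eq_zero.mp h').resolve_left (pow_ne_zero 3 hi)
    linear_combination h'' - E0
  have E1 : r 1 * (μ 0 + μ 2 + μ 4) = 0 := by
    have h := hP ![μ 3, 0, μ 3, -(μ 0 + μ 2 + μ 4), μ 3] (by simp only [Matrix.cons_val_zero, Matrix.cons_val_one, Matrix.cons_val_two, Matrix.cons_val_three, Matrix.cons_val_four, Matrix.head_cons, Matrix.tail_cons]; ring)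
    simp only [D, Matrix.cons_val_zero, Matrix.cons_val_one, Matrix.cons_val_two, Matrix.cons_val_three, Matrix.cons_val_four, Matrix.head_cons, Matrix.tail_cons] at h
    have h' : μ 3 ^ 3 * (r 1 * (μ 0 + μ 2 + μ 4)) = 0 := by linear_combination (-1 : ℂ) * h
    exact (mul_eq_zero.mp h').resolve_left (pow_ne_zero 3 hi)
  have P10 : r 1 * μ 0 = 0 := by
    have h := hP ![2 * μ 3, 0, μ 3, -(2 * μ 0 + μ 2 + μ 4), μ 3] (by simp only [Matrix.cons_val_zero, Matrix.cons_val_one, Matrix.cons_val_two, Matrix.cons_val_three, Matrix.cons_val_four, Matrix.head_cons, Matrix.tail_cons]; ring)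
    simp only [D, Matrix.cons_val_zero, Matrix.cons_val_one, Matrix.cons_val_two, Matrix.cons_val_three, Matrix.cons_val_four, Matrix.head_cons, Matrix.tail_cons] at h
    have h' : μ 3 ^ 3 * (r 1 * (2 * μ 0 + μ 2 + μ 4)) = 0 := by
      linear_combination (-1/2 : ℂ) * h
    have h'' := (mul_eq_zero.mp h').resolve_left (pow_ne_zero 3 hi)
    linear_combination h'' - E1
  have P12 : r 1 * μ 2 = 0 := by
    have h := hP ![μ 3, 0, 2 * μ 3, -(2 * μ 2 + μ 0 + μ 4), μ 3] (by simp only [Matrix.cons_val_zero, Matrix.cons_val_one, Matrix.cons_val_two, Matrix.cons_val_three, Matrix.cons_val_four, Matrix.head_cons, Matrix.tail_cons]; ring)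
    simp only [D, Matrix.cons_val_zero, Matrix.cons_val_one, Matrix.cons_val_two, Matrix.cons_val_three, Matrix.cons_val_four, Matrix.head_cons, Matrix.tail_cons] at h
    have h' : μ 3 ^ 3 * (r 1 * (2 * μ 2 + μ 0 + μ 4)) = 0 := by
      linear_combination (-1/2 : ℂ) * h
    have h'' := (mul_eq_zero.mp h').resolve_left (pow_ne_zero 3 hi)
    linear_combination h'' - E1
  have P14 : r 1 * μ 4 = 0 := by
    have h := hP ![μ 3, 0, μ 3, -(2 * μ 4 + μ 0 + μ 2), 2 * μ 3] (by simp only [Matrix.cons_val_zero, Matrix.cons_val_one, Matrix.cons_val_two, Matrix.cons_val_three, Matrix.cons_val_four, Matrix.head_cons, Matrix.tail_cons]; ring)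
    simp only [D, Matrix.cons_val_zero, Matrix.cons_val_one, Matrix.cons_val_two, Matrix.cons_val_three, Matrix.cons_val_four, Matrix.head_cons, Matrix.tail_cons] at h
    have h' : μ 3 ^ 3 * (r 1 * (2 * μ 4 + μ 0 + μ 2)) = 0 := by
      linear_combination (-1/2 : ℂ) * h
    have h'' := (mul_eq_zero.mp h').resolve_left (pow_ne_zero 3 hi)
    linear_combination h'' - E1
  have E2 : r 2 * (μ 0 + μ 1 + μ 4) = 0 := by
    have h := hP ![μ 3, μ 3, 0, -(μ 0 + μ 1 + μ 4), μ 3] (by simp only [Matrix.cons_val_zero, Matrix.cons_val_one, Matrix.cons_val_two, Matrix.cons_val_three, Matrix.cons_val_four, Matrix.head_cons, Matrix.tail_cons]; ring)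
    simp only [D, Matrix.cons_val_zero, Matrix.cons_val_one, Matrix.cons_val_two, Matrix.cons_val_three, Matrix.cons_val_four, Matrix.head_cons, Matrix.tail_cons] at h
    have h' : μ 3 ^ 3 * (r 2 * (μ 0 + μ 1 + μ 4)) = 0 := by linear_combination (-1 : ℂ) * h
    exact (mul_eq_zero.mp h').resolve_left (pow_ne_zero 3 hi)
  have P20 : r 2 * μ 0 = 0 := by
    have h := hP ![2 * μ 3, μ 3, 0, -(2 * μ 0 + μ 1 + μ 4), μ 3] (by simp only [Matrix.cons_val_zero, Matrix.cons_val_one, Matrix.cons_val_two, Matrix.cons_val_three, Matrix.cons_val_four, Matrix.head_cons, Matrix.tail_cons]; ring)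
    simp only [D, Matrix.cons_val_zero, Matrix.cons_val_one, Matrix.cons_val_two, Matrix.cons_val_three, Matrix.cons_val_four, Matrix.head_cons, Matrix.tail_cons] at h
    have h' : μ 3 ^ 3 * (r 2 * (2 * μ 0 + μ 1 + μ 4)) = 0 := by
      linear_combination (-1/2 : ℂ) * h
    have h'' := (mul_eq_zero.mp h').resolve_left (pow_ne_zero 3 hi)
    linear_combination h'' - E2
  have P21 : r 2 * μ 1 = 0 := by
    have h := hP ![μ 3, 2 * μ 3, 0, -(2 * μ 1 + μ 0 + μ 4), μ 3] (by simp only [Matrix.cons_val_zero, Matrix.cons_val_one, Matrix.cons_val_two, Matrix.cons_val_three, Matrix.cons_val_four, Matrix.head_cons, Matrix.tail_cons]; ring)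
    simp only [D, Matrix.cons_val_zero, Matrix.cons_val_one, Matrix.cons_val_two, Matrix.cons_val_three, Matrix.cons_val_four, Matrix.head_cons, Matrix.tail_cons] at h
    have h' : μ 3 ^ 3 * (r 2 * (2 * μ 1 + μ 0 + μ 4)) = 0 := by
      linear_combination (-1/2 : ℂ) * h
    have h'' := (mul_eq_zero.mp h').resolve_left (pow_ne_zero 3 hi)
    linear_combination h'' - E2
  have P24 : r 2 * μ 4 = 0 := by
    have h := hP ![μ 3, μ 3, 0, -(2 * μ 4 + μ 0 + μ 1), 2 * μ 3] (by simp only [Matrix.cons_val_zero, Matrix.cons_val_one, Matrix.cons_val_two, Matrix.cons_val_three, Matrix.cons_val_four, Matrix.head_cons, Matrix.tail_cons]; ring)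
    simp only [D, Matrix.cons_val_zero, Matrix.cons_val_one, Matrix.cons_val_two, Matrix.cons_val_three, Matrix.cons_val_four, Matrix.head_cons, Matrix.tail_cons] at h
    have h' : μ 3 ^ 3 * (r 2 * (2 * μ 4 + μ 0 + μ 1)) = 0 := by
      linear_combination (-1/2 : ℂ) * h
    have h'' := (mul_eq_zero.mp h').resolve_left (pow_ne_zero 3 hi)
    linear_combination h'' - E2
  have E4 : r 4 * (μ 0 + μ 1 + μ 2) = 0 := by
    have h := hP ![μ 3, μ 3, μ 3, -(μ 0 + μ 1 + μ 2), 0] (by simp only [Matrix.cons_val_zero, Matrix.cons_val_one, Matrix.cons_val_two, Matrix.cons_val_three, Matrix.cons_val_four, Matrix.head_cons, Matrix.tail_cons]; ring)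
    simp only [D, Matrix.cons_val_zero, Matrix.cons_val_one, Matrix.cons_val_two, Matrix.cons_val_three, Matrix.cons_val_four, Matrix.head_cons, Matrix.tail_cons] at h
    have h' : μ 3 ^ 3 * (r 4 * (μ 0 + μ 1 + μ 2)) = 0 := by linear_combination (-1 : ℂ) * h
    exact (mul_eq_zero.mp h').resolve_left (pow_ne_zero 3 hi)
  have P40 : r 4 * μ 0 = 0 := by
    have h := hP ![2 * μ 3, μ 3, μ 3, -(2 * μ 0 + μ 1 + μ 2), 0] (by simp only [Matrix.cons_val_zero, Matrix.cons_val_one, Matrix.cons_val_two, Matrix.cons_val_three, Matrix.cons_val_four, Matrix.head_cons, Matrix.tail_cons]; ring)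
    simp only [D, Matrix.cons_val_zero, Matrix.cons_val_one, Matrix.cons_val_two, Matrix.cons_val_three, Matrix.cons_val_four, Matrix.head_cons, Matrix.tail_cons] at h
    have h' : μ 3 ^ 3 * (r 4 * (2 * μ 0 + μ 1 + μ 2)) = 0 := by
      linear_combination (-1/2 : ℂ) * h
    have h'' := (mul_eq_zero.mp h').resolve_left (pow_ne_zero 3 hi)
    linear_combination h'' - E4
  have P41 : r 4 * μ 1 = 0 := by
    have h := hP ![μ 3, 2 * μ 3, μ 3, -(2 * μ 1 + μ 0 + μ 2), 0] (by simp only [Matrix.cons_val_zero, Matrix.cons_val_one, Matrix.cons_val_two, Matrix.cons_val_three, Matrix.cons_val_four, Matrix.head_cons, Matrix.tail_cons]; ring)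
    simp only [D, Matrix.cons_val_zero, Matrix.cons_val_one, Matrix.cons_val_two, Matrix.cons_val_three, Matrix.cons_val_four, Matrix.head_cons, Matrix.tail_cons] at h
    have h' : μ 3 ^ 3 * (r 4 * (2 * μ 1 + μ 0 + μ 2)) = 0 := by
      linear_combination (-1/2 : ℂ) * h
    have h'' := (mul_eq_zero.mp h').resolve_left (pow_ne_zero 3 hi)
    linear_combination h'' - E4
  have P42 : r 4 * μ 2 = 0 := by
    have h := hP ![μ 3, μ 3, 2 * μ 3, -(2 * μ 2 + μ 0 + μ 1), 0] (by simp only [Matrix.cons_val_zero, Matrix.cons_val_one, Matrix.cons_val_two, Matrix.cons_val_three, Matrix.cons_val_four, Matrix.head_cons, Matrix.tail_cons]; ring)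
    simp only [D, Matrix.cons_val_zero, Matrix.cons_val_one, Matrix.cons_val_two, Matrix.cons_val_three, Matrix.cons_val_four, Matrix.head_cons, Matrix.tail_cons] at h
    have h' : μ 3 ^ 3 * (r 4 * (2 * μ 2 + μ 0 + μ 1)) = 0 := by
      linear_combination (-1/2 : ℂ) * h
    have h'' := (mul_eq_zero.mp h').resolve_left (pow_ne_zero 3 hi)
    linear_combination h'' - E4
  have hri : r 3 = 0 := by
    have h2 : μ 3 * (2 * r 3) = 0 := by
      linear_combination EA + hr + P01 + P02 + P04 + P10 + P12 + P14 + P20 + P21 + P24 + P40 + P41 + P42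
    have := (mul_eq_zero.mp h2).resolve_left hi
    have h3 : r 3 = (2 * r 3) / 2 := by ring
    rw [h3, this]; simp
  refine ⟨hri, fun l hl hμ => ?_⟩
  fin_cases l
  · -- l = 0
    have hr1 : r 1 = 0 := (mul_eq_zero.mp P10).resolve_right hμ
    have hr2 : r 2 = 0 := (mul_eq_zero.mp P20).resolve_right hμ
    have hr4 : r 4 = 0 := (mul_eq_zero.mp P40).resolve_right hμ
    have hrl : r 0 * μ 0 = 0 := by
      have h := hr; rw [hri, hr1, hr2, hr4] at h; linear_combination h
    have hr0 : r 0 = 0 := (mul_eq_zero.mp hrl).resolve_right hμ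
    funext x; fin_cases x
    · exact hr0
    · exact hr1
    · exact hr2
    · exact hri
    · exact hr4
  · -- l = 1
    have hr0 : r 0 = 0 := (mul_eq_zero.mp P01).resolve_right hμ
    have hr2 : r 2 = 0 := (mul_eq_zero.mp P21).resolve_right hμ
    have hr4 : r 4 = 0 := (mul_eq_zero.mp P41).resolve_right hμ
    have hrl : r 1 * μ 1 = 0 := by
      have h := hr; rw [hri, hr0, hr2, hr4] at h; linear_combination h
    have hr1 : r 1 = 0 := (mul_eq_zero.mp hrl).resolve_right hμ
    funext x; fin_cases x
    · exact hr0
    · exact hr1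
    · exact hr2
    · exact hri
    · exact hr4
  · -- l = 2
    have hr0 : r 0 = 0 := (mul_eq_zero.mp P02).resolve_right hμ
    have hr1 : r 1 = 0 := (mul_eq_zero.mp P12).resolve_right hμ
    have hr4 : r 4 = 0 := (mul_eq_zero.mp P42).resolve_right hμ
    have hrl : r 2 * μ 2 = 0 := by
      have h := hr; rw [hri, hr0, hr1, hr4] at h; linear_combination h
    have hr2 : r 2 = 0 := (mul_eq_zero.mp hrl).resolve_right hμ
    funext x; fin_cases x
    · exact hr0
    · exact hr1
    · exact hr2
    · exact hri
    · exact hr4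
  · exact absurd rfl hl
  · -- l = 4
    have hr0 : r 0 = 0 := (mul_eq_zero.mp P04).resolve_right hμ
    have hr1 : r 1 = 0 := (mul_eq_zero.mp P14).resolve_right hμ
    have hr2 : r 2 = 0 := (mul_eq_zero.mp P24).resolve_right hμ
    have hrl : r 4 * μ 4 = 0 := by
      have h := hr; rw [hri, hr0, hr1, hr2] at h; linear_combination h
    have hr4 : r 4 = 0 := (mul_eq_zero.mp hrl).resolve_right hμ
    funext x; fin_cases x
    · exact hr0
    · exact hr1
    · exact hr2
    · exact hri
    · exact hr4

theorem core4 (μ r : Fin 5 → ℂ) (hi : μ 4 ≠ 0)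
    (hr : r 0 * μ 0 + r 1 * μ 1 + r 2 * μ 2 + r 3 * μ 3 + r 4 * μ 4 = 0)
    (hP : ∀ u : Fin 5 → ℂ, μ 0 * u 0 + μ 1 * u 1 + μ 2 * u 2 + μ 3 * u 3 + μ 4 * u 4 = 0 → D r u = 0) :
    r 4 = 0 ∧ ∀ l : Fin 5, l ≠ 4 → μ l ≠ 0 → r = 0 := by
  have EA : μ 4 * r 4 - (μ 0 + μ 1 + μ 2 + μ 3) * (r 0 + r 1 + r 2 + r 3) = 0 := by
    have h := hP ![μ 4, μ 4, μ 4, μ 4, -(μ 0 + μ 1 + μ 2 + μ 3)] (by simp only [Matrix.cons_val_zero, Matrix.cons_val_one, Matrix.cons_val_two, Matrix.cons_val_three, Matrix.cons_val_four, Matrix.head_cons, Matrix.tail_cons]; ring)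
    simp only [D, Matrix.cons_val_zero, Matrix.cons_val_one, Matrix.cons_val_two, Matrix.cons_val_three, Matrix.cons_val_four, Matrix.head_cons, Matrix.tail_cons] at h
    have h' : μ 4 ^ 3 * (μ 4 * r 4 - (μ 0 + μ 1 + μ 2 + μ 3) * (r 0 + r 1 + r 2 + r 3)) = 0 := by
      linear_combination h
    exact (mul_eq_zero.mp h').resolve_left (pow_ne_zero 3 hi)
  have E0 : r 0 * (μ 1 + μ 2 + μ 3) = 0 := by
    have h := hP ![0, μ 4, μ 4, μ 4, -(μ 1 + μ 2 + μ 3)] (by simp only [Matrix.cons_val_zero, Matrix.cons_val_one, Matrix.cons_val_two, Matrix.cons_val_three, Matrix.cons_val_four, Matrix.head_cons, Matrix.tail_cons]; ring)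
    simp only [D, Matrix.cons_val_zero, Matrix.cons_val_one, Matrix.cons_val_two, Matrix.cons_val_three, Matrix.cons_val_four, Matrix.head_cons, Matrix.tail_cons] at h
    have h' : μ 4 ^ 3 * (r 0 * (μ 1 + μ 2 + μ 3)) = 0 := by linear_combination (-1 : ℂ) * h
    exact (mul_eq_zero.mp h').resolve_left (pow_ne_zero 3 hi)
  have P01 : r 0 * μ 1 = 0 := by
    have h := hP ![0, 2 * μ 4, μ 4, μ 4, -(2 * μ 1 + μ 2 + μ 3)] (by simp only [Matrix.cons_val_zero, Matrix.cons_val_one, Matrix.cons_val_two, Matrix.cons_val_three, Matrix.cons_val_four, Matrix.head_cons, Matrix.tail_cons]; ring)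
    simp only [D, Matrix.cons_val_zero, Matrix.cons_val_one, Matrix.cons_val_two, Matrix.cons_val_three, Matrix.cons_val_four, Matrix.head_cons, Matrix.tail_cons] at h
    have h' : μ 4 ^ 3 * (r 0 * (2 * μ 1 + μ 2 + μ 3)) = 0 := by
      linear_combination (-1/2 : ℂ) * h
    have h'' := (mul_eq_zero.mp h').resolve_left (pow_ne_zero 3 hi)
    linear_combination h'' - E0
  have P02 : r 0 * μ 2 = 0 := by
    have h := hP ![0, μ 4, 2 * μ 4, μ 4, -(2 * μ 2 + μ 1 + μ 3)] (by simp only [Matrix.cons_val_zero, Matrix.cons_val_one, Matrix.cons_val_two, Matrix.cons_val_three, Matrix.cons_val_four, Matrix.head_cons, Matrix.tail_cons]; ring)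
    simp only [D, Matrix.cons_val_zero, Matrix.cons_val_one, Matrix.cons_val_two, Matrix.cons_val_three, Matrix.cons_val_four, Matrix.head_cons, Matrix.tail_cons] at h
    have h' : μ 4 ^ 3 * (r 0 * (2 * μ 2 + μ 1 + μ 3)) = 0 := by
      linear_combination (-1/2 : ℂ) * h
    have h'' := (mul_eq_zero.mp h').resolve_left (pow_ne_zero 3 hi)
    linear_combination h'' - E0
  have P03 : r 0 * μ 3 = 0 := by
    have h := hP ![0, μ 4, μ 4, 2 * μ 4, -(2 * μ 3 + μ 1 + μ 2)] (by simp only [Matrix.cons_val_zero, Matrix.cons_val_one, Matrix.cons_val_two, Matrix.cons_val_three, Matrix.cons_val_four, Matrix.head_cons, Matrix.tail_cons]; ring)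
    simp only [D, Matrix.cons_val_zero, Matrix.cons_val_one, Matrix.cons_val_two, Matrix.cons_val_three, Matrix.cons_val_four, Matrix.head_cons, Matrix.tail_cons] at h
    have h' : μ 4 ^ 3 * (r 0 * (2 * μ 3 + μ 1 + μ 2)) = 0 := by
      linear_combination (-1/2 : ℂ) * h
    have h'' := (mul_eq_zero.mp h').resolve_left (pow_ne_zero 3 hi)
    linear_combination h'' - E0
  have E1 : r 1 * (μ 0 + μ 2 + μ 3) = 0 := by
    have h := hP ![μ 4, 0, μ 4, μ 4, -(μ 0 + μ 2 + μ 3)] (by simp only [Matrix.cons_val_zero, Matrix.cons_val_one, Matrix.cons_val_two, Matrix.cons_val_three, Matrix.cons_val_four, Matrix.head_cons, Matrix.tail_cons]; ring)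
    simp only [D, Matrix.cons_val_zero, Matrix.cons_val_one, Matrix.cons_val_two, Matrix.cons_val_three, Matrix.cons_val_four, Matrix.head_cons, Matrix.tail_cons] at h
    have h' : μ 4 ^ 3 * (r 1 * (μ 0 + μ 2 + μ 3)) = 0 := by linear_combination (-1 : ℂ) * h
    exact (mul_eq_zero.mp h').resolve_left (pow_ne_zero 3 hi)
  have P10 : r 1 * μ 0 = 0 := by
    have h := hP ![2 * μ 4, 0, μ 4, μ 4, -(2 * μ 0 + μ 2 + μ 3)] (by simp only [Matrix.cons_val_zero, Matrix.cons_val_one, Matrix.cons_val_two, Matrix.cons_val_three, Matrix.cons_val_four, Matrix.head_cons, Matrix.tail_cons]; ring)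
    simp only [D, Matrix.cons_val_zero, Matrix.cons_val_one, Matrix.cons_val_two, Matrix.cons_val_three, Matrix.cons_val_four, Matrix.head_cons, Matrix.tail_cons] at h
    have h' : μ 4 ^ 3 * (r 1 * (2 * μ 0 + μ 2 + μ 3)) = 0 := by
      linear_combination (-1/2 : ℂ) * h
    have h'' := (mul_eq_zero.mp h').resolve_left (pow_ne_zero 3 hi)
    linear_combination h'' - E1
  have P12 : r 1 * μ 2 = 0 := by
    have h := hP ![μ 4, 0, 2 * μ 4, μ 4, -(2 * μ 2 + μ 0 + μ 3)] (by simp only [Matrix.cons_val_zero, Matrix.cons_val_one, Matrix.cons_val_two, Matrix.cons_val_three, Matrix.cons_val_four, Matrix.head_cons, Matrix.tail_cons]; ring)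
    simp only [D, Matrix.cons_val_zero, Matrix.cons_val_one, Matrix.cons_val_two, Matrix.cons_val_three, Matrix.cons_val_four, Matrix.head_cons, Matrix.tail_cons] at h
    have h' : μ 4 ^ 3 * (r 1 * (2 * μ 2 + μ 0 + μ 3)) = 0 := by
      linear_combination (-1/2 : ℂ) * h
    have h'' := (mul_eq_zero.mp h').resolve_left (pow_ne_zero 3 hi)
    linear_combination h'' - E1
  have P13 : r 1 * μ 3 = 0 := by
    have h := hP ![μ 4, 0, μ 4, 2 * μ 4, -(2 * μ 3 + μ 0 + μ 2)] (by simp only [Matrix.cons_val_zero, Matrix.cons_val_one, Matrix.cons_val_two, Matrix.cons_val_three, Matrix.cons_val_four, Matrix.head_cons, Matrix.tail_cons]; ring)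
    simp only [D, Matrix.cons_val_zero, Matrix.cons_val_one, Matrix.cons_val_two, Matrix.cons_val_three, Matrix.cons_val_four, Matrix.head_cons, Matrix.tail_cons] at h
    have h' : μ 4 ^ 3 * (r 1 * (2 * μ 3 + μ 0 + μ 2)) = 0 := by
      linear_combination (-1/2 : ℂ) * h
    have h'' := (mul_eq_zero.mp h').resolve_left (pow_ne_zero 3 hi)
    linear_combination h'' - E1
  have E2 : r 2 * (μ 0 + μ 1 + μ 3) = 0 := by
    have h := hP ![μ 4, μ 4, 0, μ 4, -(μ 0 + μ 1 + μ 3)] (by simp only [Matrix.cons_val_zero, Matrix.cons_val_one, Matrix.cons_val_two, Matrix.cons_val_three, Matrix.cons_val_four, Matrix.head_cons, Matrix.tail_cons]; ring)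
    simp only [D, Matrix.cons_val_zero, Matrix.cons_val_one, Matrix.cons_val_two, Matrix.cons_val_three, Matrix.cons_val_four, Matrix.head_cons, Matrix.tail_cons] at h
    have h' : μ 4 ^ 3 * (r 2 * (μ 0 + μ 1 + μ 3)) = 0 := by linear_combination (-1 : ℂ) * h
    exact (mul_eq_zero.mp h').resolve_left (pow_ne_zero 3 hi)
  have P20 : r 2 * μ 0 = 0 := by
    have h := hP ![2 * μ 4, μ 4, 0, μ 4, -(2 * μ 0 + μ 1 + μ 3)] (by simp only [Matrix.cons_val_zero, Matrix.cons_val_one, Matrix.cons_val_two, Matrix.cons_val_three, Matrix.cons_val_four, Matrix.head_cons, Matrix.tail_cons]; ring)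
    simp only [D, Matrix.cons_val_zero, Matrix.cons_val_one, Matrix.cons_val_two, Matrix.cons_val_three, Matrix.cons_val_four, Matrix.head_cons, Matrix.tail_cons] at h
    have h' : μ 4 ^ 3 * (r 2 * (2 * μ 0 + μ 1 + μ 3)) = 0 := by
      linear_combination (-1/2 : ℂ) * h
    have h'' := (mul_eq_zero.mp h').resolve_left (pow_ne_zero 3 hi)
    linear_combination h'' - E2
  have P21 : r 2 * μ 1 = 0 := by
    have h := hP ![μ 4, 2 * μ 4, 0, μ 4, -(2 * μ 1 + μ 0 + μ 3)] (by simp only [Matrix.cons_val_zero, Matrix.cons_val_one, Matrix.cons_val_two, Matrix.cons_val_three, Matrix.cons_val_four, Matrix.head_cons, Matrix.tail_cons]; ring)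
    simp only [D, Matrix.cons_val_zero, Matrix.cons_val_one, Matrix.cons_val_two, Matrix.cons_val_three, Matrix.cons_val_four, Matrix.head_cons, Matrix.tail_cons] at h
    have h' : μ 4 ^ 3 * (r 2 * (2 * μ 1 + μ 0 + μ 3)) = 0 := by
      linear_combination (-1/2 : ℂ) * h
    have h'' := (mul_eq_zero.mp h').resolve_left (pow_ne_zero 3 hi)
    linear_combination h'' - E2
  have P23 : r 2 * μ 3 = 0 := by
    have h := hP ![μ 4, μ 4, 0, 2 * μ 4, -(2 * μ 3 + μ 0 + μ 1)] (by simp only [Matrix.cons_val_zero, Matrix.cons_val_one, Matrix.cons_val_two, Matrix.cons_val_three, Matrix.cons_val_four, Matrix.head_cons, Matrix.tail_cons]; ring)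
    simp only [D, Matrix.cons_val_zero, Matrix.cons_val_one, Matrix.cons_val_two, Matrix.cons_val_three, Matrix.cons_val_four, Matrix.head_cons, Matrix.tail_cons] at h
    have h' : μ 4 ^ 3 * (r 2 * (2 * μ 3 + μ 0 + μ 1)) = 0 := by
      linear_combination (-1/2 : ℂ) * h
    have h'' := (mul_eq_zero.mp h').resolve_left (pow_ne_zero 3 hi)
    linear_combination h'' - E2
  have E3 : r 3 * (μ 0 + μ 1 + μ 2) = 0 := by
    have h := hP ![μ 4, μ 4, μ 4, 0, -(μ 0 + μ 1 + μ 2)] (by simp only [Matrix.cons_val_zero, Matrix.cons_val_one, Matrix.cons_val_two, Matrix.cons_val_three, Matrix.cons_val_four, Matrix.head_cons, Matrix.tail_cons]; ring)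
    simp only [D, Matrix.cons_val_zero, Matrix.cons_val_one, Matrix.cons_val_two, Matrix.cons_val_three, Matrix.cons_val_four, Matrix.head_cons, Matrix.tail_cons] at h
    have h' : μ 4 ^ 3 * (r 3 * (μ 0 + μ 1 + μ 2)) = 0 := by linear_combination (-1 : ℂ) * h
    exact (mul_eq_zero.mp h').resolve_left (pow_ne_zero 3 hi)
  have P30 : r 3 * μ 0 = 0 := by
    have h := hP ![2 * μ 4, μ 4, μ 4, 0, -(2 * μ 0 + μ 1 + μ 2)] (by simp only [Matrix.cons_val_zero, Matrix.cons_val_one, Matrix.cons_val_two, Matrix.cons_val_three, Matrix.cons_val_four, Matrix.head_cons, Matrix.tail_cons]; ring)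
    simp only [D, Matrix.cons_val_zero, Matrix.cons_val_one, Matrix.cons_val_two, Matrix.cons_val_three, Matrix.cons_val_four, Matrix.head_cons, Matrix.tail_cons] at h
    have h' : μ 4 ^ 3 * (r 3 * (2 * μ 0 + μ 1 + μ 2)) = 0 := by
      linear_combination (-1/2 : ℂ) * h
    have h'' := (mul_eq_zero.mp h').resolve_left (pow_ne_zero 3 hi)
    linear_combination h'' - E3
  have P31 : r 3 * μ 1 = 0 := by
    have h := hP ![μ 4, 2 * μ 4, μ 4, 0, -(2 * μ 1 + μ 0 + μ 2)] (by simp only [Matrix.cons_val_zero, Matrix.cons_val_one, Matrix.cons_val_two, Matrix.cons_val_three, Matrix.cons_val_four, Matrix.head_cons, Matrix.tail_cons]; ring)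
    simp only [D, Matrix.cons_val_zero, Matrix.cons_val_one, Matrix.cons_val_two, Matrix.cons_val_three, Matrix.cons_val_four, Matrix.head_cons, Matrix.tail_cons] at h
    have h' : μ 4 ^ 3 * (r 3 * (2 * μ 1 + μ 0 + μ 2)) = 0 := by
      linear_combination (-1/2 : ℂ) * h
    have h'' := (mul_eq_zero.mp h').resolve_left (pow_ne_zero 3 hi)
    linear_combination h'' - E3
  have P32 : r 3 * μ 2 = 0 := by
    have h := hP ![μ 4, μ 4, 2 * μ 4, 0, -(2 * μ 2 + μ 0 + μ 1)] (by simp only [Matrix.cons_val_zero, Matrix.cons_val_one, Matrix.cons_val_two, Matrix.cons_val_three, Matrix.cons_val_four, Matrix.head_cons, Matrix.tail_cons]; ring)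
    simp only [D, Matrix.cons_val_zero, Matrix.cons_val_one, Matrix.cons_val_two, Matrix.cons_val_three, Matrix.cons_val_four, Matrix.head_cons, Matrix.tail_cons] at h
    have h' : μ 4 ^ 3 * (r 3 * (2 * μ 2 + μ 0 + μ 1)) = 0 := by
      linear_combination (-1/2 : ℂ) * h
    have h'' := (mul_eq_zero.mp h').resolve_left (pow_ne_zero 3 hi)
    linear_combination h'' - E3
  have hri : r 4 = 0 := by
    have h2 : μ 4 * (2 * r 4) = 0 := by
      linear_combination EA + hr + P01 + P02 + P03 + P10 + P12 + P13 + P20 + P21 + P23 + P30 + P31 + P32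
    have := (mul_eq_zero.mp h2).resolve_left hi
    have h3 : r 4 = (2 * r 4) / 2 := by ring
    rw [h3, this]; simp
  refine ⟨hri, fun l hl hμ => ?_⟩
  fin_cases l
  · -- l = 0
    have hr1 : r 1 = 0 := (mul_eq_zero.mp P10).resolve_right hμ
    have hr2 : r 2 = 0 := (mul_eq_zero.mp P20).resolve_right hμ
    have hr3 : r 3 = 0 := (mul_eq_zero.mp P30).resolve_right hμ
    have hrl : r 0 * μ 0 = 0 := by
      have h := hr; rw [hri, hr1, hr2, hr3] at h; linear_combination h
    have hr0 : r 0 = 0 := (mul_eq_zero.mp hrl).resolve_right hμ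
    funext x; fin_cases x
    · exact hr0
    · exact hr1
    · exact hr2
    · exact hr3
    · exact hri
  · -- l = 1
    have hr0 : r 0 = 0 := (mul_eq_zero.mp P01).resolve_right hμ
    have hr2 : r 2 = 0 := (mul_eq_zero.mp P21).resolve_right hμ
    have hr3 : r 3 = 0 := (mul_eq_zero.mp P31).resolve_right hμ
    have hrl : r 1 * μ 1 = 0 := by
      have h := hr; rw [hri, hr0, hr2, hr3] at h; linear_combination h
    have hr1 : r 1 = 0 := (mul_eq_zero.mp hrl).resolve_right hμ
    funext x; fin_cases x
    · exact hr0
    · exact hr1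
    · exact hr2
    · exact hr3
    · exact hri
  · -- l = 2
    have hr0 : r 0 = 0 := (mul_eq_zero.mp P02).resolve_right hμ
    have hr1 : r 1 = 0 := (mul_eq_zero.mp P12).resolve_right hμ
    have hr3 : r 3 = 0 := (mul_eq_zero.mp P32).resolve_right hμ
    have hrl : r 2 * μ 2 = 0 := by
      have h := hr; rw [hri, hr0, hr1, hr3] at h; linear_combination h
    have hr2 : r 2 = 0 := (mul_eq_zero.mp hrl).resolve_right hμ
    funext x; fin_cases x
    · exact hr0
    · exact hr1
    · exact hr2
    · exact hr3
    · exact hri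
  · -- l = 3
    have hr0 : r 0 = 0 := (mul_eq_zero.mp P03).resolve_right hμ
    have hr1 : r 1 = 0 := (mul_eq_zero.mp P13).resolve_right hμ
    have hr2 : r 2 = 0 := (mul_eq_zero.mp P23).resolve_right hμ
    have hrl : r 3 * μ 3 = 0 := by
      have h := hr; rw [hri, hr0, hr1, hr2] at h; linear_combination h
    have hr3 : r 3 = 0 := (mul_eq_zero.mp hrl).resolve_right hμ
    funext x; fin_cases x
    · exact hr0
    · exact hr1
    · exact hr2
    · exact hr3
    · exact hri
  · exact absurd rfl hl

theorem core (μ r : Fin 5 → ℂ) (i : Fin 5) (hi : μ i ≠ 0)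
    (hr : r 0 * μ 0 + r 1 * μ 1 + r 2 * μ 2 + r 3 * μ 3 + r 4 * μ 4 = 0)
    (hP : ∀ u : Fin 5 → ℂ, μ 0 * u 0 + μ 1 * u 1 + μ 2 * u 2 + μ 3 * u 3 + μ 4 * u 4 = 0 → D r u = 0) :
    r i = 0 ∧ ∀ l : Fin 5, l ≠ i → μ l ≠ 0 → r = 0 := by
  fin_cases i
  · exact core0 μ r hi hr hP
  · exact core1 μ r hi hr hP
  · exact core2 μ r hi hr hP
  · exact core3 μ r hi hr hP
  · exact core4 μ r hi hr hP

/-! ### matrix bookkeeping: columns of `G⁻¹`, the hyperplane instances, the column normal form -/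

section Bookkeeping
variable (G : Matrix (Fin 5) (Fin 5) ℂ)

theorem GM_apply (hG : G.det ≠ 0) (x b : Fin 5) :
    ∑ j, G x j * G⁻¹ j b = if x = b then 1 else 0 := by
  have h := Matrix.mul_nonsing_inv G (isUnit_iff_ne_zero.mpr hG)
  have := congrFun (congrFun h x) b
  simpa [Matrix.mul_apply, Matrix.one_apply] using this

theorem MG_apply (hG : G.det ≠ 0) (x b : Fin 5) :
    ∑ j, G⁻¹ x j * G j b = if x = b then 1 else 0 := by
  have h := Matrix.nonsing_inv_mul G (isUnit_iff_ne_zero.mpr hG)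
  have := congrFun (congrFun h x) b
  simpa [Matrix.mul_apply, Matrix.one_apply] using this

/-- the hyperplane instances: for `a = pr b`, `D(G_a, u) = 0` whenever `u ⊥` column `b` of `G⁻¹`. -/
theorem hyperplane (hG : G.det ≠ 0) (hX : InLhub (chow G)) (b : Fin 5) (hb : b ≠ 4)
    (u : Fin 5 → ℂ) (hu : ∑ j, G⁻¹ j b * u j = 0) : D (G (pr b)) u = 0 := by
  set a := pr b with ha_def
  have hab : pr a = b := pr_pr b hb
  have ha4 : a ≠ 4 := pr_ne_four b
  set y : Fin 5 → ℂ := fun x => ∑ j, u j * G⁻¹ j x with hy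
  have hyb : y b = 0 := by
    simp only [hy]; rw [← hu]; exact Finset.sum_congr rfl (fun j _ => by ring)
  have hell : ell G y = u := by
    funext j
    simp only [ell, hy, Finset.sum_mul]
    rw [Finset.sum_comm]
    have : ∀ j', ∑ x, u j' * G⁻¹ j' x * G x j = u j' * ∑ x, G⁻¹ j' x * G x j := by
      intro j'; rw [Finset.mul_sum]; exact Finset.sum_congr rfl (fun x _ => by ring)
    simp only [this, MG_apply G hG]
    simp
  have hE : ∑ w : Fin 4 → Fin 5, (∏ k, y (w k)) * chow G a (w 0) (w 1) (w 2) (w 3) = 0 := by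
    refine Finset.sum_eq_zero (fun w _ => ?_)
    by_cases hw : ∃ k, w k = b
    · obtain ⟨k, hk⟩ := hw
      have : ∏ k, y (w k) = 0 := Finset.prod_eq_zero (Finset.mem_univ k) (by rw [hk, hyb])
      rw [this, zero_mul]
    · push Not at hw
      rw [hX.support a _ _ _ _ ha4 (hab ▸ hw 0) (hab ▸ hw 1) (hab ▸ hw 2) (hab ▸ hw 3), mul_zero]
  rw [expansion, hell, R_eq_D] at hE
  exact (mul_eq_zero.mp hE).resolve_left (by norm_num)

/-- COLUMN NORMAL FORM: for each letter `b ≤ 3` some column of `G` is supported on row `b`. -/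
theorem column_supported (hG : G.det ≠ 0) (hX : InLhub (chow G)) (b : Fin 5) (hb : b ≠ 4) :
    ∃ c : Fin 5, (∀ x, x ≠ b → G x c = 0) ∧ G b c ≠ 0 := by
  set a := pr b with ha_def
  have hab : pr a = b := pr_pr b hb
  have hba : a ≠ b := pr_ne_self b hb
  -- column `b` of `G⁻¹` is nonzero
  obtain ⟨i, hi⟩ : ∃ i, G⁻¹ i b ≠ 0 := by
    by_contra h
    push Not at h
    have := GM_apply G hG b b
    simp [h] at this
  have hr : G a 0 * G⁻¹ 0 b + G a 1 * G⁻¹ 1 b + G a 2 * G⁻¹ 2 b + G a 3 * G⁻¹ 3 b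
      + G a 4 * G⁻¹ 4 b = 0 := by
    have := GM_apply G hG a b
    rw [if_neg hba, Fin.sum_univ_five] at this
    exact this
  have hP : ∀ u : Fin 5 → ℂ, G⁻¹ 0 b * u 0 + G⁻¹ 1 b * u 1 + G⁻¹ 2 b * u 2 + G⁻¹ 3 b * u 3
      + G⁻¹ 4 b * u 4 = 0 → D (G a) u = 0 := by
    intro u hu
    apply hyperplane G hG hX b hb u
    rw [Fin.sum_univ_five]; exact hu
  obtain ⟨_, hcol⟩ := core (fun j => G⁻¹ j b) (G a) i hi hr hP
  -- the row `G_a` is nonzero, so column `b` of `G⁻¹` is supported on `{i}`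
  have hMcol : ∀ l, l ≠ i → G⁻¹ l b = 0 := by
    intro l hl
    by_contra hμ
    have hrow : G a = 0 := hcol l hl hμ
    apply hG
    exact Matrix.det_eq_zero_of_row_eq_zero a (fun j => by rw [hrow]; rfl)
  have key : ∀ x, ∑ j, G x j * G⁻¹ j b = G x i * G⁻¹ i b := by
    intro x
    exact Finset.sum_eq_single i (fun j _ hj => by rw [hMcol j hj, mul_zero])
      (fun h => absurd (Finset.mem_univ i) h)
  refine ⟨i, fun x hx => ?_, ?_⟩
  · have := GM_apply G hG x b
    rw [if_neg hx, key] at this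
    exact (mul_eq_zero.mp this).resolve_right hi
  · intro h0
    have := GM_apply G hG b b
    rw [if_pos rfl, key, h0, zero_mul] at this
    exact zero_ne_one this

end Bookkeeping

/-! ### column reindexing and the evaluation at the injective words -/

theorem edot_eq_sum (ε : Fin 5 → Fin 2) (v : Fin 5 → ℂ) : edot ε v = ∑ j, ((ε j).val : ℂ) * v j := by
  simp [edot, Fin.sum_univ_five]

theorem rsgn_eq (ε : Fin 5 → Fin 2) : rsgn ε = (-1) ^ (5 - ∑ j, (ε j).val) := by
  simp [rsgn, Fin.sum_univ_five]

theorem chow_reindex (G : Matrix (Fin 5) (Fin 5) ℂ) (π : Equiv.Perm (Fin 5)) (a b c d e : Fin 5) :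
    chow (fun x j => G x (π j)) a b c d e = chow G a b c d e := by
  unfold chow
  -- substitute ε = ε' ∘ π on the left
  rw [← Equiv.sum_comp (Equiv.arrowCongr π.symm (Equiv.refl (Fin 2)))]
  refine Finset.sum_congr rfl (fun ε _ => ?_)
  have hs : rsgn (Equiv.arrowCongr π.symm (Equiv.refl (Fin 2)) ε) = rsgn ε := by
    rw [rsgn_eq, rsgn_eq]
    congr 2
    simp only [Equiv.arrowCongr_apply, Equiv.coe_refl, Function.comp_apply, id, Equiv.symm_symm]
    exact Equiv.sum_comp π (fun x => (ε x).val)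
  have hr : ∀ x, rd (Equiv.arrowCongr π.symm (Equiv.refl (Fin 2)) ε) (fun x j => G x (π j)) x
      = rd ε G x := by
    intro x
    simp only [rd, edot_eq_sum, Equiv.arrowCongr_apply, Equiv.coe_refl, Function.comp_apply, id,
      Equiv.symm_symm]
    exact Equiv.sum_comp π (fun j => (((ε j).val : ℂ)) * G x j)
  rw [hs, hr, hr, hr, hr, hr]

/-- `chow` is symmetric in the word (here: the two instances needed). -/
theorem chow_w23 (G : Matrix (Fin 5) (Fin 5) ℂ) : chow G 2 3 0 1 4 = chow G 0 1 2 3 4 := by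
  unfold chow; exact Finset.sum_congr rfl (fun ε _ => by ring)
theorem chow_w32 (G : Matrix (Fin 5) (Fin 5) ℂ) : chow G 3 2 0 1 4 = chow G 0 1 2 3 4 := by
  unfold chow; exact Finset.sum_congr rfl (fun ε _ => by ring)

/-- Ryser evaluation on the column normal form: `per = product of the pivots`. -/
theorem chow_normalForm (G : Matrix (Fin 5) (Fin 5) ℂ)
    (h10 : G 1 0 = 0) (h20 : G 2 0 = 0) (h30 : G 3 0 = 0) (h40 : G 4 0 = 0)
    (h01 : G 0 1 = 0) (h21 : G 2 1 = 0) (h31 : G 3 1 = 0) (h41 : G 4 1 = 0)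
    (h02 : G 0 2 = 0) (h12 : G 1 2 = 0) (h32 : G 3 2 = 0) (h42 : G 4 2 = 0)
    (h03 : G 0 3 = 0) (h13 : G 1 3 = 0) (h23 : G 2 3 = 0) (h43 : G 4 3 = 0) :
    chow G 0 1 2 3 4 = G 0 0 * G 1 1 * G 2 2 * G 3 3 * G 4 4 := by
  unfold chow; rw [sum32]
  simp only [Fin.sum_univ_two, rsgn, rd, edot, Matrix.cons_val_zero, Matrix.cons_val_one,
    Matrix.cons_val_two, Matrix.cons_val_three, Matrix.cons_val_four, Matrix.head_cons,
    Matrix.tail_cons, Fin.val_zero, Fin.val_one, Fin.isValue, Nat.cast_zero, Nat.cast_one,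
    h10, h20, h30, h40, h01, h21, h31, h41, h02, h12, h32, h42, h03, h13, h23, h43]
  norm_num
  ring

theorem fifth : ∀ c0 c1 c2 c3 : Fin 5, ∃ c4 : Fin 5, c4 ≠ c0 ∧ c4 ≠ c1 ∧ c4 ≠ c2 ∧ c4 ≠ c3 := by
  decide

theorem cover : ∀ c0 c1 c2 c3 c4 : Fin 5, c0 ≠ c1 → c0 ≠ c2 → c0 ≠ c3 → c0 ≠ c4 → c1 ≠ c2 →
    c1 ≠ c3 → c1 ≠ c4 → c2 ≠ c3 → c2 ≠ c4 → c3 ≠ c4 →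
    ∀ j : Fin 5, j = c0 ∨ j = c1 ∨ j = c2 ∨ j = c3 ∨ j = c4 := by
  decide

/-! ### THEOREM A: no honest Chow tensor lies in `L(U_hub)` — K1 on the whole `GL₅`-class -/

theorem chow_not_InLhub (G : Matrix (Fin 5) (Fin 5) ℂ) (hG : G.det ≠ 0) : ¬ InLhub (chow G) := by
  intro hX
  obtain ⟨c0, hc0, hg0⟩ := column_supported G hG hX 0 (by decide)
  obtain ⟨c1, hc1, hg1⟩ := column_supported G hG hX 1 (by decide)
  obtain ⟨c2, hc2, hg2⟩ := column_supported G hG hX 2 (by decide)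
  obtain ⟨c3, hc3, hg3⟩ := column_supported G hG hX 3 (by decide)
  have h01 : c0 ≠ c1 := fun h => hg0 (h ▸ hc1 0 (by decide))
  have h02 : c0 ≠ c2 := fun h => hg0 (h ▸ hc2 0 (by decide))
  have h03 : c0 ≠ c3 := fun h => hg0 (h ▸ hc3 0 (by decide))
  have h12 : c1 ≠ c2 := fun h => hg1 (h ▸ hc2 1 (by decide))
  have h13 : c1 ≠ c3 := fun h => hg1 (h ▸ hc3 1 (by decide))
  have h23 : c2 ≠ c3 := fun h => hg2 (h ▸ hc3 2 (by decide))
  obtain ⟨c4, h40, h41, h42, h43⟩ := fifth c0 c1 c2 c3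
  -- the fifth pivot `G 4 c4 ≠ 0` (else row 4 vanishes)
  have hg4 : G 4 c4 ≠ 0 := by
    intro h0
    apply hG
    refine Matrix.det_eq_zero_of_row_eq_zero 4 (fun j => ?_)
    rcases cover c0 c1 c2 c3 c4 h01 h02 h03 h40.symm h12 h13 h41.symm h23 h42.symm h43.symm j
      with rfl | rfl | rfl | rfl | rfl
    · exact hc0 4 (by decide)
    · exact hc1 4 (by decide)
    · exact hc2 4 (by decide)
    · exact hc3 4 (by decide)
    · exact h0
  -- reindex the columns by `π : b ↦ c_b`
  have hinj : Function.Injective (![c0, c1, c2, c3, c4] : Fin 5 → Fin 5) := by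
    intro i j h
    fin_cases i <;> fin_cases j <;> simp_all (config := {decide := true})
  let π : Equiv.Perm (Fin 5) := Equiv.ofBijective _ ⟨hinj, Finite.injective_iff_surjective.mp hinj⟩
  have hπ0 : π 0 = c0 := by simp [π]
  have hπ1 : π 1 = c1 := by simp [π]
  have hπ2 : π 2 = c2 := by simp [π]
  have hπ3 : π 3 = c3 := by simp [π]
  have hπ4 : π 4 = c4 := by simp [π]
  set G' : Matrix (Fin 5) (Fin 5) ℂ := fun x j => G x (π j) with hG'
  have hval : chow G 0 1 2 3 4 = G 0 c0 * G 1 c1 * G 2 c2 * G 3 c3 * G 4 c4 := by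
    rw [← chow_reindex G π]
    rw [chow_normalForm (fun x j => G x (π j))
      (by simp only [hπ0]; exact hc0 1 (by decide)) (by simp only [hπ0]; exact hc0 2 (by decide))
      (by simp only [hπ0]; exact hc0 3 (by decide)) (by simp only [hπ0]; exact hc0 4 (by decide))
      (by simp only [hπ1]; exact hc1 0 (by decide)) (by simp only [hπ1]; exact hc1 2 (by decide))
      (by simp only [hπ1]; exact hc1 3 (by decide)) (by simp only [hπ1]; exact hc1 4 (by decide))
      (by simp only [hπ2]; exact hc2 0 (by decide)) (by simp only [hπ2]; exact hc2 1 (by decide))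
      (by simp only [hπ2]; exact hc2 3 (by decide)) (by simp only [hπ2]; exact hc2 4 (by decide))
      (by simp only [hπ3]; exact hc3 0 (by decide)) (by simp only [hπ3]; exact hc3 1 (by decide))
      (by simp only [hπ3]; exact hc3 2 (by decide)) (by simp only [hπ3]; exact hc3 4 (by decide))]
    simp only [hπ0, hπ1, hπ2, hπ3, hπ4]
  have hne : chow G 0 1 2 3 4 ≠ 0 := by
    rw [hval]
    exact mul_ne_zero (mul_ne_zero (mul_ne_zero (mul_ne_zero hg0 hg1) hg2) hg3) hg4
  have htw := hX.twoWord
  rw [chow_w23, chow_w32] at htw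
  apply hne
  linear_combination htw / 2

/-! ### sanity: `chow` is the PERMANENT of the row selection (Ryser's normalisation), three spot checks -/

/-- all-ones matrix: `per J = 120` (`det J = 0`). -/
example : chow (fun _ _ => (1 : ℂ)) 0 1 2 3 4 = 120 := by
  unfold chow; rw [sum32]
  simp only [Fin.sum_univ_two, rsgn, rd, edot, Matrix.cons_val_zero, Matrix.cons_val_one,
    Matrix.cons_val_two, Matrix.cons_val_three, Matrix.cons_val_four, Matrix.head_cons,
    Matrix.tail_cons, Fin.val_zero, Fin.val_one, Fin.isValue, Nat.cast_zero, Nat.cast_one]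
  norm_num

/-- identity matrix: `chow 1 = P₅` at an injective and at a non-injective word. -/
example : chow 1 0 1 2 3 4 = 1 ∧ chow 1 0 0 1 2 3 = 0 := by
  constructor <;>
  · unfold chow; rw [sum32]
    simp only [Fin.sum_univ_two, rsgn, rd, edot, Matrix.cons_val_zero, Matrix.cons_val_one,
      Matrix.cons_val_two, Matrix.cons_val_three, Matrix.cons_val_four, Matrix.head_cons,
      Matrix.tail_cons, Fin.val_zero, Fin.val_one, Fin.isValue, Nat.cast_zero, Nat.cast_one,
      Matrix.one_apply_eq, Matrix.one_apply_ne (by decide : (0 : Fin 5) ≠ 1),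
      Matrix.one_apply_ne (by decide : (0 : Fin 5) ≠ 2), Matrix.one_apply_ne (by decide : (0 : Fin 5) ≠ 3),
      Matrix.one_apply_ne (by decide : (0 : Fin 5) ≠ 4), Matrix.one_apply_ne (by decide : (1 : Fin 5) ≠ 0),
      Matrix.one_apply_ne (by decide : (1 : Fin 5) ≠ 2), Matrix.one_apply_ne (by decide : (1 : Fin 5) ≠ 3),
      Matrix.one_apply_ne (by decide : (1 : Fin 5) ≠ 4), Matrix.one_apply_ne (by decide : (2 : Fin 5) ≠ 0),
      Matrix.one_apply_ne (by decide : (2 : Fin 5) ≠ 1), Matrix.one_apply_ne (by decide : (2 : Fin 5) ≠ 3),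
      Matrix.one_apply_ne (by decide : (2 : Fin 5) ≠ 4), Matrix.one_apply_ne (by decide : (3 : Fin 5) ≠ 0),
      Matrix.one_apply_ne (by decide : (3 : Fin 5) ≠ 1), Matrix.one_apply_ne (by decide : (3 : Fin 5) ≠ 2),
      Matrix.one_apply_ne (by decide : (3 : Fin 5) ≠ 4), Matrix.one_apply_ne (by decide : (4 : Fin 5) ≠ 0),
      Matrix.one_apply_ne (by decide : (4 : Fin 5) ≠ 1), Matrix.one_apply_ne (by decide : (4 : Fin 5) ≠ 2),
      Matrix.one_apply_ne (by decide : (4 : Fin 5) ≠ 3)]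
    norm_num

/-! ### corollaries in K1 language -/

/-- THEOREM A (K1 on the `GL₅`-class of the hub configuration).  For every invertible `G` — i.e. for
the pattern `P₅` transformed by any `g = G ∈ GL₅(ℂ)` acting diagonally, `(G·P₅)(v) = per G[v,:] = chow G v`
— and for ARBITRARY long factors `Y` (slice `{0}`) and `W_k` (rays `{0,k}`), the hub short factors
`θ = e⁴`, `ω = e⁰∧e¹ + e²∧e³` do not carry `G·P₅`.  Equivalently (apply `G⁻¹`): no configuration in the
`GL₅`-orbit of the hub configuration carries `P₅`, although every one of them carries `D₅` (`δ = 1` is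
`GL₅`-invariant since `g·D₅ = det g · D₅`). -/
theorem K1_hubClass (G : Matrix (Fin 5) (Fin 5) ℂ) (hG : G.det ≠ 0)
    (Y : Fin 5 → Fin 5 → Fin 5 → Fin 5 → ℂ) (W : Fin 4 → Fin 5 → Fin 5 → Fin 5 → ℂ) :
    ¬ ∀ a b c d e : Fin 5, chow G a b c d e = (th a : ℂ) * Y b c d e + (om a b : ℂ) * W 0 c d e
      + (om a c : ℂ) * W 1 b d e + (om a d : ℂ) * W 2 b c e + (om a e : ℂ) * W 3 b c d :=
  fun h => chow_not_InLhub G hG ⟨Y, W, h⟩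

def e0 (x : Fin 5) : ℤ := if x = 0 then 1 else 0

/-- the same for the `GL₅`-class of the exact `2222` star design (`SignPencilSketch` §2d): its short factors
`ω(v₀,v_k)` and `θ(v₀)e⁰(v_k)` span a subspace of `L(U_hub)` (`θe⁰ ⊗ Z ∈ θ ⊗ V⁴`). -/
theorem K1_star2222Class (G : Matrix (Fin 5) (Fin 5) ℂ) (hG : G.det ≠ 0)
    (W Z : Fin 4 → Fin 5 → Fin 5 → Fin 5 → ℂ) :
    ¬ ∀ a b c d e : Fin 5, chow G a b c d e =
      ((om a b : ℂ) * W 0 c d e + (th a : ℂ) * (e0 b : ℂ) * Z 0 c d e)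
      + ((om a c : ℂ) * W 1 b d e + (th a : ℂ) * (e0 c : ℂ) * Z 1 b d e)
      + ((om a d : ℂ) * W 2 b c e + (th a : ℂ) * (e0 d : ℂ) * Z 2 b c e)
      + ((om a e : ℂ) * W 3 b c d + (th a : ℂ) * (e0 e : ℂ) * Z 3 b c d) := by
  intro h
  apply chow_not_InLhub G hG
  refine ⟨fun b c d e => (e0 b : ℂ) * Z 0 c d e + (e0 c : ℂ) * Z 1 b d e + (e0 d : ℂ) * Z 2 b c e
    + (e0 e : ℂ) * Z 3 b c d, W, fun a b c d e => ?_⟩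
  rw [h a b c d e]; ring

/-! ## §10 THEOREM B — K1 on the `GL₅`-class of the two-hub `84` configuration (`SixTail`), kernel

`L(U_84) = Σ_{k=1..4} ω(v₀,v_k)⊗V³ + Σ_{k=2..4} ω(v₁,v_k)⊗V³` (the weight-84 exact design of `D₅`,
`SignPencilSketch` §2d, arbitrary long factors).  **Theorem B** (`chow_not_InL84`, `K1_twohub84Class`): for every
invertible `G`, `G·P₅ ∉ L(U_84)`.  With Theorem A this gives K1 on the `GL₅`-orbits of ALL THREE exact `D₅`
designs on record (hub 72, star 96, two-hub 84) — both LM tail profiles.  Proof: (1) `L(U_84)` vanishes at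
the words `(4,4,*,*,*)` (`ω(4,·) = 0`), so `per[G_4;G_4;u;u;u] = 6·D₂(G_4,G_4,u) ≡ 0` in `u`
(`expansion3`, `R2_eq_D2`), whence row 4 of `G` has a single nonzero entry (`row_four_single`); after a
column permutation (`chow_reindex`, `Matrix.det_permute'`) it is `g·e₄`.  (2) `L(U_84)` vanishes at the words
`(a,4,w)` with `w_k ≠ p(a)`; contracting gives `D₂(G_a, G_4, u) = 0` on the hyperplane `u ⊥` column `p(a)`
of `G⁻¹`, and `u₄·D₂(G_a, g e₄, u) = g·D(r°, u)` with `r° = (G_{a0},…,G_{a3},0)`; since `(G G⁻¹)_{4b} = 0`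
kills the entry `(G⁻¹)_{4,p(a)}`, the CORE LEMMA of §9 applies to `(μ, r°)`: `r° = 0` would make rows `a`
and `4` proportional (`Matrix.det_updateRow_add_smul_self`), so column `p(a)` of `G⁻¹` is a coordinate vector
— the same column normal form as in Theorem A — and the two-word certificate (valid on `L(U_84)` as well)
finishes exactly as there. -/

theorem om_four : ∀ x : Fin 5, om 4 x = 0 := by decide

/-- `X ∈ L(U_84)` (two hubs `0` and `1`, no slice; long factors arbitrary). -/
def InL84 (X : Fin 5 → Fin 5 → Fin 5 → Fin 5 → Fin 5 → ℂ) : Prop :=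
  ∃ (W : Fin 4 → Fin 5 → Fin 5 → Fin 5 → ℂ) (W' : Fin 3 → Fin 5 → Fin 5 → Fin 5 → ℂ),
    ∀ a b c d e, X a b c d e = (om a b : ℂ) * W 0 c d e + (om a c : ℂ) * W 1 b d e
      + (om a d : ℂ) * W 2 b c e + (om a e : ℂ) * W 3 b c d
      + (om b c : ℂ) * W' 0 a d e + (om b d : ℂ) * W' 1 a c e + (om b e : ℂ) * W' 2 a c d

theorem InL84.support44 {X} (hX : InL84 X) (c d e : Fin 5) : X 4 4 c d e = 0 := by
  obtain ⟨W, W', h⟩ := hX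
  rw [h, om_four, om_four, om_four, om_four]
  simp

theorem InL84.support4 {X} (hX : InL84 X) (a c d e : Fin 5) (hc : c ≠ pr a) (hd : d ≠ pr a)
    (he : e ≠ pr a) : X a 4 c d e = 0 := by
  obtain ⟨W, W', h⟩ := hX
  rw [h, om_eq_zero_of_ne a 4 (pr_ne_four a).symm, om_eq_zero_of_ne a c hc, om_eq_zero_of_ne a d hd,
    om_eq_zero_of_ne a e he, om_four, om_four, om_four]
  simp

theorem InL84.twoWord {X} (hX : InL84 X) : X 2 3 0 1 4 + X 3 2 0 1 4 = 0 := by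
  obtain ⟨W, W', h⟩ := hX
  rw [h, h, om23, om32,
    om_eq_zero_of_ne 2 0 (by decide), om_eq_zero_of_ne 2 1 (by decide),
    om_eq_zero_of_ne 2 4 (by decide), om_eq_zero_of_ne 3 0 (by decide),
    om_eq_zero_of_ne 3 1 (by decide), om_eq_zero_of_ne 3 4 (by decide)]
  push_cast; ring

/-- mixed second derivative of `e₅`: `D₂(r,r',u) = Σ_{j≠j'} r_j r'_{j'} Π_{l∉{j,j'}} u_l`. -/
def D2 (r r' u : Fin 5 → ℂ) : ℂ :=
  r 0 * r' 1 * (u 2 * u 3 * u 4)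
  + r 0 * r' 2 * (u 1 * u 3 * u 4)
  + r 0 * r' 3 * (u 1 * u 2 * u 4)
  + r 0 * r' 4 * (u 1 * u 2 * u 3)
  + r 1 * r' 0 * (u 2 * u 3 * u 4)
  + r 1 * r' 2 * (u 0 * u 3 * u 4)
  + r 1 * r' 3 * (u 0 * u 2 * u 4)
  + r 1 * r' 4 * (u 0 * u 2 * u 3)
  + r 2 * r' 0 * (u 1 * u 3 * u 4)
  + r 2 * r' 1 * (u 0 * u 3 * u 4)
  + r 2 * r' 3 * (u 0 * u 1 * u 4)
  + r 2 * r' 4 * (u 0 * u 1 * u 3)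
  + r 3 * r' 0 * (u 1 * u 2 * u 4)
  + r 3 * r' 1 * (u 0 * u 2 * u 4)
  + r 3 * r' 2 * (u 0 * u 1 * u 4)
  + r 3 * r' 4 * (u 0 * u 1 * u 2)
  + r 4 * r' 0 * (u 1 * u 2 * u 3)
  + r 4 * r' 1 * (u 0 * u 2 * u 3)
  + r 4 * r' 2 * (u 0 * u 1 * u 3)
  + r 4 * r' 3 * (u 0 * u 1 * u 2)

/-- Ryser functional with two distinguished rows: `R₂(r,r',u) = per[r;r';u;u;u]`. -/
def R2 (r r' u : Fin 5 → ℂ) : ℂ := ∑ e : Fin 5 → Fin 2, rsgn e * (edot e r * edot e r' * edot e u ^ 3)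

theorem R2_eq_D2 (r r' u : Fin 5 → ℂ) : R2 r r' u = 6 * D2 r r' u := by
  unfold R2
  rw [sum32]
  simp only [Fin.sum_univ_two, rsgn, edot, D2, Fin.isValue, Matrix.cons_val_zero, Matrix.cons_val_one,
    Matrix.cons_val_two, Matrix.cons_val_three, Matrix.cons_val_four, Matrix.head_cons, Matrix.tail_cons,
    Fin.val_zero, Fin.val_one, Nat.cast_zero, Nat.cast_one]
  norm_num
  ring

/-- EXPANSION with two fixed letters: `Σ_{w∈[5]³} y_{w₁}y_{w₂}y_{w₃}·chow G (a,b,w) = R₂(G_a, G_b, ℓ(y))`. -/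
theorem expansion3 (G : Matrix (Fin 5) (Fin 5) ℂ) (a b : Fin 5) (y : Fin 5 → ℂ) :
    ∑ w : Fin 3 → Fin 5, (∏ k, y (w k)) * chow G a b (w 0) (w 1) (w 2)
      = R2 (G a) (G b) (ell G y) := by
  have step1 : ∀ w : Fin 3 → Fin 5, (∏ k, y (w k)) * chow G a b (w 0) (w 1) (w 2)
      = ∑ ε : Fin 5 → Fin 2, rsgn ε * rd ε G a * rd ε G b * ∏ k, (y (w k) * rd ε G (w k)) := by
    intro w
    simp only [chow, Finset.mul_sum, Fin.prod_univ_three]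
    exact Finset.sum_congr rfl (fun ε _ => by ring)
  simp_rw [step1]
  rw [Finset.sum_comm]
  unfold R2
  refine Finset.sum_congr rfl (fun ε _ => ?_)
  rw [← Finset.mul_sum, ← Fintype.prod_sum (fun (_ : Fin 3) (x : Fin 5) => y x * rd ε G x)]
  simp only [sum_mul_rd, Finset.prod_const, Finset.card_univ, Fintype.card_fin]
  simp [rd]; ring

section B
variable (G : Matrix (Fin 5) (Fin 5) ℂ)

/-- `y = u·G⁻¹` solves `ℓ(y) = u`. -/
theorem ell_solve (hG : G.det ≠ 0) (u : Fin 5 → ℂ) : ell G (fun x => ∑ j, u j * G⁻¹ j x) = u := by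
  funext j
  simp only [ell, Finset.sum_mul]
  rw [Finset.sum_comm]
  have : ∀ j', ∑ x, u j' * G⁻¹ j' x * G x j = u j' * ∑ x, G⁻¹ j' x * G x j := by
    intro j'; rw [Finset.mul_sum]; exact Finset.sum_congr rfl (fun x _ => by ring)
  simp only [this, MG_apply G hG]
  simp

/-- STEP 1: row 4 of `G` has pairwise vanishing products of entries. -/
theorem row_four_products (hG : G.det ≠ 0) (hX : InL84 (chow G)) :
    ∀ j j' : Fin 5, j ≠ j' → G 4 j * G 4 j' = 0 := by
  have hR : ∀ u : Fin 5 → ℂ, R2 (G 4) (G 4) u = 0 := by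
    intro u
    have h := expansion3 G 4 4 (fun x => ∑ j, u j * G⁻¹ j x)
    rw [ell_solve G hG] at h
    rw [← h]
    exact Finset.sum_eq_zero (fun w _ => by rw [hX.support44, mul_zero])
  have hD : ∀ u : Fin 5 → ℂ, D2 (G 4) (G 4) u = 0 := by
    intro u
    have h := hR u
    rw [R2_eq_D2] at h
    exact (mul_eq_zero.mp h).resolve_left (by norm_num)
  have P01 : G 4 0 * G 4 1 = 0 := by
    have h := hD ![0, 0, 1, 1, 1]
    simp only [D2, Matrix.cons_val_zero, Matrix.cons_val_one, Matrix.cons_val_two, Matrix.cons_val_three, Matrix.cons_val_four, Matrix.head_cons, Matrix.tail_cons] at h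
    linear_combination h / 2
  have P02 : G 4 0 * G 4 2 = 0 := by
    have h := hD ![0, 1, 0, 1, 1]
    simp only [D2, Matrix.cons_val_zero, Matrix.cons_val_one, Matrix.cons_val_two, Matrix.cons_val_three, Matrix.cons_val_four, Matrix.head_cons, Matrix.tail_cons] at h
    linear_combination h / 2
  have P03 : G 4 0 * G 4 3 = 0 := by
    have h := hD ![0, 1, 1, 0, 1]
    simp only [D2, Matrix.cons_val_zero, Matrix.cons_val_one, Matrix.cons_val_two, Matrix.cons_val_three, Matrix.cons_val_four, Matrix.head_cons, Matrix.tail_cons] at h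
    linear_combination h / 2
  have P04 : G 4 0 * G 4 4 = 0 := by
    have h := hD ![0, 1, 1, 1, 0]
    simp only [D2, Matrix.cons_val_zero, Matrix.cons_val_one, Matrix.cons_val_two, Matrix.cons_val_three, Matrix.cons_val_four, Matrix.head_cons, Matrix.tail_cons] at h
    linear_combination h / 2
  have P12 : G 4 1 * G 4 2 = 0 := by
    have h := hD ![1, 0, 0, 1, 1]
    simp only [D2, Matrix.cons_val_zero, Matrix.cons_val_one, Matrix.cons_val_two, Matrix.cons_val_three, Matrix.cons_val_four, Matrix.head_cons, Matrix.tail_cons] at h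
    linear_combination h / 2
  have P13 : G 4 1 * G 4 3 = 0 := by
    have h := hD ![1, 0, 1, 0, 1]
    simp only [D2, Matrix.cons_val_zero, Matrix.cons_val_one, Matrix.cons_val_two, Matrix.cons_val_three, Matrix.cons_val_four, Matrix.head_cons, Matrix.tail_cons] at h
    linear_combination h / 2
  have P14 : G 4 1 * G 4 4 = 0 := by
    have h := hD ![1, 0, 1, 1, 0]
    simp only [D2, Matrix.cons_val_zero, Matrix.cons_val_one, Matrix.cons_val_two, Matrix.cons_val_three, Matrix.cons_val_four, Matrix.head_cons, Matrix.tail_cons] at h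
    linear_combination h / 2
  have P23 : G 4 2 * G 4 3 = 0 := by
    have h := hD ![1, 1, 0, 0, 1]
    simp only [D2, Matrix.cons_val_zero, Matrix.cons_val_one, Matrix.cons_val_two, Matrix.cons_val_three, Matrix.cons_val_four, Matrix.head_cons, Matrix.tail_cons] at h
    linear_combination h / 2
  have P24 : G 4 2 * G 4 4 = 0 := by
    have h := hD ![1, 1, 0, 1, 0]
    simp only [D2, Matrix.cons_val_zero, Matrix.cons_val_one, Matrix.cons_val_two, Matrix.cons_val_three, Matrix.cons_val_four, Matrix.head_cons, Matrix.tail_cons] at h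
    linear_combination h / 2
  have P34 : G 4 3 * G 4 4 = 0 := by
    have h := hD ![1, 1, 1, 0, 0]
    simp only [D2, Matrix.cons_val_zero, Matrix.cons_val_one, Matrix.cons_val_two, Matrix.cons_val_three, Matrix.cons_val_four, Matrix.head_cons, Matrix.tail_cons] at h
    linear_combination h / 2
  intro j j' h
  fin_cases j <;> fin_cases j'
  · exact absurd rfl h
  · exact P01
  · exact P02
  · exact P03
  · exact P04
  · rw [mul_comm]; exact P01
  · exact absurd rfl h
  · exact P12
  · exact P13
  · exact P14
  · rw [mul_comm]; exact P02
  · rw [mul_comm]; exact P12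
  · exact absurd rfl h
  · exact P23
  · exact P24
  · rw [mul_comm]; exact P03
  · rw [mul_comm]; exact P13
  · rw [mul_comm]; exact P23
  · exact absurd rfl h
  · exact P34
  · rw [mul_comm]; exact P04
  · rw [mul_comm]; exact P14
  · rw [mul_comm]; exact P24
  · rw [mul_comm]; exact P34
  · exact absurd rfl h

/-- STEP 2 (normalised: row 4 of `G` supported on column 4): the column normal form. -/
theorem column_supported84 (hG : G.det ≠ 0) (hX : InL84 (chow G)) (h4 : ∀ j : Fin 5, j ≠ 4 → G 4 j = 0)
    (b : Fin 5) (hb : b ≠ 4) : ∃ c : Fin 5, (∀ x, x ≠ b → G x c = 0) ∧ G b c ≠ 0 := by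
  set a := pr b with ha_def
  have hab : pr a = b := pr_pr b hb
  have hba : a ≠ b := pr_ne_self b hb
  -- the pivot `g = G 4 4 ≠ 0`
  have hg : G 4 4 ≠ 0 := by
    intro h0
    apply hG
    refine Matrix.det_eq_zero_of_row_eq_zero 4 (fun j => ?_)
    by_cases hj : j = 4
    · rw [hj, h0]
    · exact h4 j hj
  -- `(G⁻¹)_{4,b} = 0`
  have hM4 : G⁻¹ 4 b = 0 := by
    have := GM_apply G hG 4 b
    rw [if_neg (Ne.symm hb)] at this
    rw [Finset.sum_eq_single 4 (fun j _ hj => by rw [h4 j hj, zero_mul])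
      (fun h => absurd (Finset.mem_univ 4) h)] at this
    exact (mul_eq_zero.mp this).resolve_left hg
  -- column `b` of `G⁻¹` is nonzero
  obtain ⟨i, hi⟩ : ∃ i, G⁻¹ i b ≠ 0 := by
    by_contra h
    push Not at h
    have := GM_apply G hG b b
    simp [h] at this
  -- the truncated row `r° = (G a 0, …, G a 3, 0)`
  have hr : G a 0 * G⁻¹ 0 b + G a 1 * G⁻¹ 1 b + G a 2 * G⁻¹ 2 b + G a 3 * G⁻¹ 3 b
      + (0 : ℂ) * G⁻¹ 4 b = 0 := by
    have := GM_apply G hG a b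
    rw [if_neg hba, Fin.sum_univ_five, hM4] at this
    rw [hM4]; linear_combination this
  have hD2 : ∀ u : Fin 5 → ℂ, ∑ j, G⁻¹ j b * u j = 0 → D2 (G a) (G 4) u = 0 := by
    intro u hu
    set y : Fin 5 → ℂ := fun x => ∑ j, u j * G⁻¹ j x with hy
    have hyb : y b = 0 := by
      simp only [hy]; rw [← hu]; exact Finset.sum_congr rfl (fun j _ => by ring)
    have hE : ∑ w : Fin 3 → Fin 5, (∏ k, y (w k)) * chow G a 4 (w 0) (w 1) (w 2) = 0 := by
      refine Finset.sum_eq_zero (fun w _ => ?_)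
      by_cases hw : ∃ k, w k = b
      · obtain ⟨k, hk⟩ := hw
        have : ∏ k, y (w k) = 0 := Finset.prod_eq_zero (Finset.mem_univ k) (by rw [hk, hyb])
        rw [this, zero_mul]
      · push Not at hw
        rw [hX.support4 a _ _ _ (hab ▸ hw 0) (hab ▸ hw 1) (hab ▸ hw 2), mul_zero]
    rw [expansion3, ell_solve G hG, R2_eq_D2] at hE
    exact (mul_eq_zero.mp hE).resolve_left (by norm_num)
  have hP : ∀ u : Fin 5 → ℂ, G⁻¹ 0 b * u 0 + G⁻¹ 1 b * u 1 + G⁻¹ 2 b * u 2 + G⁻¹ 3 b * u 3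
      + G⁻¹ 4 b * u 4 = 0 → D ![G a 0, G a 1, G a 2, G a 3, 0] u = 0 := by
    intro u hu
    have h2 := hD2 u (by rw [Fin.sum_univ_five]; exact hu)
    have hid : u 4 * D2 (G a) (G 4) u = G 4 4 * D ![G a 0, G a 1, G a 2, G a 3, 0] u := by
      simp only [D2, D, h4 0 (by decide), h4 1 (by decide), h4 2 (by decide), h4 3 (by decide),
        Matrix.cons_val_zero, Matrix.cons_val_one, Matrix.cons_val_two, Matrix.cons_val_three,
        Matrix.cons_val_four, Matrix.head_cons, Matrix.tail_cons]
      ring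
    rw [h2, mul_zero] at hid
    exact (mul_eq_zero.mp hid.symm).resolve_left hg
  obtain ⟨_, hcol⟩ := core (fun j => G⁻¹ j b) ![G a 0, G a 1, G a 2, G a 3, 0] i hi
    (by simpa only [Matrix.cons_val_zero, Matrix.cons_val_one, Matrix.cons_val_two, Matrix.cons_val_three,
        Matrix.cons_val_four, Matrix.head_cons, Matrix.tail_cons] using hr) hP
  -- `r° = 0` would make rows `a` and `4` proportional
  have hMcol : ∀ l, l ≠ i → G⁻¹ l b = 0 := by
    intro l hl
    by_contra hμ
    have hz := hcol l hl hμ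
    have h0 : G a 0 = 0 := by have := congrFun hz 0; simpa using this
    have h1 : G a 1 = 0 := by have := congrFun hz 1; simpa using this
    have h2 : G a 2 = 0 := by have := congrFun hz 2; simpa using this
    have h3 : G a 3 = 0 := by have := congrFun hz 3; simpa using this
    have ha4 : a ≠ 4 := pr_ne_four b
    apply hG
    rw [← Matrix.det_updateRow_add_smul_self G ha4 (-(G a 4 / G 4 4))]
    refine Matrix.det_eq_zero_of_row_eq_zero a (fun j => ?_)
    rw [Matrix.updateRow_self]
    simp only [Pi.add_apply, Pi.smul_apply, smul_eq_mul]
    fin_cases j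
    · simp [h0, h4 0 (by decide)]
    · simp [h1, h4 1 (by decide)]
    · simp [h2, h4 2 (by decide)]
    · simp [h3, h4 3 (by decide)]
    · show G a 4 + -(G a 4 / G 4 4) * G 4 4 = 0
      field_simp; ring
  have key : ∀ x, ∑ j, G x j * G⁻¹ j b = G x i * G⁻¹ i b := by
    intro x
    exact Finset.sum_eq_single i (fun j _ hj => by rw [hMcol j hj, mul_zero])
      (fun h => absurd (Finset.mem_univ i) h)
  refine ⟨i, fun x hx => ?_, ?_⟩
  · have := GM_apply G hG x b
    rw [if_neg hx, key] at this
    exact (mul_eq_zero.mp this).resolve_right hi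
  · intro h0
    have := GM_apply G hG b b
    rw [if_pos rfl, key, h0, zero_mul] at this
    exact zero_ne_one this

/-- THEOREM B, normalised case. -/
theorem chow_not_InL84_normalised (hG : G.det ≠ 0) (h4 : ∀ j : Fin 5, j ≠ 4 → G 4 j = 0) :
    ¬ InL84 (chow G) := by
  intro hX
  obtain ⟨c0, hc0, hg0⟩ := column_supported84 G hG hX h4 0 (by decide)
  obtain ⟨c1, hc1, hg1⟩ := column_supported84 G hG hX h4 1 (by decide)
  obtain ⟨c2, hc2, hg2⟩ := column_supported84 G hG hX h4 2 (by decide)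
  obtain ⟨c3, hc3, hg3⟩ := column_supported84 G hG hX h4 3 (by decide)
  have h01 : c0 ≠ c1 := fun h => hg0 (h ▸ hc1 0 (by decide))
  have h02 : c0 ≠ c2 := fun h => hg0 (h ▸ hc2 0 (by decide))
  have h03 : c0 ≠ c3 := fun h => hg0 (h ▸ hc3 0 (by decide))
  have h12 : c1 ≠ c2 := fun h => hg1 (h ▸ hc2 1 (by decide))
  have h13 : c1 ≠ c3 := fun h => hg1 (h ▸ hc3 1 (by decide))
  have h23 : c2 ≠ c3 := fun h => hg2 (h ▸ hc3 2 (by decide))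
  obtain ⟨c4, h40, h41, h42, h43⟩ := fifth c0 c1 c2 c3
  have hg4 : G 4 c4 ≠ 0 := by
    intro h0
    apply hG
    refine Matrix.det_eq_zero_of_row_eq_zero 4 (fun j => ?_)
    rcases cover c0 c1 c2 c3 c4 h01 h02 h03 h40.symm h12 h13 h41.symm h23 h42.symm h43.symm j
      with rfl | rfl | rfl | rfl | rfl
    · exact hc0 4 (by decide)
    · exact hc1 4 (by decide)
    · exact hc2 4 (by decide)
    · exact hc3 4 (by decide)
    · exact h0
  have hinj : Function.Injective (![c0, c1, c2, c3, c4] : Fin 5 → Fin 5) := by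
    intro i j h
    fin_cases i <;> fin_cases j <;> simp_all (config := {decide := true})
  let π : Equiv.Perm (Fin 5) := Equiv.ofBijective _ ⟨hinj, Finite.injective_iff_surjective.mp hinj⟩
  have hπ0 : π 0 = c0 := by simp [π]
  have hπ1 : π 1 = c1 := by simp [π]
  have hπ2 : π 2 = c2 := by simp [π]
  have hπ3 : π 3 = c3 := by simp [π]
  have hπ4 : π 4 = c4 := by simp [π]
  have hval : chow G 0 1 2 3 4 = G 0 c0 * G 1 c1 * G 2 c2 * G 3 c3 * G 4 c4 := by
    rw [← chow_reindex G π]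
    rw [chow_normalForm (fun x j => G x (π j))
      (by simp only [hπ0]; exact hc0 1 (by decide)) (by simp only [hπ0]; exact hc0 2 (by decide))
      (by simp only [hπ0]; exact hc0 3 (by decide)) (by simp only [hπ0]; exact hc0 4 (by decide))
      (by simp only [hπ1]; exact hc1 0 (by decide)) (by simp only [hπ1]; exact hc1 2 (by decide))
      (by simp only [hπ1]; exact hc1 3 (by decide)) (by simp only [hπ1]; exact hc1 4 (by decide))
      (by simp only [hπ2]; exact hc2 0 (by decide)) (by simp only [hπ2]; exact hc2 1 (by decide))
      (by simp only [hπ2]; exact hc2 3 (by decide)) (by simp only [hπ2]; exact hc2 4 (by decide))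
      (by simp only [hπ3]; exact hc3 0 (by decide)) (by simp only [hπ3]; exact hc3 1 (by decide))
      (by simp only [hπ3]; exact hc3 2 (by decide)) (by simp only [hπ3]; exact hc3 4 (by decide))]
    simp only [hπ0, hπ1, hπ2, hπ3, hπ4]
  have hne : chow G 0 1 2 3 4 ≠ 0 := by
    rw [hval]
    exact mul_ne_zero (mul_ne_zero (mul_ne_zero (mul_ne_zero hg0 hg1) hg2) hg3) hg4
  have htw := hX.twoWord
  rw [chow_w23, chow_w32] at htw
  apply hne
  linear_combination htw / 2

end B

/-- THEOREM B: no honest Chow tensor lies in `L(U_84)` — K1 on the `GL₅`-class of the two-hub `84` design. -/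
theorem chow_not_InL84 (G : Matrix (Fin 5) (Fin 5) ℂ) (hG : G.det ≠ 0) : ¬ InL84 (chow G) := by
  intro hX
  -- row 4 has a single nonzero entry `G 4 js`
  obtain ⟨js, hjs⟩ : ∃ js, G 4 js ≠ 0 := by
    by_contra h
    push Not at h
    exact hG (Matrix.det_eq_zero_of_row_eq_zero 4 h)
  have hrow : ∀ j, j ≠ js → G 4 j = 0 := fun j hj =>
    (mul_eq_zero.mp (row_four_products G hG hX j js hj)).resolve_right hjs
  -- move column `js` to position 4
  let π : Equiv.Perm (Fin 5) := Equiv.swap 4 js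
  set G' : Matrix (Fin 5) (Fin 5) ℂ := fun x j => G x (π j) with hG'def
  have hG' : G'.det ≠ 0 := by
    have h := Matrix.det_permute' π G
    have hsub : G.submatrix id π = G' := by
      funext x j; simp [hG'def, Matrix.submatrix_apply]
    rw [hsub] at h
    rw [h]
    refine mul_ne_zero ?_ hG
    rcases Int.units_eq_one_or (Equiv.Perm.sign π) with hs | hs <;> simp [hs]
  have h4' : ∀ j : Fin 5, j ≠ 4 → G' 4 j = 0 := by
    intro j hj
    simp only [hG'def]
    apply hrow
    intro hπ
    apply hj
    have : π j = π 4 := by rw [hπ]; simp [π]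
    exact π.injective this
  have hX' : InL84 (chow G') := by
    have hfun : chow G' = chow G := by
      funext a b c d e; exact chow_reindex G π a b c d e
    rw [hfun]; exact hX
  exact chow_not_InL84_normalised G' hG' h4' hX'

/-- the same in the shape of `SignPencilSketch` §2d (`twohub84_configuration_pencil_only_D5`: `W : Fin 7 → …`). -/
theorem K1_twohub84Class (G : Matrix (Fin 5) (Fin 5) ℂ) (hG : G.det ≠ 0)
    (W : Fin 7 → Fin 5 → Fin 5 → Fin 5 → ℂ) :
    ¬ ∀ a b c d e : Fin 5, chow G a b c d e =
      (om a b : ℂ) * W 0 c d e + (om a c : ℂ) * W 1 b d e + (om a d : ℂ) * W 2 b c e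
        + (om a e : ℂ) * W 3 b c d + (om b c : ℂ) * W 4 a d e + (om b d : ℂ) * W 5 a c e
        + (om b e : ℂ) * W 6 a c d := by
  intro h
  apply chow_not_InL84 G hG
  exact ⟨![W 0, W 1, W 2, W 3], ![W 4, W 5, W 6], fun a b c d e => by
    rw [h a b c d e]
    simp only [Matrix.cons_val_zero, Matrix.cons_val_one, Matrix.cons_val_two, Matrix.cons_val_three,
      Matrix.head_cons, Matrix.tail_cons]⟩

/-! ## §11 THEOREM C — K1 on the ENTIRE hub profile (kernel) -/

/-- the Levi-Civita table `D₅` on words: `levW r = det[e_(r 0); …; e_(r 4)]` (`= sgn r` on bijective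
words, `0` otherwise). -/
def levW (r : Fin 5 → Fin 5) : ℂ :=
  Matrix.detRowAlternating (fun i => (Pi.single (r i) (1:ℂ) : Fin 5 → ℂ))

/-- `levW r` is the determinant of the `0/1` matrix with rows `e_(r i)` (`Matrix.det M` is by
definition `Matrix.detRowAlternating M`). -/
theorem levW_eq_det (r : Fin 5 → Fin 5) :
    levW r = Matrix.det (Matrix.of fun i j => if j = r i then (1:ℂ) else 0) := by
  unfold levW Matrix.det
  congr 1
  ext i j
  simp [Pi.single_apply]

/-- multilinear expansion of the determinant over words. -/
theorem det_expand (y : Fin 5 → Fin 5 → ℂ) :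
    Matrix.det (Matrix.of y) = ∑ r : Fin 5 → Fin 5, (∏ i, y i (r i)) * levW r := by
  have hy : (Matrix.of y : Matrix (Fin 5) (Fin 5) ℂ)
      = fun i => ∑ j, (y i j) • (Pi.single j (1:ℂ) : Fin 5 → ℂ) := by
    ext i j
    simp [Finset.sum_apply, Pi.single_apply]
  show Matrix.detRowAlternating (Matrix.of y) = _
  rw [hy]
  have h1 := (Matrix.detRowAlternating : (Fin 5 → ℂ) [⋀^Fin 5]→ₗ[ℂ] ℂ).toMultilinearMap.map_sum
    (fun i j => (y i j) • (Pi.single j (1:ℂ) : Fin 5 → ℂ))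
  simp only [AlternatingMap.coe_multilinearMap] at h1
  rw [h1]
  refine Finset.sum_congr rfl (fun r _ => ?_)
  have h2 := (Matrix.detRowAlternating : (Fin 5 → ℂ) [⋀^Fin 5]→ₗ[ℂ] ℂ).toMultilinearMap.map_smul_univ
    (fun i => y i (r i)) (fun i => (Pi.single (r i) (1:ℂ) : Fin 5 → ℂ))
  simp only [AlternatingMap.coe_multilinearMap] at h2
  rw [h2, smul_eq_mul]
  rfl

theorem sum5W (f : (Fin 5 → Fin 5) → ℂ) :
    ∑ r, f r = ∑ a, ∑ b, ∑ c, ∑ d, ∑ e, f ![a, b, c, d, e] := by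
  rw [sum_vecCons 4]
  refine Finset.sum_congr rfl (fun a _ => ?_)
  rw [sum_vecCons 3]
  refine Finset.sum_congr rfl (fun b _ => ?_)
  rw [sum_vecCons 2]
  refine Finset.sum_congr rfl (fun c _ => ?_)
  rw [sum_vecCons 1]
  refine Finset.sum_congr rfl (fun d _ => ?_)
  rw [sum_vecCons 0]
  refine Finset.sum_congr rfl (fun e _ => ?_)
  rw [sum_fin0]

theorem sum4W (f : (Fin 4 → Fin 5) → ℂ) :
    ∑ r, f r = ∑ b, ∑ c, ∑ d, ∑ e, f ![b, c, d, e] := by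
  rw [sum_vecCons 3]
  refine Finset.sum_congr rfl (fun b _ => ?_)
  rw [sum_vecCons 2]
  refine Finset.sum_congr rfl (fun c _ => ?_)
  rw [sum_vecCons 1]
  refine Finset.sum_congr rfl (fun d _ => ?_)
  rw [sum_vecCons 0]
  refine Finset.sum_congr rfl (fun e _ => ?_)
  rw [sum_fin0]

/-- EVALUATION (D side): `det[λ;x₀;x₁;x₂;x₃] = Σ_words λ_a x₀_b x₁_c x₂_d x₃_e · D₅(a,b,c,d,e)`. -/
theorem evalD (l x0 x1 x2 x3 : Fin 5 → ℂ) :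
    Matrix.det (Matrix.of ![l, x0, x1, x2, x3])
      = ∑ a, ∑ b, ∑ c, ∑ d, ∑ e, l a * x0 b * x1 c * x2 d * x3 e * levW ![a, b, c, d, e] := by
  rw [det_expand, sum5W]
  refine Finset.sum_congr rfl (fun a _ => Finset.sum_congr rfl (fun b _ => Finset.sum_congr rfl
    (fun c _ => Finset.sum_congr rfl (fun d _ => Finset.sum_congr rfl (fun e _ => ?_)))))
  simp only [Fin.prod_univ_five, Matrix.cons_val_zero, Matrix.cons_val_one, Matrix.cons_val_two, Matrix.cons_val_three, Matrix.cons_val_four, Matrix.head_cons, Matrix.tail_cons]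

theorem ell_one (x : Fin 5 → ℂ) : ell (1 : Matrix (Fin 5) (Fin 5) ℂ) x = x := by
  funext j
  simp [ell, Matrix.one_apply]

theorem edot_one (ε : Fin 5 → Fin 2) (a : Fin 5) :
    edot ε ((1 : Matrix (Fin 5) (Fin 5) ℂ) a) = ((ε a).val : ℂ) := by
  rw [edot_eq_sum]
  simp [Matrix.one_apply]

theorem R_rowsum (l x : Fin 5 → ℂ) :
    ∑ a, l a * R ((1 : Matrix (Fin 5) (Fin 5) ℂ) a) x = R l x := by
  unfold R
  simp_rw [edot_one, Finset.mul_sum]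
  rw [Finset.sum_comm]
  refine Finset.sum_congr rfl (fun ε _ => ?_)
  rw [edot_eq_sum ε l, Finset.sum_mul, Finset.mul_sum]
  refine Finset.sum_congr rfl (fun a _ => ?_)
  ring

/-- EVALUATION (P side): `Σ_words λ_a x_b x_c x_d x_e · P₅(a,b,c,d,e) = per[λ;x;x;x;x] = 24·D(λ,x)`. -/
theorem evalP (l x : Fin 5 → ℂ) :
    ∑ a, ∑ b, ∑ c, ∑ d, ∑ e, l a * x b * x c * x d * x e * chow 1 a b c d e = 24 * D l x := by
  have inner : ∀ a, ∑ b, ∑ c, ∑ d, ∑ e, l a * x b * x c * x d * x e * chow 1 a b c d e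
      = l a * R ((1 : Matrix (Fin 5) (Fin 5) ℂ) a) x := by
    intro a
    have e := expansion 1 a x
    rw [ell_one] at e
    rw [← e, Finset.mul_sum, sum4W]
    refine Finset.sum_congr rfl (fun b _ => Finset.sum_congr rfl (fun c _ => Finset.sum_congr rfl
      (fun d _ => Finset.sum_congr rfl (fun e _ => ?_))))
    simp only [Fin.prod_univ_four, Matrix.cons_val_zero, Matrix.cons_val_one, Matrix.cons_val_two, Matrix.cons_val_three, Matrix.head_cons, Matrix.tail_cons]
    ring
  rw [Finset.sum_congr rfl (fun a _ => inner a), R_rowsum, R_eq_D]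

/-! ### factorisation of the slice / ray terms under evaluation -/

theorem factorS (p q0 q1 q2 q3 θ : Fin 5 → ℂ) (Y : Fin 5 → Fin 5 → Fin 5 → Fin 5 → ℂ) :
    ∑ a, ∑ b, ∑ c, ∑ d, ∑ e, p a * q0 b * q1 c * q2 d * q3 e * (θ a * Y b c d e)
      = (∑ a, θ a * p a) * ∑ b, ∑ c, ∑ d, ∑ e, Y b c d e * q0 b * q1 c * q2 d * q3 e := by
  rw [Finset.sum_mul]
  refine Finset.sum_congr rfl (fun a _ => ?_)
  rw [Finset.mul_sum]
  refine Finset.sum_congr rfl (fun b _ => ?_)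
  rw [Finset.mul_sum]
  refine Finset.sum_congr rfl (fun c _ => ?_)
  rw [Finset.mul_sum]
  refine Finset.sum_congr rfl (fun d _ => ?_)
  rw [Finset.mul_sum]
  refine Finset.sum_congr rfl (fun e _ => ?_)
  ring

theorem factor0 (p q0 q1 q2 q3 : Fin 5 → ℂ) (F : Fin 5 → Fin 5 → ℂ) (G : Fin 5 → Fin 5 → Fin 5 → ℂ) :
    ∑ a, ∑ b, ∑ c, ∑ d, ∑ e, p a * q0 b * q1 c * q2 d * q3 e * (F a b * G c d e)
      = (∑ a, ∑ b, F a b * p a * q0 b) * ∑ c, ∑ d, ∑ e, G c d e * q1 c * q2 d * q3 e := by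
  rw [Finset.sum_mul]
  refine Finset.sum_congr rfl (fun a _ => ?_)
  rw [Finset.sum_mul]
  refine Finset.sum_congr rfl (fun b _ => ?_)
  rw [Finset.mul_sum]
  refine Finset.sum_congr rfl (fun c _ => ?_)
  rw [Finset.mul_sum]
  refine Finset.sum_congr rfl (fun d _ => ?_)
  rw [Finset.mul_sum]
  refine Finset.sum_congr rfl (fun e _ => ?_)
  ring

theorem factor1 (p q0 q1 q2 q3 : Fin 5 → ℂ) (F : Fin 5 → Fin 5 → ℂ) (G : Fin 5 → Fin 5 → Fin 5 → ℂ) :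
    ∑ a, ∑ b, ∑ c, ∑ d, ∑ e, p a * q0 b * q1 c * q2 d * q3 e * (F a c * G b d e)
      = (∑ a, ∑ c, F a c * p a * q1 c) * ∑ b, ∑ d, ∑ e, G b d e * q0 b * q2 d * q3 e := by
  rw [Finset.sum_mul]
  refine Finset.sum_congr rfl (fun a _ => ?_)
  conv_lhs => rw [Finset.sum_comm]
  rw [Finset.sum_mul]
  refine Finset.sum_congr rfl (fun c _ => ?_)
  rw [Finset.mul_sum]
  refine Finset.sum_congr rfl (fun b _ => ?_)
  rw [Finset.mul_sum]
  refine Finset.sum_congr rfl (fun d _ => ?_)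
  rw [Finset.mul_sum]
  refine Finset.sum_congr rfl (fun e _ => ?_)
  ring

theorem factor2 (p q0 q1 q2 q3 : Fin 5 → ℂ) (F : Fin 5 → Fin 5 → ℂ) (G : Fin 5 → Fin 5 → Fin 5 → ℂ) :
    ∑ a, ∑ b, ∑ c, ∑ d, ∑ e, p a * q0 b * q1 c * q2 d * q3 e * (F a d * G b c e)
      = (∑ a, ∑ d, F a d * p a * q2 d) * ∑ b, ∑ c, ∑ e, G b c e * q0 b * q1 c * q3 e := by
  rw [Finset.sum_mul]
  refine Finset.sum_congr rfl (fun a _ => ?_)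
  conv_lhs => enter [2, b]; rw [Finset.sum_comm]
  conv_lhs => rw [Finset.sum_comm]
  rw [Finset.sum_mul]
  refine Finset.sum_congr rfl (fun d _ => ?_)
  rw [Finset.mul_sum]
  refine Finset.sum_congr rfl (fun b _ => ?_)
  rw [Finset.mul_sum]
  refine Finset.sum_congr rfl (fun c _ => ?_)
  rw [Finset.mul_sum]
  refine Finset.sum_congr rfl (fun e _ => ?_)
  ring

theorem factor3 (p q0 q1 q2 q3 : Fin 5 → ℂ) (F : Fin 5 → Fin 5 → ℂ) (G : Fin 5 → Fin 5 → Fin 5 → ℂ) :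
    ∑ a, ∑ b, ∑ c, ∑ d, ∑ e, p a * q0 b * q1 c * q2 d * q3 e * (F a e * G b c d)
      = (∑ a, ∑ e, F a e * p a * q3 e) * ∑ b, ∑ c, ∑ d, G b c d * q0 b * q1 c * q2 d := by
  rw [Finset.sum_mul]
  refine Finset.sum_congr rfl (fun a _ => ?_)
  conv_lhs => enter [2, b, 2, c]; rw [Finset.sum_comm]
  conv_lhs => enter [2, b]; rw [Finset.sum_comm]
  conv_lhs => rw [Finset.sum_comm]
  rw [Finset.sum_mul]
  refine Finset.sum_congr rfl (fun e _ => ?_)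
  rw [Finset.mul_sum]
  refine Finset.sum_congr rfl (fun b _ => ?_)
  rw [Finset.mul_sum]
  refine Finset.sum_congr rfl (fun c _ => ?_)
  rw [Finset.mul_sum]
  refine Finset.sum_congr rfl (fun d _ => ?_)
  ring

/-! ### the hub PROFILE: slice `{0}` (short factor `θ`, ghost allowed) + rays `{0,k}` with ARBITRARY
bilinear short factors `C k` (any rank, symmetric parts allowed); long factors free -/

def thdot (θ l : Fin 5 → ℂ) : ℂ := ∑ a, θ a * l a

def bil (F : Fin 5 → Fin 5 → ℂ) (l x : Fin 5 → ℂ) : ℂ := ∑ a, ∑ b, F a b * l a * x b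

/-- the covector `u(λ, ·)` of a bilinear short factor `u = F` at `λ = l`. -/
def nvec (F : Fin 5 → Fin 5 → ℂ) (l : Fin 5 → ℂ) (b : Fin 5) : ℂ := ∑ a, F a b * l a

theorem bil_eq (F : Fin 5 → Fin 5 → ℂ) (l x : Fin 5 → ℂ) : bil F l x = ∑ b, nvec F l b * x b := by
  unfold bil nvec
  rw [Finset.sum_comm]
  refine Finset.sum_congr rfl (fun b _ => ?_)
  rw [Finset.sum_mul]

/-- `D₅ ∈ L(U)` for the hub-profile configuration `U = (θ; C 0, …, C 3)`. -/
def HubD (θ : Fin 5 → ℂ) (C : Fin 4 → Fin 5 → Fin 5 → ℂ) : Prop :=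
  ∃ (Y : Fin 5 → Fin 5 → Fin 5 → Fin 5 → ℂ) (W : Fin 4 → Fin 5 → Fin 5 → Fin 5 → ℂ),
    ∀ a b c d e, levW ![a, b, c, d, e] = θ a * Y b c d e + C 0 a b * W 0 c d e + C 1 a c * W 1 b d e
      + C 2 a d * W 2 b c e + C 3 a e * W 3 b c d

/-- `P₅ ∈ L(U)` for the same configuration (`P₅ = chow 1`, Ryser). -/
def HubP (θ : Fin 5 → ℂ) (C : Fin 4 → Fin 5 → Fin 5 → ℂ) : Prop :=
  ∃ (Y : Fin 5 → Fin 5 → Fin 5 → Fin 5 → ℂ) (W : Fin 4 → Fin 5 → Fin 5 → Fin 5 → ℂ),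
    ∀ a b c d e, chow 1 a b c d e = θ a * Y b c d e + C 0 a b * W 0 c d e + C 1 a c * W 1 b d e
      + C 2 a d * W 2 b c e + C 3 a e * W 3 b c d

theorem HubD.eval {θ : Fin 5 → ℂ} {C : Fin 4 → Fin 5 → Fin 5 → ℂ} (h : HubD θ C)
    (l x0 x1 x2 x3 : Fin 5 → ℂ) (hl : thdot θ l = 0) (h0 : bil (C 0) l x0 = 0)
    (h1 : bil (C 1) l x1 = 0) (h2 : bil (C 2) l x2 = 0) (h3 : bil (C 3) l x3 = 0) :
    Matrix.det (Matrix.of ![l, x0, x1, x2, x3]) = 0 := by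
  obtain ⟨Y, W, hW⟩ := h
  rw [evalD]
  simp_rw [hW]
  simp only [mul_add, Finset.sum_add_distrib]
  rw [factorS, factor0, factor1, factor2, factor3]
  unfold thdot at hl
  unfold bil at h0 h1 h2 h3
  rw [hl, h0, h1, h2, h3]
  ring

theorem HubP.eval {θ : Fin 5 → ℂ} {C : Fin 4 → Fin 5 → Fin 5 → ℂ} (h : HubP θ C) (l x : Fin 5 → ℂ)
    (hl : thdot θ l = 0) (hk : ∀ k, bil (C k) l x = 0) : D l x = 0 := by
  obtain ⟨Y, W, hW⟩ := h
  have h24 : (24:ℂ) * D l x = 0 := by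
    rw [← evalP]
    simp_rw [hW]
    simp only [mul_add, Finset.sum_add_distrib]
    rw [factorS, factor0, factor1, factor2, factor3]
    unfold thdot at hl
    unfold bil at hk
    rw [hl, hk 0, hk 1, hk 2, hk 3]
    ring
  exact (mul_eq_zero.mp h24).resolve_left (by norm_num)

/-- ALIGNMENT of the ray short factors on `ker θ` (the output of the det side, THEOREM C step (2)). -/
def Aligned (θ : Fin 5 → ℂ) (C : Fin 4 → Fin 5 → Fin 5 → ℂ) : Prop :=
  ∀ l : Fin 5 → ℂ, thdot θ l = 0 → l ≠ 0 →
    nvec (C 0) l ≠ 0 ∧ (∑ b, nvec (C 0) l b * l b) = 0 ∧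
      ∀ (k : Fin 4) (x : Fin 5 → ℂ), (∑ b, nvec (C 0) l b * x b) = 0 → (∑ b, nvec (C k) l b * x b) = 0

theorem exists_pair (θ : Fin 5 → ℂ) : ∃ l1 l2 : Fin 5 → ℂ, thdot θ l1 = 0 ∧ thdot θ l2 = 0 ∧
    ∀ s t : ℂ, s • l1 + t • l2 = 0 → s = 0 ∧ t = 0 := by
  by_cases h0 : θ 0 = 0
  · by_cases h1 : θ 1 = 0
    · refine ⟨![1, 0, 0, 0, 0], ![0, 1, 0, 0, 0], ?_, ?_, ?_⟩
      · simp [thdot, Fin.sum_univ_five, h0]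
      · simp [thdot, Fin.sum_univ_five, h1]
      · intro s t h
        have e0 := congrFun h 0
        have e1 := congrFun h 1
        simp only [Pi.add_apply, Pi.smul_apply, smul_eq_mul, Pi.zero_apply, Matrix.cons_val_zero, Matrix.cons_val_one] at e0 e1
        constructor
        · linear_combination e0
        · linear_combination e1
    · refine ⟨![1, 0, 0, 0, 0], ![0, θ 2, -θ 1, 0, 0], ?_, ?_, ?_⟩
      · simp [thdot, Fin.sum_univ_five, h0]
      · simp [thdot, Fin.sum_univ_five]; ring
      · intro s t h
        have e0 := congrFun h 0
        have e2 := congrFun h 2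
        simp only [Pi.add_apply, Pi.smul_apply, smul_eq_mul, Pi.zero_apply, Matrix.cons_val_zero, Matrix.cons_val_two, Matrix.head_cons, Matrix.tail_cons] at e0 e2
        refine ⟨by linear_combination e0, ?_⟩
        have : t * θ 1 = 0 := by linear_combination -e2
        exact (mul_eq_zero.mp this).resolve_right h1
  · refine ⟨![θ 1, -θ 0, 0, 0, 0], ![θ 2, 0, -θ 0, 0, 0], ?_, ?_, ?_⟩
    · simp [thdot, Fin.sum_univ_five]; ring
    · simp [thdot, Fin.sum_univ_five]; ring
    · intro s t h
      have e1 := congrFun h 1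
      have e2 := congrFun h 2
      simp only [Pi.add_apply, Pi.smul_apply, smul_eq_mul, Pi.zero_apply, Matrix.cons_val_zero, Matrix.cons_val_one, Matrix.cons_val_two, Matrix.head_cons, Matrix.tail_cons] at e1 e2
      have hs : s * θ 0 = 0 := by linear_combination -e1
      have ht : t * θ 0 = 0 := by linear_combination -e2
      exact ⟨(mul_eq_zero.mp hs).resolve_right h0, (mul_eq_zero.mp ht).resolve_right h0⟩

/-- THEOREM C, steps (3)–(4): alignment + `P₅ ∈ L(U)` is contradictory (core lemma + finite union). -/
theorem K1_hub_of_aligned {θ : Fin 5 → ℂ} {C : Fin 4 → Fin 5 → Fin 5 → ℂ} (hA : Aligned θ C)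
    (hP : HubP θ C) : False := by
  have hPev : ∀ l x, thdot θ l = 0 → l ≠ 0 → (∑ b, nvec (C 0) l b * x b) = 0 → D l x = 0 := by
    intro l x hl hl0 hx
    refine hP.eval l x hl (fun k => ?_)
    rw [bil_eq]; exact (hA l hl hl0).2.2 k x hx
  have axis : ∀ l, thdot θ l = 0 → l ≠ 0 →
      ∃ i, nvec (C 0) l i ≠ 0 ∧ ∀ j, j ≠ i → nvec (C 0) l j = 0 := by
    intro l hl hl0
    obtain ⟨hn, horth, -⟩ := hA l hl hl0
    obtain ⟨i, hi⟩ : ∃ i, nvec (C 0) l i ≠ 0 := by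
      by_contra h
      push Not at h
      exact hn (funext h)
    refine ⟨i, hi, fun j hj => ?_⟩
    by_contra hj'
    have hc := core (nvec (C 0) l) l i hi
      (by simp only [Fin.sum_univ_five] at horth; linear_combination horth)
      (fun u hu => hPev l u hl hl0 (by rw [Fin.sum_univ_five]; exact hu))
    exact hl0 (hc.2 j hj hj')
  have nadd : ∀ l l' b, nvec (C 0) (l + l') b = nvec (C 0) l b + nvec (C 0) l' b := by
    intro l l' b
    simp only [nvec, Pi.add_apply, mul_add, Finset.sum_add_distrib]
  have nsmul : ∀ (s : ℂ) l b, nvec (C 0) (s • l) b = s * nvec (C 0) l b := by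
    intro s l b
    simp only [nvec, Pi.smul_apply, smul_eq_mul, Finset.mul_sum]
    exact Finset.sum_congr rfl (fun a _ => by ring)
  have tadd : ∀ l l', thdot θ (l + l') = thdot θ l + thdot θ l' := by
    intro l l'
    simp only [thdot, Pi.add_apply, mul_add, Finset.sum_add_distrib]
  have tsmul : ∀ (s : ℂ) l, thdot θ (s • l) = s * thdot θ l := by
    intro s l
    simp only [thdot, Pi.smul_apply, smul_eq_mul, Finset.mul_sum]
    exact Finset.sum_congr rfl (fun a _ => by ring)
  obtain ⟨l1, l2, h1, h2, hind⟩ := exists_pair θ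
  have hl1 : l1 ≠ 0 := by
    intro h
    have := (hind 1 0 (by rw [h]; simp)).1
    exact one_ne_zero this
  have hl2 : l2 ≠ 0 := by
    intro h
    have := (hind 0 1 (by rw [h]; simp)).2
    exact one_ne_zero this
  obtain ⟨i, hi, hi'⟩ := axis l1 h1 hl1
  obtain ⟨j, hj, hj'⟩ := axis l2 h2 hl2
  have h12 : thdot θ (l1 + l2) = 0 := by rw [tadd, h1, h2, add_zero]
  have hl12 : l1 + l2 ≠ 0 := by
    intro h
    have := (hind 1 1 (by simpa using h)).1
    exact one_ne_zero this
  obtain ⟨m, -, hm'⟩ := axis (l1 + l2) h12 hl12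
  have hij : i = j := by
    by_contra hij
    have him : i = m := by
      by_contra him
      have := hm' i him
      rw [nadd, hj' i hij, add_zero] at this
      exact hi this
    have hjm : j = m := by
      by_contra hjm
      have := hm' j hjm
      rw [nadd, hi' j (Ne.symm hij), zero_add] at this
      exact hj this
    exact hij (him.trans hjm.symm)
  subst hij
  have h3 : thdot θ (nvec (C 0) l2 i • l1 + (-nvec (C 0) l1 i) • l2) = 0 := by
    rw [tadd, tsmul, tsmul, h1, h2]; ring
  have hl3 : nvec (C 0) l2 i • l1 + (-nvec (C 0) l1 i) • l2 ≠ 0 := by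
    intro h
    exact hj (hind _ _ h).1
  have hn3 : nvec (C 0) (nvec (C 0) l2 i • l1 + (-nvec (C 0) l1 i) • l2) = 0 := by
    funext b
    rw [nadd, nsmul, nsmul, Pi.zero_apply]
    by_cases hb : b = i
    · rw [hb]; ring
    · rw [hi' b hb, hj' b hb]; ring
  exact (hA _ h3 hl3).1 hn3

/-! ### THEOREM C step (2): ALIGNMENT from the det side (linear algebra) -/

/-- the functional `x ↦ n·x`. -/
def dotL (n : Fin 5 → ℂ) : (Fin 5 → ℂ) →ₗ[ℂ] ℂ where
  toFun x := ∑ b, n b * x b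
  map_add' x y := by simp only [Pi.add_apply, mul_add, Finset.sum_add_distrib]
  map_smul' s x := by
    simp only [Pi.smul_apply, smul_eq_mul, RingHom.id_apply, Finset.mul_sum]
    exact Finset.sum_congr rfl (fun b _ => by ring)

theorem dotL_apply (n x : Fin 5 → ℂ) : dotL n x = ∑ b, n b * x b := rfl

theorem finrank_V : Module.finrank ℂ (Fin 5 → ℂ) = 5 := Module.finrank_fin_fun ℂ

theorem four_le_finrank_ker (n : Fin 5 → ℂ) : 4 ≤ Module.finrank ℂ (LinearMap.ker (dotL n)) := by
  have h := LinearMap.finrank_range_add_finrank_ker (dotL n)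
  rw [finrank_V] at h
  have hr : Module.finrank ℂ (LinearMap.range (dotL n)) ≤ 1 := by
    have := Submodule.finrank_le (LinearMap.range (dotL n))
    simpa using this
  omega

theorem finrank_ker_eq (n : Fin 5 → ℂ) (hn : n ≠ 0) :
    Module.finrank ℂ (LinearMap.ker (dotL n)) = 4 := by
  obtain ⟨i, hi⟩ : ∃ i, n i ≠ 0 := by
    by_contra h
    push Not at h
    exact hn (funext h)
  have hsurj : Function.Surjective (dotL n) := by
    intro c
    refine ⟨Pi.single i (c / n i), ?_⟩
    rw [dotL_apply, Finset.sum_eq_single i (fun b _ hb => by rw [Pi.single_eq_of_ne hb, mul_zero])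
      (fun h => absurd (Finset.mem_univ i) h), Pi.single_eq_same]
    field_simp
  have h := LinearMap.finrank_range_add_finrank_ker (dotL n)
  rw [finrank_V, LinearMap.range_eq_top.mpr hsurj, finrank_top, Module.finrank_self] at h
  omega

theorem exists_not_mem {H S : Submodule ℂ (Fin 5 → ℂ)}
    (h : Module.finrank ℂ S < Module.finrank ℂ H) : ∃ v ∈ H, v ∉ S := by
  by_contra hc
  push Not at hc
  exact absurd (Submodule.finrank_mono (show H ≤ S from fun v hv => hc v hv)) (not_le.mpr h)

theorem finrank_span_range_le {m : ℕ} (v : Fin m → (Fin 5 → ℂ)) :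
    Module.finrank ℂ (Submodule.span ℂ (Set.range v)) ≤ m := by
  have := finrank_range_le_card (R := ℂ) v
  simpa [Set.finrank] using this

/-- the heart of step (2): if `det[d;c;b;a;λ] = 0` whenever `a ⊥ n_A, b ⊥ n_B, c ⊥ n_C, d ⊥ n_D`, then
`n_D ≠ 0`, `n_D·λ = 0` and `n_A^⊥ ⊆ n_D^⊥` (a Rado/Hall transversal count, done by hand). -/
theorem align_core (l : Fin 5 → ℂ) (hl0 : l ≠ 0) (nA nB nC nD : Fin 5 → ℂ)
    (Hdet : ∀ a b c d : Fin 5 → ℂ, (∑ i, nA i * a i) = 0 → (∑ i, nB i * b i) = 0 →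
      (∑ i, nC i * c i) = 0 → (∑ i, nD i * d i) = 0 → Matrix.det (Matrix.of ![d, c, b, a, l]) = 0) :
    nD ≠ 0 ∧ (∑ i, nD i * l i) = 0 ∧ ∀ x : Fin 5 → ℂ, (∑ i, nA i * x i) = 0 → (∑ i, nD i * x i) = 0 := by
  have inner : ∀ a, a ∈ LinearMap.ker (dotL nA) → a ∉ Submodule.span ℂ (Set.range ![l]) →
      nD ≠ 0 ∧ l ∈ LinearMap.ker (dotL nD) ∧ a ∈ LinearMap.ker (dotL nD) := by
    intro a haA haS
    have hli1 : LinearIndependent ℂ ![l] := linearIndependent_unique_iff.mpr (by simpa using hl0)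
    have hli2 : LinearIndependent ℂ ![a, l] := linearIndependent_finCons.mpr ⟨hli1, haS⟩
    obtain ⟨b, hbB, hbS⟩ := exists_not_mem (H := LinearMap.ker (dotL nB))
      (S := Submodule.span ℂ (Set.range ![a, l]))
      (lt_of_le_of_lt (finrank_span_range_le _) (by have := four_le_finrank_ker nB; omega))
    have hli3 : LinearIndependent ℂ ![b, a, l] := linearIndependent_finCons.mpr ⟨hli2, hbS⟩
    obtain ⟨c, hcC, hcS⟩ := exists_not_mem (H := LinearMap.ker (dotL nC))
      (S := Submodule.span ℂ (Set.range ![b, a, l]))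
      (lt_of_le_of_lt (finrank_span_range_le _) (by have := four_le_finrank_ker nC; omega))
    have hli4 : LinearIndependent ℂ ![c, b, a, l] := linearIndependent_finCons.mpr ⟨hli3, hcS⟩
    have hDS : ∀ d, d ∈ LinearMap.ker (dotL nD) → d ∈ Submodule.span ℂ (Set.range ![c, b, a, l]) := by
      intro d hdD
      have hdet0 : Matrix.det (Matrix.of ![d, c, b, a, l]) = 0 :=
        Hdet a b c d (LinearMap.mem_ker.mp haA) (LinearMap.mem_ker.mp hbB) (LinearMap.mem_ker.mp hcC)
          (LinearMap.mem_ker.mp hdD)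
      by_contra hdS
      have hli5 : LinearIndependent ℂ ![d, c, b, a, l] := linearIndependent_finCons.mpr ⟨hli4, hdS⟩
      have hU : IsUnit (Matrix.of ![d, c, b, a, l]) :=
        (Matrix.linearIndependent_rows_iff_isUnit (A := Matrix.of ![d, c, b, a, l])).mp hli5
      rw [Matrix.isUnit_iff_isUnit_det, hdet0] at hU
      exact not_isUnit_zero hU
    have hS4 : Module.finrank ℂ (Submodule.span ℂ (Set.range ![c, b, a, l])) ≤ 4 :=
      finrank_span_range_le _
    have hnD : nD ≠ 0 := by
      intro h0
      obtain ⟨v, -, hvS⟩ := exists_not_mem (H := ⊤) (S := Submodule.span ℂ (Set.range ![c, b, a, l]))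
        (by rw [finrank_top, finrank_V]; omega)
      refine hvS (hDS v ?_)
      rw [LinearMap.mem_ker, dotL_apply]
      simp [h0]
    have hfD : Module.finrank ℂ (LinearMap.ker (dotL nD)) = 4 := finrank_ker_eq nD hnD
    have hEq : LinearMap.ker (dotL nD) = Submodule.span ℂ (Set.range ![c, b, a, l]) :=
      Submodule.eq_of_le_of_finrank_le (fun d hd => hDS d hd) (by rw [hfD]; exact hS4)
    refine ⟨hnD, ?_, ?_⟩
    · rw [hEq]; exact Submodule.subset_span ⟨3, rfl⟩
    · rw [hEq]; exact Submodule.subset_span ⟨2, rfl⟩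
  obtain ⟨a₀, ha₀A, ha₀S⟩ := exists_not_mem (H := LinearMap.ker (dotL nA))
    (S := Submodule.span ℂ (Set.range ![l]))
    (lt_of_le_of_lt (finrank_span_range_le _) (by have := four_le_finrank_ker nA; omega))
  obtain ⟨hnD, hlD, -⟩ := inner a₀ ha₀A ha₀S
  refine ⟨hnD, LinearMap.mem_ker.mp hlD, fun x hx => ?_⟩
  have hxA : x ∈ LinearMap.ker (dotL nA) := LinearMap.mem_ker.mpr hx
  by_cases hxS : x ∈ Submodule.span ℂ (Set.range ![l])
  · have hle : Submodule.span ℂ (Set.range ![l]) ≤ LinearMap.ker (dotL nD) := by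
      rw [Submodule.span_le]
      rintro _ ⟨i, rfl⟩
      fin_cases i
      exact hlD
    exact LinearMap.mem_ker.mp (hle hxS)
  · exact LinearMap.mem_ker.mp (inner x hxA hxS).2.2

theorem det_rows_perm (M : Matrix (Fin 5) (Fin 5) ℂ) (σ : Equiv.Perm (Fin 5)) (h : M.det = 0) :
    (M.submatrix σ id).det = 0 := by
  rw [Matrix.det_permute, h, mul_zero]

def σ0 : Equiv.Perm (Fin 5) := ⟨![1, 4, 3, 2, 0], ![4, 0, 3, 2, 1], by decide, by decide⟩
def σ1 : Equiv.Perm (Fin 5) := ⟨![2, 4, 3, 1, 0], ![4, 3, 0, 2, 1], by decide, by decide⟩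
def σ2 : Equiv.Perm (Fin 5) := ⟨![3, 4, 2, 1, 0], ![4, 3, 2, 0, 1], by decide, by decide⟩
def σ3 : Equiv.Perm (Fin 5) := ⟨![4, 3, 2, 1, 0], ![4, 3, 2, 1, 0], by decide, by decide⟩

/-- THEOREM C step (2): `D₅ ∈ L(U)` forces ALIGNMENT. -/
theorem aligned_of_hubD {θ : Fin 5 → ℂ} {C : Fin 4 → Fin 5 → Fin 5 → ℂ} (hD : HubD θ C) : Aligned θ C := by
  intro l hl hl0
  have HDl : ∀ x0 x1 x2 x3 : Fin 5 → ℂ, (∑ b, nvec (C 0) l b * x0 b) = 0 →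
      (∑ b, nvec (C 1) l b * x1 b) = 0 → (∑ b, nvec (C 2) l b * x2 b) = 0 →
      (∑ b, nvec (C 3) l b * x3 b) = 0 → Matrix.det (Matrix.of ![l, x0, x1, x2, x3]) = 0 := by
    intro x0 x1 x2 x3 h0 h1 h2 h3
    exact hD.eval l x0 x1 x2 x3 hl (by rw [bil_eq]; exact h0) (by rw [bil_eq]; exact h1)
      (by rw [bil_eq]; exact h2) (by rw [bil_eq]; exact h3)
  have P0 : ∀ a b c d : Fin 5 → ℂ, (∑ i, nvec (C 1) l i * a i) = 0 → (∑ i, nvec (C 2) l i * b i) = 0 →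
      (∑ i, nvec (C 3) l i * c i) = 0 → (∑ i, nvec (C 0) l i * d i) = 0 →
      Matrix.det (Matrix.of ![d, c, b, a, l]) = 0 := by
    intro a b c d ha hb hc hd
    have h := det_rows_perm _ σ0 (HDl d a b c hd ha hb hc)
    have e : (Matrix.of ![l, d, a, b, c]).submatrix σ0 id = Matrix.of ![d, c, b, a, l] := by
      ext i j; fin_cases i <;> rfl
    rw [e] at h; exact h
  have P1 : ∀ a b c d : Fin 5 → ℂ, (∑ i, nvec (C 0) l i * a i) = 0 → (∑ i, nvec (C 2) l i * b i) = 0 →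
      (∑ i, nvec (C 3) l i * c i) = 0 → (∑ i, nvec (C 1) l i * d i) = 0 →
      Matrix.det (Matrix.of ![d, c, b, a, l]) = 0 := by
    intro a b c d ha hb hc hd
    have h := det_rows_perm _ σ1 (HDl a d b c ha hd hb hc)
    have e : (Matrix.of ![l, a, d, b, c]).submatrix σ1 id = Matrix.of ![d, c, b, a, l] := by
      ext i j; fin_cases i <;> rfl
    rw [e] at h; exact h
  have P2 : ∀ a b c d : Fin 5 → ℂ, (∑ i, nvec (C 0) l i * a i) = 0 → (∑ i, nvec (C 1) l i * b i) = 0 →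
      (∑ i, nvec (C 3) l i * c i) = 0 → (∑ i, nvec (C 2) l i * d i) = 0 →
      Matrix.det (Matrix.of ![d, c, b, a, l]) = 0 := by
    intro a b c d ha hb hc hd
    have h := det_rows_perm _ σ2 (HDl a b d c ha hb hd hc)
    have e : (Matrix.of ![l, a, b, d, c]).submatrix σ2 id = Matrix.of ![d, c, b, a, l] := by
      ext i j; fin_cases i <;> rfl
    rw [e] at h; exact h
  have P3 : ∀ a b c d : Fin 5 → ℂ, (∑ i, nvec (C 0) l i * a i) = 0 → (∑ i, nvec (C 1) l i * b i) = 0 →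
      (∑ i, nvec (C 2) l i * c i) = 0 → (∑ i, nvec (C 3) l i * d i) = 0 →
      Matrix.det (Matrix.of ![d, c, b, a, l]) = 0 := by
    intro a b c d ha hb hc hd
    have h := det_rows_perm _ σ3 (HDl a b c d ha hb hc hd)
    have e : (Matrix.of ![l, a, b, c, d]).submatrix σ3 id = Matrix.of ![d, c, b, a, l] := by
      ext i j; fin_cases i <;> rfl
    rw [e] at h; exact h
  obtain ⟨hn0, hl0', -⟩ := align_core l hl0 _ _ _ _ P0
  have i1 := (align_core l hl0 _ _ _ _ P1).2.2
  have i2 := (align_core l hl0 _ _ _ _ P2).2.2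
  have i3 := (align_core l hl0 _ _ _ _ P3).2.2
  refine ⟨hn0, hl0', fun k x hx => ?_⟩
  fin_cases k
  · exact hx
  · exact i1 x hx
  · exact i2 x hx
  · exact i3 x hx

/-- THEOREM C: K1 on the ENTIRE hub profile — a hub-profile configuration carrying `D₅` does not carry
`P₅` (arbitrary slice covector `θ`, arbitrary bilinear ray short factors `C k`, long factors free). -/
theorem K1_hubProfile (θ : Fin 5 → ℂ) (C : Fin 4 → Fin 5 → Fin 5 → ℂ) (hD : HubD θ C) (hP : HubP θ C) :
    False :=
  K1_hub_of_aligned (aligned_of_hubD hD) hP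

/-! ## §12 `levW` IS the sketch's Levi-Civita table `sgn5`; NON-VACUITY of THEOREM C

The tables `sg`, `sgn5`, `Om`, `thom` and the identity `hub_design` are verbatim copies of
`SignPencilSketch` §0 (there: `hub_design`, the determinant's honest weight-72 hub design).  New here:
`levW = sgn5` on every word (`levW_eq_sgn5`, via `Matrix.det_permutation` and a 120-case `decide`), hence
the hub configuration `(θ; ω, ω, ω, ω)` is a `HubD` instance (`hubD_hub`) — THEOREM C is not vacuous — and,
as a consistency check, `K1_hubProfile` re-derives `¬ HubP` for it (`hub_not_HubP`, = Theorem A at `G = 1`). -/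

/-- sign of an ordered pair of letters (sketch §0). -/
def sg (x y : Fin 5) : ℤ := if x < y then 1 else if y < x then -1 else 0

/-- the Levi-Civita pattern `D₅` as the sketch's integer table (sketch §0). -/
def sgn5 (a b c d e : Fin 5) : ℤ :=
  sg a b * sg a c * sg a d * sg a e * sg b c * sg b d * sg b e * sg c d * sg c e * sg d e

/-- `Ω = ω∧ω/2` (sketch §0). -/
def Om (b c d e : Fin 5) : ℤ := om b c * om d e - om b d * om c e + om b e * om c d

/-- `θ∧ω` (sketch §0). -/
def thom (x y z : Fin 5) : ℤ := th x * om y z - th y * om x z + th z * om x y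

set_option maxHeartbeats 4000000 in
/-- the determinant's honest HUB DESIGN of weight 72 (sketch §0 `hub_design`, verbatim). -/
theorem hub_design : ∀ a b c d e : Fin 5,
    th a * Om b c d e + om a b * thom c d e - om a c * thom b d e + om a d * thom b c e
      - om a e * thom b c d = sgn5 a b c d e := by decide

set_option maxRecDepth 200000 in
set_option maxHeartbeats 4000000 in
/-- `sgn5` restricted to bijective words is the sign character (120 cases). -/
theorem sgn5_perm : ∀ σ : Equiv.Perm (Fin 5),
    sgn5 (σ 0) (σ 1) (σ 2) (σ 3) (σ 4) = (Equiv.Perm.sign σ : ℤ) := by decide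

set_option maxHeartbeats 4000000 in
/-- `sgn5` vanishes on words with a repeated letter. -/
theorem sgn5_rep : ∀ i j : Fin 5, i ≠ j → ∀ a b c d e : Fin 5,
    (![a, b, c, d, e] i = ![a, b, c, d, e] j) → sgn5 a b c d e = 0 := by decide

/-- `levW` of a bijective word is the sign of the permutation (`Matrix.det_permutation`). -/
theorem levW_perm (σ : Equiv.Perm (Fin 5)) : levW ⇑σ = ((Equiv.Perm.sign σ : ℤ) : ℂ) := by
  rw [levW_eq_det]
  have h := Matrix.det_permutation (R := ℂ) σ
  have e : (Matrix.of fun i j => if j = σ i then (1:ℂ) else 0) = σ.permMatrix ℂ := by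
    ext i j
    simp [Equiv.Perm.permMatrix, PEquiv.toMatrix_apply, Equiv.toPEquiv_apply, eq_comm]
  rw [e, h]

theorem eta5 (r : Fin 5 → Fin 5) : ![r 0, r 1, r 2, r 3, r 4] = r := by
  ext i; fin_cases i <;> rfl

/-- BRIDGE: the companion's `levW` (determinant of the `0/1` word matrix) is the sketch's table `sgn5`. -/
theorem levW_eq_sgn5 (r : Fin 5 → Fin 5) :
    levW r = ((sgn5 (r 0) (r 1) (r 2) (r 3) (r 4) : ℤ) : ℂ) := by
  by_cases hr : Function.Injective r
  · have hb : Function.Bijective r := hr.bijective_of_finite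
    have h1 := levW_perm (Equiv.ofBijective r hb)
    have h2 := sgn5_perm (Equiv.ofBijective r hb)
    simp only [Equiv.coe_ofBijective] at h1 h2
    rw [h1, h2]
  · have hr' := hr
    rw [Function.Injective] at hr'
    push Not at hr'
    obtain ⟨i, j, hij, hne⟩ := hr'
    have h0 : levW r = 0 := by
      rw [levW_eq_det]
      exact Matrix.det_zero_of_row_eq hne (funext fun k => by simp [Matrix.of_apply, hij])
    have h5 : sgn5 (r 0) (r 1) (r 2) (r 3) (r 4) = 0 :=
      sgn5_rep i j hne (r 0) (r 1) (r 2) (r 3) (r 4) (by rw [eta5]; exact hij)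
    rw [h0, h5]
    simp

/-- `levW` on explicit words, for use with the sketch's data format. -/
theorem levW_word (a b c d e : Fin 5) : levW ![a, b, c, d, e] = ((sgn5 a b c d e : ℤ) : ℂ) := by
  rw [levW_eq_sgn5]
  simp only [Matrix.cons_val_zero, Matrix.cons_val_one, Matrix.cons_val_two, Matrix.cons_val_three,
    Matrix.cons_val_four, Matrix.head_cons, Matrix.tail_cons]

/-- NON-VACUITY of THEOREM C: the hub configuration `(θ; ω, ω, ω, ω)` of the sketch carries `D₅`, i.e. is a
`HubD` instance (long factors `Ω` and `±θ∧ω`: the weight-72 hub design). -/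
theorem hubD_hub : HubD (fun a => (th a : ℂ)) (fun _ a b => (om a b : ℂ)) := by
  refine ⟨fun b c d e => (Om b c d e : ℂ), ![fun c d e => (thom c d e : ℂ), fun b d e => -(thom b d e : ℂ),
    fun b c e => (thom b c e : ℂ), fun b c d => -(thom b c d : ℂ)], ?_⟩
  intro a b c d e
  rw [levW_word, ← hub_design a b c d e]
  simp only [Matrix.cons_val_zero, Matrix.cons_val_one, Matrix.cons_val_two, Matrix.cons_val_three,
    Matrix.head_cons, Matrix.tail_cons]
  push_cast
  ring

/-- consistency check: THEOREM C re-derives that the hub configuration itself carries no `P₅`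
(Theorem A at `G = 1`; the sketch's `hub_configuration_misses_P5`). -/
theorem hub_not_HubP : ¬ HubP (fun a => (th a : ℂ)) (fun _ a b => (om a b : ℂ)) :=
  fun hP => K1_hubProfile _ _ hubD_hub hP

/-! ### sanity: `levW` is the Levi-Civita table -/

example : levW ![0, 1, 2, 3, 4] = 1 := by
  rw [levW_eq_det]
  have : (Matrix.of fun i j => if j = (![0, 1, 2, 3, 4] : Fin 5 → Fin 5) i then (1:ℂ) else 0)
      = (1 : Matrix (Fin 5) (Fin 5) ℂ) := by
    ext i j
    fin_cases i <;> fin_cases j <;> simp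
  rw [this, Matrix.det_one]

example : levW ![0, 0, 2, 3, 4] = 0 := by
  rw [levW_eq_det]
  exact Matrix.det_zero_of_row_eq (i := 0) (j := 1) (by decide) (by ext j; simp)

example : levW ![1, 0, 2, 3, 4] = -1 := by
  rw [levW_eq_det]
  have : (Matrix.of fun i j => if j = (![1, 0, 2, 3, 4] : Fin 5 → Fin 5) i then (1:ℂ) else 0)
      = ((1 : Matrix (Fin 5) (Fin 5) ℂ).submatrix (Equiv.swap 0 1) id) := by
    ext i j
    fin_cases i <;> fin_cases j <;>
      simp [Matrix.one_apply, Equiv.swap_apply_left, Equiv.swap_apply_right, Equiv.swap_apply_of_ne_of_ne]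
  rw [this, Matrix.det_permute, Matrix.det_one, Equiv.Perm.sign_swap (by decide)]
  simp

/-! ## 13. PRICE b1 (crit-3 g7, 04:19:47Z): `chow 1` IS the pattern `P₅` on ALL 3125 words

`chow_one_word : chow 1 a b c d e = if Function.Injective ![a,b,c,d,e] then 1 else 0` — the bridge from the
Ryser/Chow currency of THEOREMS A–C (`chow G`, `G = 1`) to the `if Function.Injective v then 1 else 0` currency of
the crux `LaplaceOptimalFive` / `DFeasibleLO5On`.  Structural proof (no table): at `G = 1` the Ryser row sums are
the bits, `rd ε 1 x = ε_x`, so `chow 1 w = Σ_ε (−1)^{5−|ε|} Π_i ε_{w_i}`; if a letter `x` is missing from the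
word, bflipping the bit `ε_x` is a sign-reversing involution with the product unchanged (sum `= 0`); if the word is
injective it is a permutation `σ` and reindexing `ε ↦ ε∘σ⁻¹` reduces to the identity word, where the value is `1`. -/

theorem rd_one (ε : Fin 5 → Fin 2) (x : Fin 5) : rd ε 1 x = ((ε x).val : ℂ) := by
  simp [rd, edot_eq_sum, Matrix.one_apply]

theorem chow_one_fun (w : Fin 5 → Fin 5) :
    chow 1 (w 0) (w 1) (w 2) (w 3) (w 4) = ∑ ε : Fin 5 → Fin 2, rsgn ε * ∏ i, ((ε (w i)).val : ℂ) := by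
  unfold chow
  refine Finset.sum_congr rfl (fun ε _ => ?_)
  simp only [rd_one, Fin.prod_univ_five]; ring

/-- the Ryser sign as a product of `±1` over the bits. -/
theorem rsgn_prod (ε : Fin 5 → Fin 2) : rsgn ε = ∏ j, (2 * ((ε j).val : ℂ) - 1) := by
  rw [Fin.prod_univ_five]; unfold rsgn
  have key : ∀ t0 t1 t2 t3 t4 : Fin 2,
      ((-1 : ℂ)) ^ (5 - (t0.val + t1.val + t2.val + t3.val + t4.val))
        = (2 * (t0.val : ℂ) - 1) * (2 * (t1.val : ℂ) - 1) * (2 * (t2.val : ℂ) - 1)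
          * (2 * (t3.val : ℂ) - 1) * (2 * (t4.val : ℂ) - 1) := by
    intro t0 t1 t2 t3 t4
    fin_cases t0 <;> fin_cases t1 <;> fin_cases t2 <;> fin_cases t3 <;> fin_cases t4 <;> norm_num
  exact key _ _ _ _ _

/-- value at the identity word: `chow 1 (0,1,2,3,4) = 1`. -/
theorem chow_one_id : ∑ ε : Fin 5 → Fin 2, rsgn ε * ∏ i, ((ε i).val : ℂ) = 1 := by
  have h := chow_one_fun id
  simp only [id] at h
  rw [← h]
  unfold chow
  rw [show (∑ ε : Fin 5 → Fin 2, rsgn ε * (rd ε 1 0 * (rd ε 1 1 * rd ε 1 2 * rd ε 1 3 * rd ε 1 4)))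
      = ∑ ε : Fin 5 → Fin 2, rsgn ε * (((ε 0).val : ℂ) * (((ε 1).val : ℂ) * ((ε 2).val : ℂ)
          * ((ε 3).val : ℂ) * ((ε 4).val : ℂ))) from Finset.sum_congr rfl (fun ε _ => by simp only [rd_one])]
  rw [Fintype.sum_eq_single (fun _ => (1 : Fin 2))]
  · simp [rsgn]
  · intro ε hε
    have : ∃ j, ε j = 0 := by
      by_contra hcon
      push Not at hcon
      apply hε; funext j
      have := hcon j
      rcases Fin.exists_fin_two.mp ⟨ε j, rfl⟩ with h0 | h1
      · exact absurd h0 this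
      · exact h1
    obtain ⟨j, hj⟩ := this
    fin_cases j <;> simp_all

/-- bflipping one bit. -/
def bflip (x : Fin 5) (ε : Fin 5 → Fin 2) : Fin 5 → Fin 2 := Function.update ε x (1 - ε x)

theorem bflip_bflip (x : Fin 5) (ε : Fin 5 → Fin 2) : bflip x (bflip x ε) = ε := by
  funext j
  unfold bflip
  by_cases h : j = x
  · subst h; simp
  · simp [Function.update_of_ne h]

theorem bflip_ne (x : Fin 5) (ε : Fin 5 → Fin 2) : bflip x ε ≠ ε := by
  intro h
  have h1 := congrFun h x
  simp only [bflip, Function.update_self] at h1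
  have : ∀ t : Fin 2, 1 - t ≠ t := by decide
  exact this _ h1

theorem rsgn_flip (x : Fin 5) (ε : Fin 5 → Fin 2) : rsgn (bflip x ε) = -rsgn ε := by
  rw [rsgn_prod, rsgn_prod]
  have hb : ∀ t : Fin 2, (2 * (((1 - t : Fin 2)).val : ℂ) - 1) = -(2 * (t.val : ℂ) - 1) := by
    intro t; fin_cases t <;> norm_num
  rw [Finset.prod_eq_mul_prod_sdiff_singleton_of_mem (Finset.mem_univ x)
        (fun j => 2 * (((bflip x ε) j).val : ℂ) - 1),
    Finset.prod_eq_mul_prod_sdiff_singleton_of_mem (Finset.mem_univ x) (fun j => 2 * ((ε j).val : ℂ) - 1)]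
  have h1 : (2 * (((bflip x ε) x).val : ℂ) - 1) = -(2 * ((ε x).val : ℂ) - 1) := by
    simp only [bflip, Function.update_self]; exact hb _
  have h2 : ∏ j ∈ Finset.univ \ {x}, (2 * (((bflip x ε) j).val : ℂ) - 1)
      = ∏ j ∈ Finset.univ \ {x}, (2 * ((ε j).val : ℂ) - 1) := by
    refine Finset.prod_congr rfl (fun j hj => ?_)
    have hjx : j ≠ x := by simpa using hj
    simp [bflip, Function.update_of_ne hjx]
  rw [h1, h2]; ring

/-- a word missing the letter `x`: the Chow value vanishes (bit-bflip involution). -/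
theorem chow_one_missing (w : Fin 5 → Fin 5) (x : Fin 5) (hx : ∀ i, w i ≠ x) :
    ∑ ε : Fin 5 → Fin 2, rsgn ε * ∏ i, ((ε (w i)).val : ℂ) = 0 := by
  refine Finset.sum_involution (fun ε _ => bflip x ε) ?_ ?_ ?_ ?_
  · intro ε _
    have hp : ∏ i, (((bflip x ε) (w i)).val : ℂ) = ∏ i, ((ε (w i)).val : ℂ) := by
      refine Finset.prod_congr rfl (fun i _ => ?_)
      simp [bflip, Function.update_of_ne (hx i)]
    rw [hp, rsgn_flip]; ring
  · intro ε _ _; exact bflip_ne x ε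
  · intro ε _; exact Finset.mem_univ _
  · intro ε _; exact bflip_bflip x ε

/-- an injective word is a permutation; reindexing the bits reduces to the identity word. -/
theorem chow_one_perm (σ : Equiv.Perm (Fin 5)) :
    ∑ ε : Fin 5 → Fin 2, rsgn ε * ∏ i, ((ε (σ i)).val : ℂ) = 1 := by
  rw [← chow_one_id]
  rw [← Equiv.sum_comp (Equiv.arrowCongr σ (Equiv.refl (Fin 2)))
        (fun ε : Fin 5 → Fin 2 => rsgn ε * ∏ i, ((ε (σ i)).val : ℂ))]
  refine Finset.sum_congr rfl (fun ε _ => ?_)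
  have hs : rsgn (Equiv.arrowCongr σ (Equiv.refl (Fin 2)) ε) = rsgn ε := by
    rw [rsgn_eq, rsgn_eq]
    congr 2
    simp only [Equiv.arrowCongr_apply, Equiv.coe_refl, Function.comp_apply, id]
    exact Equiv.sum_comp σ.symm (fun x => (ε x).val)
  rw [hs]
  congr 1
  refine Finset.prod_congr rfl (fun i _ => ?_)
  simp

/-- PRICE b1: `chow 1 = P₅` word by word. -/
theorem chow_one_word (a b c d e : Fin 5) :
    chow 1 a b c d e = if Function.Injective ![a, b, c, d, e] then 1 else 0 := by
  have h := chow_one_fun ![a, b, c, d, e]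
  simp only [Matrix.cons_val_zero, Matrix.cons_val_one, Matrix.cons_val_two, Matrix.cons_val_three,
    Matrix.cons_val_four, Matrix.head_cons, Matrix.tail_cons] at h
  rw [h]
  split_ifs with hinj
  · obtain ⟨σ, hσ⟩ : ∃ σ : Equiv.Perm (Fin 5), ⇑σ = ![a, b, c, d, e] :=
      ⟨Equiv.ofBijective _ (Finite.injective_iff_bijective.mp hinj), rfl⟩
    rw [← hσ]; exact chow_one_perm σ
  · have hs : ¬ Function.Surjective ![a, b, c, d, e] := fun hs =>
      hinj (Finite.injective_iff_surjective.mpr hs)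
    obtain ⟨x, hx⟩ : ∃ x, ∀ i, (![a, b, c, d, e] : Fin 5 → Fin 5) i ≠ x := by
      simp only [Function.Surjective, not_forall, not_exists] at hs
      exact hs
    exact chow_one_missing _ x hx


/-- `P₅ ∈ L(U)` on the hub profile, in the WORD CURRENCY of the crux (`if Function.Injective v then 1 else 0`). -/
def HubPword (θ : Fin 5 → ℂ) (C : Fin 4 → Fin 5 → Fin 5 → ℂ) : Prop :=
  ∃ (Y : Fin 5 → Fin 5 → Fin 5 → Fin 5 → ℂ) (W : Fin 4 → Fin 5 → Fin 5 → Fin 5 → ℂ),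
    ∀ a b c d e, (if Function.Injective ![a, b, c, d, e] then (1 : ℂ) else 0)
      = θ a * Y b c d e + C 0 a b * W 0 c d e + C 1 a c * W 1 b d e + C 2 a d * W 2 b c e + C 3 a e * W 3 b c d

theorem hubP_iff_word (θ : Fin 5 → ℂ) (C : Fin 4 → Fin 5 → Fin 5 → ℂ) : HubP θ C ↔ HubPword θ C := by
  unfold HubP HubPword
  simp only [chow_one_word]

/-- THEOREM C in the crux currency: `D₅ ∈ L(U)` (`levW`/`sgn5`, bridged by `levW_word`) and `P₅ ∈ L(U)`
(`if Function.Injective v then 1 else 0`) cannot both hold on the hub profile `{0},{01},{02},{03},{04}`. -/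
theorem K1_hubProfile_word (θ : Fin 5 → ℂ) (C : Fin 4 → Fin 5 → Fin 5 → ℂ)
    (hD : HubD θ C) (hP : HubPword θ C) : False :=
  K1_hubProfile θ C hD ((hubP_iff_word θ C).mpr hP)

end Summit.ValiantsHypothesis.ValiantsHypothesis.Cruxes.LaplaceOptimalFive.SignPencil.ChowClass
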